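import Summits.KontsevichZagierPeriods.KontsevichZagierPeriods.Theses.LinRedNormalForm
import Literature.NumberTheory.Transcendental.KZCalculusProofs
import Literature.NumberTheory.Transcendental.MZVSimplexRep
import Literature.NumberTheory.Transcendental.MZVSimplexRepProofs
import Literature.NumberTheory.Transcendental.MultipleZetaValuesProofs
import Literature.NumberTheory.Transcendental.LindemannWeierstrassProofs
import Literature.NumberTheory.Transcendental.KZUnfolding
import Literature.Barriers.KontsevichZagierPeriods.AlgebraicPrimitivesObstruction
import Literature.NumberTheory.Transcendental.KZSliceFubini
import Summits.KontsevichZagierPeriods.KontsevichZagierPeriods.Theorems.MzvKernelInKZ.Negative.Divergence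

/-!
# Disproof work file for the crux `DihedralNormalForm` (cdisprove, generations 2–3)

Crux item `stmt-KontsevichZagierPeriods-3912` =
`Summit.KontsevichZagierPeriods.KontsevichZagierPeriods.Theses.LinRedNormalForm.DihedralNormalForm`:
every absolutely convergent genus-zero representation `[Δ_k, P/(∏ tᵢ^{bᵢ} ∏ (1-tᵢ)^{cᵢ}
∏_{i<j} (tᵢ-tⱼ)^{aᵢⱼ})]` is congruent modulo `KZ.relations` to a `ℤ`-combination of MZV word
representations `[Δ_w, q · ∏ ω_{εᵢ}(tᵢ)]`.

## Findings of generation 3 (2026-08-16; sections §4–§5, all `lean check` rc 0)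

* §4 `dihedralNormalForm_false_without_newtonLeibniz` — RULE (3) IS LOAD-BEARING, certified:
  the dimension-graded evaluation `evalDim d : FormalRep →+ ℝ` kills the sub-calculus
  (1a)+(1b)+(2) (`relationsWithoutNL_le_ker_evalDim`) and the word closure in degree `1`, while
  `evalDim 1 [Δ₁,1] = 1` (witness `oneRep`, `oneRep_value`). Also `not_cruxHomogeneousAt_one`
  (words of length exactly `k` fail at `k = 1`). Both re-establish generation 1's lost theorems
  with the simplest witness; sorry-free, to be landed under `Theorems/DihedralNormalForm/Negative/`.
* §5 + §9 RULE (2) IS LOAD-BEARING — CERTIFIED (`dihedralNormalForm_false_without_changeOfVariables`,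
  proved in §9 `RuleTwo.not_cruxWithoutChangeOfVariables`, sorry-free, standard axioms; the paper
  proof is the §5 docstring): witness `letterRep = [Δ₂, 1/(1-t₁)]` (constructed, `isGenusZero_letterRep`,
  integrable by domination `integrableOn_one_div_one_sub`); invariant = push-forward of `f·λ|_σ`
  to the first two coordinates modulo low-dimensional Newton–Leibniz differences; the word side is
  eliminated by its `1/x₀`-homogeneity, and the contradiction is the barrier's simple-pole descent
  (`no_semialgebraic_primitive_letter`, PROVED here for both letters from
  `Literature.Barriers…AlgebraicPrimitivesObstruction`). With rule (2) the witness closes in four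
  moves using one TRANSPOSITION: the indispensable part of rule (2) is `KZ.permRel`.
  Structural corollaries recorded in §5: rule (1b) is derivable from (1a)+(3) (never
  load-bearing); rule (1a) is not derivable from the others; OPEN `CruxWithPermutations`.
* §7 `no_linearCombination_algebraic_primitive(_letter)` — the ELIMINATION step of §5 certified:
  no ℝ-linear combination of pointwise-algebraic functions is a primitive of a simple pole
  (integrality over `ℝ[t]` in the function ring + the barrier descent on any interval); landed as
  `Negative/LinearCombinationPrimitive.lean` (p76814).
* §8 `exists_ne_zero_evalEval_slice` — slices `x₁ ↦ F(r,x₁)` of `ℚ`-semialgebraic primitives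
  satisfy REAL polynomial relations for every real `r` (steps (A)–(B) of the barrier over `ℝ`);
  landed as `Negative/SliceRelations.lean` (p77035).
* §10 `cruxWithoutChangeOfVariables_mirror` — TIGHTNESS: the mirror witness `[Δ₂, 1/t₀]` DOES
  close without rule (2) (six (1a)/(3) instances, certified): the obstruction is exactly a transposition.
* §9 `RuleTwo.*` — the measure-theoretic part: two-coordinate slices, densities, the invariant
  `FormalRep →+ (ℝ² → ℝ) ⧸ (Nul ⊔ Dsub)` killing `closure(1a ∪ 1b ∪ 3)`, extraction along two
  generic lines, FTC upgrade, and the final contradiction. THIS FILE HAS NO `sorry`.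
* §6 `integrandAddRel_subset_closure`, `relations_eq_closure_three` — RULE (1b) IS DERIVABLE
  FROM (1a)+(3), certified (mixing band with polynomial primitive): `relations = closure(1a ∪ 2 ∪ 3)`;
  an invariant finer than `eval` need only be tested on (1a), (2), (3). Landed as
  `Theorems/DihedralNormalForm/Negative/RuleOneBDerivable.lean` (p75454).

## Findings of generation 2 (see `## Provenance` for generation 1)

* §1 `valueLevel_of_crux`, `crux_of_summit_of_valueLevel` — the SANDWICH, re-proved here
  self-containedly: the crux implies its value-level shadow `ValueLevel` (every genus-zero value lies
  in the subgroup generated by the values of word representations = Brown's theorem, ENS 2009,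
  Thm 1.1, NOT in the tree) by soundness, and the summit `KontsevichZagierPeriods` together with
  `ValueLevel` implies the crux. Consequence: a refutation of the crux is a refutation of
  Conjecture 1 itself restricted to one genus-zero pair, i.e. an additive invariant of
  `KZ.relations` finer than `KZ.eval` (route Neg, `NegObstructionShape`); no value-level
  counterexample can exist.
* §2 `not_cruxWeightBelow` — TIGHTNESS of Brown's weight bound: the strengthening "the words may
  be taken of length `< k`" is FALSE at `k = 2` (`[Δ₂, 1/(t₀(1-t₁))]`, value `π²/6`; words of
  length `0` are rational constants, words of length `1` do not converge; `π` transcendental,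
  `Literature…transcendental_pi_holds`). Together with generation 1's refutation of the
  weight-HOMOGENEOUS strengthening (words of length exactly `k`, false at `k = 1, 2`) this pins the
  normal form: it must mix the weights `0 … k` and must reach weight `k`.
* Docstrings of §3 record the hand analysis of the cycle-2 regime (corner-paired integrands,
  depth ≥ 2, `(t₀ - t₂)^{-2}` with numerators): explicit CONVERGENT move chains, the cubical
  engine, and why no candidate counterexample pair was found; §3.0 the reduction of the crux to
  DIHEDRAL MONOMIALS (Brown's `f ∈ ℚ[u_{ij}]`, a 1b-chain); §3.6 the `kit`/local experiment
  `gzred`: every dihedral monomial with `k = 2, |α| ≤ 9` (236 orbits) and 25/33 orbits with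
  `k = 3, |α| ≤ 3` (rest pending CPU, none stuck) reduces to words with convergent
  intermediates; the one systematic trap found (the `D₅`-invariant monomial) and its cure
  (endpoint-vanishing primitives, `chainD_*`).

## Why it resists (summary for the lead)

(1) Value level is a theorem (Brown).  (2) Any kill needs an additive move-invariant finer than
`eval`; the invariant-like functionals found — `χ(σ)·∫_σ f` with `χ` the o-minimal Euler
characteristic (kills rules 1b, 2, 3, NOT 1a), `evalDim` (§4: kills 1a, 1b, 2, NOT 3) and the
coordinate push-forwards of §5 (kill 1a, 1b, 3, NOT 2 — they die under a transposition) — each die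
on exactly one rule; by §5 (iii) rule (1b) can never be the rule an invariant dies on, so a kill of
the crux is an additive functional that is measure-like in `σ` (1a), Fubini/FTC-compatible in the
last coordinate (3) and invariant under semialgebraic diffeomorphisms (2), yet not a multiple of
`eval` on genus-zero pairs: none is known, and what the `χ`-invariant would separate is blocked by
open transcendence questions anyway (`1 ∉ ℚ⟨odd-weight MZVs⟩`).  (3) In every instance computed by hand (all `k ≤ 3` shapes tried,
including both-corner pairings and `(t₀-t₂)^{-2}` with numerators) a convergent chain exists; the
working engine is: cubical chart `tᵢ = x₁⋯x_{i+1}` (rule 2) → Newton–Leibniz along a variable in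
which the integrand has a pole of order ≥ 2 or polynomial dependence, applied to the EXACT part
only (rule 3 with rational primitive; the base integrand is automatically absolutely convergent,
being the fibre integral) → lump the simple-pole remainder (rule 1b; convergent as a whole) →
projective / duplication changes of variables to re-simplexify sub-cells.  The genuinely delicate
point is not convergence of NL outputs (automatic) but the 1b-SPLITS: a partial-fraction split of
a convergent integrand can have divergent summands at a corner of `M̄_{0,n}`; one must split into
`exact part + (sum of the rest)` only, and choose the fibre variable / chart so that the exact
part alone converges.  No instance where every chart fails is known to us.

## Provenance

Generation 1 (agent `refuter-cdisprove-stmt-KontsevichZagierPeriods-3912-0`, evidence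
`Disproof.lean` v1–v5 on the item, 2026-08-15T22:24–22:40Z) proved, sorry-free: the sandwich
(first version), `dihedralNormalForm_dim_zero` (k = 0 holds), non-vacuity `zetaTwoRep`,
`no_semialgebraic_primitive_letter_one` (folding the last letter of the ζ(2) band by rule 3 is
impossible; barrier `noSemialgebraicPrimitive_inv_sub_two` transferred),
`dihedralNormalForm_false_without_newtonLeibniz` (invariant `evalDim`),
`not_dihedralNormalFormHomogeneous` (k = 1) and `dihedralNormalFormHomogeneous_false_at_two`, and
documented a 7-move convergent chain for `[Δ₃, 1/(t₁(1-t₁)(t₀-t₂))] ≡ 2·[ζ(2) word]`.  That file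
is not readable from this generation's jail (evidence store not mounted); the present file is
self-contained and does not re-prove those items except the sandwich.
-/

noncomputable section

set_option linter.dupNamespace false

open MeasureTheory Set
open Literature.NumberTheory.Transcendental

namespace Summit.KontsevichZagierPeriods.KontsevichZagierPeriods.Cruxes.DihedralNormalForm.Disproof

variable {n : ℕ}

open Summit.KontsevichZagierPeriods.KontsevichZagierPeriods.Theses.LinRedNormalForm
  (DihedralNormalForm)

/-! ## §0 The crux, its hypothesis and its target set, named -/

/-- The open ordered simplex `{1 > t₀ > ⋯ > t_{k-1} > 0}` exactly as inlined in the route file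
(definitionally `KZ.openOrderedSimplex k`). [folklore] -/
def simplex (k : ℕ) : Set (Fin k → ℝ) := {t | (∀ i, 0 < t i) ∧ (∀ i, t i < 1) ∧ StrictAnti t}

theorem simplex_eq_openOrderedSimplex (k : ℕ) : simplex k = KZ.openOrderedSimplex k := rfl

/-- The genus-zero integrand of the crux, as inlined in the route file. [folklore] -/
def gzIntegrand (k : ℕ) (p : MvPolynomial (Fin k) ℚ) (a : Fin k → Fin k → ℕ) (b c : Fin k → ℕ)
    (t : Fin k → ℝ) : ℝ :=
  MvPolynomial.aeval t p / ((∏ i, t i ^ b i) * (∏ i, (1 - t i) ^ c i) *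
    ∏ i, ∏ j, if i < j then (t i - t j) ^ a i j else 1)

/-- Hypothesis of the crux on a representation `r`: genus-zero shape on the open simplex. [folklore] -/
def IsGenusZero {k : ℕ} (r : KZ.IntegralRep k) : Prop :=
  ∃ (p : MvPolynomial (Fin k) ℚ) (a : Fin k → Fin k → ℕ) (b c : Fin k → ℕ),
    r.domain = simplex k ∧ EqOn r.integrand (gzIntegrand k p a b c) r.domain

/-- The MZV word representations (generators of the target subgroup of the crux). [folklore] -/
def wordRepSet : Set KZ.FormalRep :=
  {x | ∃ (w : ℕ) (ε : Fin w → Bool) (q : ℚ) (s : KZ.IntegralRep w),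
    s.domain = simplex w ∧
    EqOn s.integrand (fun t => (q : ℝ) * ∏ i, if ε i then 1 / (1 - t i) else 1 / t i) s.domain ∧
    x = KZ.of s}

/-- The VALUES of the MZV word representations. [folklore] -/
def wordValueSet : Set ℝ :=
  {x | ∃ (w : ℕ) (ε : Fin w → Bool) (q : ℚ) (s : KZ.IntegralRep w),
    s.domain = simplex w ∧
    EqOn s.integrand (fun t => (q : ℝ) * ∏ i, if ε i then 1 / (1 - t i) else 1 / t i) s.domain ∧
    x = s.value}

/-- The crux, restated through the names above (definitionally the route decl). [folklore] -/
theorem crux_iff :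
    DihedralNormalForm ↔ ∀ (k : ℕ) (r : KZ.IntegralRep k), IsGenusZero r →
      ∃ m ∈ AddSubgroup.closure wordRepSet, KZ.of r - m ∈ KZ.relations := by
  constructor
  · intro h k r ⟨p, a, b, c, hdom, hint⟩
    exact h k r p a b c hdom hint
  · intro h k r p a b c hdom hint
    exact h k r ⟨p, a, b, c, hdom, hint⟩

/-! ## §1 The sandwich: crux ⇒ value level; summit ∧ value level ⇒ crux -/

/-- **Value-level shadow of the crux** (Brown's theorem in this typing, [BrownENS2009, Thm 1.1]:
the value of every absolutely convergent genus-zero representation lies in the subgroup of `ℝ`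
generated by the values `q·ζ(ε)` of the MZV word representations, i.e. in the `ℚ`-span of the
MZVs and `1`). NOT proved in the tree; it is the printed theorem. [cite: BrownENS2009, Thm 1.1] -/
def ValueLevel : Prop :=
  ∀ (k : ℕ) (r : KZ.IntegralRep k), IsGenusZero r → r.value ∈ AddSubgroup.closure wordValueSet

/-- Soundness transports the target subgroup onto its values. [folklore] -/
theorem eval_mem_closure_wordValueSet {m : KZ.FormalRep} (hm : m ∈ AddSubgroup.closure wordRepSet) :
    KZ.eval m ∈ AddSubgroup.closure wordValueSet := by
  induction hm using AddSubgroup.closure_induction with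
  | mem x hx =>
    obtain ⟨w, ε, q, s, hdom, hint, rfl⟩ := hx
    refine AddSubgroup.subset_closure ⟨w, ε, q, s, hdom, hint, ?_⟩
    simp
  | zero => simp
  | add x y _ _ hx hy => simpa using add_mem hx hy
  | neg x _ hx => simpa using neg_mem hx

/-- **Crux ⇒ value level** (soundness `KZ.relations_le_ker_eval_holds`). Hence a value-level
counterexample to the crux would contradict Brown's printed theorem: none exists. [folklore] -/
theorem valueLevel_of_crux (h : DihedralNormalForm) : ValueLevel := by
  intro k r hr
  obtain ⟨m, hm, hrel⟩ := (crux_iff.1 h) k r hr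
  have h0 : KZ.eval (KZ.of r - m) = 0 :=
    (AddMonoidHom.mem_ker).1 (KZ.relations_le_ker_eval_holds hrel)
  rw [map_sub, KZ.eval_of, sub_eq_zero] at h0
  rw [h0]
  exact eval_mem_closure_wordValueSet hm

/-- Every element of the value subgroup is the evaluation of a formal combination of word
representations. [folklore] -/
theorem exists_eval_eq_of_mem_closure_wordValueSet {x : ℝ}
    (hx : x ∈ AddSubgroup.closure wordValueSet) :
    ∃ m ∈ AddSubgroup.closure wordRepSet, KZ.eval m = x := by
  induction hx using AddSubgroup.closure_induction with
  | mem x hx =>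
    obtain ⟨w, ε, q, s, hdom, hint, rfl⟩ := hx
    exact ⟨KZ.of s, AddSubgroup.subset_closure ⟨w, ε, q, s, hdom, hint, rfl⟩, by simp⟩
  | zero => exact ⟨0, zero_mem _, by simp⟩
  | add x y _ _ hx hy =>
    obtain ⟨m, hm, rfl⟩ := hx
    obtain ⟨m', hm', rfl⟩ := hy
    exact ⟨m + m', add_mem hm hm', by simp⟩
  | neg x _ hx =>
    obtain ⟨m, hm, rfl⟩ := hx
    exact ⟨-m, neg_mem hm, by simp⟩

/-- **Summit ∧ value level ⇒ crux.** Given Brown's theorem, the crux FOLLOWS from Conjecture 1: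
write `[r] − m ≡ [r₁] − [r₂]` modulo relations (`KZ.exists_integralRep_sub_holds`), rationalise
`rᵢ` (`KZ.exists_isRational_equivalent_holds`), and apply the summit to the rational pair, whose
values agree by soundness. With `valueLevel_of_crux`: modulo Brown's printed theorem the crux is
EQUIVALENT to Conjecture 1 on the pairs (genus-zero rep, combination of word reps); a kill of the
crux is a kill of the summit. [folklore] -/
theorem crux_of_summit_of_valueLevel (hS : KontsevichZagierPeriods) (hV : ValueLevel) :
    DihedralNormalForm := by
  rw [crux_iff]
  intro k r hr
  obtain ⟨m, hm, hval⟩ := exists_eval_eq_of_mem_closure_wordValueSet (hV k r hr)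
  refine ⟨m, hm, ?_⟩
  set c : KZ.FormalRep := KZ.of r - m with hc
  have hc0 : KZ.eval c = 0 := by simp [hc, hval]
  obtain ⟨n₁, n₂, r₁, r₂, hsub⟩ := KZ.exists_integralRep_sub_holds c
  obtain ⟨m₁, r₁', hrat₁, heq₁⟩ := KZ.exists_isRational_equivalent_holds r₁
  obtain ⟨m₂, r₂', hrat₂, heq₂⟩ := KZ.exists_isRational_equivalent_holds r₂
  have hsound : ∀ x ∈ KZ.relations, KZ.eval x = 0 := fun x hx =>
    (AddMonoidHom.mem_ker).1 (KZ.relations_le_ker_eval_holds hx)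
  have hv : r₁'.value = r₂'.value := by
    have h1 := hsound _ hsub
    have h2 := hsound _ heq₁
    have h3 := hsound _ heq₂
    simp only [map_sub, KZ.eval_of, hc0] at h1 h2 h3
    linarith
  have hE : KZ.Equivalent r₁' r₂' := hS r₁' r₂' hrat₁ hrat₂ hv
  -- [r₁] − [r₂] = ([r₁] − [r₁']) + ([r₁'] − [r₂']) − ([r₂] − [r₂'])
  have h12 : KZ.of r₁ - KZ.of r₂ ∈ KZ.relations := by
    have key := sub_mem (add_mem heq₁ hE) heq₂
    have : KZ.of r₁ - KZ.of r₁' + (KZ.of r₁' - KZ.of r₂') - (KZ.of r₂ - KZ.of r₂') =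
        KZ.of r₁ - KZ.of r₂ := by abel
    simpa [KZ.Equivalent, this] using key
  have key := add_mem hsub h12
  rwa [sub_add_cancel] at key

/-- The two directions together: under Conjecture 1 the crux is exactly its value-level shadow.
[folklore] -/
theorem crux_iff_valueLevel_of_summit (hS : KontsevichZagierPeriods) :
    DihedralNormalForm ↔ ValueLevel :=
  ⟨valueLevel_of_crux, crux_of_summit_of_valueLevel hS⟩


/-! ## §2 Tightness of Brown's weight bound: words of length `< k` do not suffice

Brown's theorem bounds the weights of the MZVs by the dimension `k`; the crux allows every word
length `w` (only admissible words converge).  The natural strengthening "words of length `< k`"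
is false already at `k = 2`: the genus-zero representation `[Δ₂, 1/(t₀(1-t₁))]` (Kontsevich's
formula for `ζ(2)`, `KZ.mzvRep [2]`) has value `π²/6`, while a word representation of length `0`
has a rational value and a word representation of length `1` with `q ≠ 0` does not exist (the
letters `1/t`, `1/(1-t)` are not integrable on `(0,1)`), so everything reachable evaluates in `ℚ`.
Complements generation 1's `not_dihedralNormalFormHomogeneous` (length exactly `k` fails): the
normal form must mix weights `0, …, k` and must reach `k`. -/

/-- The representation `[Δ₂, 1/(t₀(1-t₁))]` of `ζ(2)` (Kontsevich's formula; `KZ.mzvRep [2]` with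
its two analytic inputs discharged in the tree). [Kontsevich–Zagier 2001, §1.1] [folklore] -/
def zeta2Rep : KZ.IntegralRep 2 :=
  KZ.mzvRep [2] MZV.isAdmissible_two (KZ.mzvIntegrand_isSemialgebraicFunOn_holds [2])
    (KZ.mzvIntegrand_integrableOn_holds [2] MZV.isAdmissible_two)

theorem zeta2Rep_domain : zeta2Rep.domain = simplex 2 := rfl

theorem zeta2Rep_integrand (t : Fin 2 → ℝ) :
    zeta2Rep.integrand t = 1 / t 0 * (1 / (1 - t 1)) := by
  show (∏ i : Fin 2, KZ.mzvForm ((MZV.binaryWord [2]).getD i false) (t i)) = _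
  simp [KZ.mzvForm, MZV.binaryWord, Fin.prod_univ_two]

/-- `value [Δ₂, 1/(t₀(1-t₁))] = ζ(2) = π²/6`. [Euler; Kontsevich–Zagier 2001, §1.1] [folklore] -/
theorem zeta2Rep_value : zeta2Rep.value = Real.pi ^ 2 / 6 := by
  rw [← multipleZeta_two]
  exact KZ.mzvRep_value_holds [2] MZV.isAdmissible_two _ _

/-- `[Δ₂, 1/(t₀(1-t₁))]` has the genus-zero shape of the crux (`P = 1`, `b = (1,0)`, `c = (0,1)`,
`a = 0`): the hypotheses of the crux are satisfiable by a representation with irrational value.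
[folklore] -/
theorem isGenusZero_zeta2Rep : IsGenusZero zeta2Rep := by
  refine ⟨1, fun _ _ => 0, ![1, 0], ![0, 1], rfl, ?_⟩
  intro t ht
  rw [zeta2Rep_integrand]
  simp [gzIntegrand, Fin.prod_univ_two, mul_comm]

theorem simplex_one : simplex 1 = {t | 0 < t 0 ∧ t 0 < 1} := by
  ext t
  simp only [simplex, mem_setOf_eq, Fin.forall_fin_one]
  constructor
  · rintro ⟨h0, h1, -⟩; exact ⟨h0, h1⟩
  · rintro ⟨h0, h1⟩; exact ⟨h0, h1, Subsingleton.strictAnti t⟩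

/-- A word representation of length `0` evaluates to its rational coefficient `q`. [folklore] -/
theorem value_word_zero {ε : Fin 0 → Bool} {q : ℚ} {s : KZ.IntegralRep 0}
    (hdom : s.domain = simplex 0)
    (hint : EqOn s.integrand (fun t => (q : ℝ) * ∏ i, if ε i then 1 / (1 - t i) else 1 / t i)
      s.domain) :
    s.value = q := by
  have volume_univ_fin_zero : volume (univ : Set (Fin 0 → ℝ)) = 1 := by
    rw [volume_pi, Measure.pi_univ]; simp
  have simplex_zero : simplex 0 = univ := by
    ext t
    simp only [simplex, mem_setOf_eq, mem_univ, iff_true]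
    exact ⟨fun i => i.elim0, fun i => i.elim0, fun i => i.elim0⟩
  have hfun : s.integrand = fun _ => (q : ℝ) := by
    funext t
    have := hint (show t ∈ s.domain by rw [hdom, simplex_zero]; trivial)
    simpa using this
  rw [KZ.IntegralRep.value, hdom, simplex_zero, Measure.restrict_univ, hfun, integral_const,
    measureReal_def, volume_univ_fin_zero]
  simp

/-- The letters `1/t` and `1/(1 - t)` are not integrable on `(0, 1)`: there is no convergent word
representation of length `1` with `q ≠ 0`. [folklore] -/
theorem not_integrableOn_letter (ε : Bool) :
    ¬ IntegrableOn (fun t : Fin 1 → ℝ => if ε then 1 / (1 - t 0) else 1 / t 0) (simplex 1) := by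
  intro h
  set e : (Fin 1 → ℝ) ≃ᵐ ℝ := MeasurableEquiv.funUnique (Fin 1) ℝ with he
  have hmap : Measure.map e volume = volume := (volume_preserving_funUnique (Fin 1) ℝ).map_eq
  have hpre : e ⁻¹' Ioo (0 : ℝ) 1 = simplex 1 := by
    rw [simplex_one]; ext t; simp [he, MeasurableEquiv.funUnique]
  have key : IntegrableOn (fun x : ℝ => if ε then 1 / (1 - x) else 1 / x) (Ioo 0 1) volume := by
    rw [← hmap, integrableOn_map_equiv e, hpre]
    refine h.congr_fun (fun t _ => ?_) (by rw [← hpre]; exact measurableSet_Ioo.preimage e.measurable)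
    simp [he, MeasurableEquiv.funUnique]
  have hI : IntervalIntegrable (fun x : ℝ => if ε then 1 / (1 - x) else 1 / x) volume 0 1 :=
    (intervalIntegrable_iff_integrableOn_Ioo_of_le zero_le_one).2 key
  cases ε with
  | false =>
    have h' : IntervalIntegrable (fun x : ℝ => x⁻¹) volume 0 1 :=
      hI.congr (by intro x _; simp)
    rw [intervalIntegrable_inv_iff] at h'
    rcases h' with h' | h'
    · exact zero_ne_one h'
    · exact h' (by simp)
  | true =>
    have h' : IntervalIntegrable (fun x : ℝ => (x - 1)⁻¹) volume 0 1 := by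
      refine (hI.neg).congr ?_
      intro x _
      simp only [Pi.neg_apply, if_true, one_div]
      rw [← inv_neg, neg_sub]
    rw [intervalIntegrable_sub_inv_iff] at h'
    rcases h' with h' | h'
    · exact zero_ne_one h'
    · exact h' (by simp)

/-- A word representation of length `1` has `q = 0`, hence value `0`. [folklore] -/
theorem value_word_one {ε : Fin 1 → Bool} {q : ℚ} {s : KZ.IntegralRep 1}
    (hdom : s.domain = simplex 1)
    (hint : EqOn s.integrand (fun t => (q : ℝ) * ∏ i, if ε i then 1 / (1 - t i) else 1 / t i)
      s.domain) :
    s.value = 0 := by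
  by_cases hq : q = 0
  · rw [KZ.IntegralRep.value]
    refine (setIntegral_congr_fun (KZ.IntegralRep.measurableSet_domain_holds s) hint).trans ?_
    simp [hq]
  · exfalso
    apply not_integrableOn_letter (ε 0)
    have h1 : IntegrableOn (fun t => (q : ℝ) * ∏ i, if ε i then 1 / (1 - t i) else 1 / t i)
        (simplex 1) := hdom ▸ s.integrableOn.congr_fun hint (KZ.IntegralRep.measurableSet_domain_holds s)
    have h2 : IntegrableOn (fun t => (q : ℝ)⁻¹ * ((q : ℝ) * ∏ i, if ε i then 1 / (1 - t i) else 1 / t i))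
        (simplex 1) := h1.const_mul _
    refine IntegrableOn.congr_fun h2 (fun t _ => ?_) (hdom ▸ KZ.IntegralRep.measurableSet_domain_holds s)
    have hq' : (q : ℝ) ≠ 0 := by exact_mod_cast hq
    simp [← mul_assoc, inv_mul_cancel₀ hq']

/-- **The strengthening of the crux to words of length `< k`.** [folklore] -/
def CruxWeightBelow : Prop :=
  ∀ (k : ℕ) (r : KZ.IntegralRep k), IsGenusZero r →
    ∃ m ∈ AddSubgroup.closure {x : KZ.FormalRep | ∃ (w : ℕ) (_ : w < k) (ε : Fin w → Bool) (q : ℚ)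
        (s : KZ.IntegralRep w), s.domain = simplex w ∧
        EqOn s.integrand (fun t => (q : ℝ) * ∏ i, if ε i then 1 / (1 - t i) else 1 / t i)
          s.domain ∧ x = KZ.of s},
      KZ.of r - m ∈ KZ.relations

/-- Everything reachable from words of length `< 2` evaluates in `ℚ`. [folklore] -/
theorem eval_rational_of_mem_closure_lt_two {m : KZ.FormalRep}
    (hm : m ∈ AddSubgroup.closure {x : KZ.FormalRep | ∃ (w : ℕ) (_ : w < 2) (ε : Fin w → Bool)
        (q : ℚ) (s : KZ.IntegralRep w), s.domain = simplex w ∧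
        EqOn s.integrand (fun t => (q : ℝ) * ∏ i, if ε i then 1 / (1 - t i) else 1 / t i)
          s.domain ∧ x = KZ.of s}) :
    ∃ q : ℚ, KZ.eval m = q := by
  induction hm using AddSubgroup.closure_induction with
  | mem x hx =>
    obtain ⟨w, hw, ε, q, s, hdom, hint, rfl⟩ := hx
    rw [KZ.eval_of]
    interval_cases w
    · exact ⟨q, value_word_zero hdom hint⟩
    · exact ⟨0, by simpa using value_word_one hdom hint⟩
  | zero => exact ⟨0, by simp⟩
  | add x y _ _ hx hy =>
    obtain ⟨a, ha⟩ := hx; obtain ⟨b, hb⟩ := hy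
    exact ⟨a + b, by simp [ha, hb]⟩
  | neg x _ hx =>
    obtain ⟨a, ha⟩ := hx
    exact ⟨-a, by simp [ha]⟩

/-- **Tightness of the weight bound (refuted strengthening).** The crux with word lengths
restricted to `w < k` is FALSE: at `k = 2` the representation `[Δ₂, 1/(t₀(1-t₁))]` would be
congruent to a combination evaluating in `ℚ`, so `π² / 6 ∈ ℚ` by soundness, contradicting the
transcendence of `π` (`transcendental_pi_holds`, Lindemann). Any proof of the crux must produce
words of the top length `k` (at `k = 2`: the word `01` itself). [folklore] -/
theorem not_cruxWeightBelow : ¬ CruxWeightBelow := by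
  intro h
  obtain ⟨m, hm, hrel⟩ := h 2 zeta2Rep isGenusZero_zeta2Rep
  obtain ⟨q, hq⟩ := eval_rational_of_mem_closure_lt_two hm
  have h0 : KZ.eval (KZ.of zeta2Rep - m) = 0 :=
    (AddMonoidHom.mem_ker).1 (KZ.relations_le_ker_eval_holds hrel)
  rw [map_sub, KZ.eval_of, sub_eq_zero, zeta2Rep_value, hq] at h0
  -- π is a root of X² − 6q
  apply transcendental_pi_holds
  refine ⟨Polynomial.X ^ 2 - Polynomial.C (6 * q), ?_, ?_⟩
  · intro hz
    have := congrArg (Polynomial.coeff · 2) hz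
    simp [Polynomial.coeff_X_pow] at this
  · simp only [map_sub, map_pow, Polynomial.aeval_X, Polynomial.aeval_C, eq_ratCast,
      Rat.cast_mul, Rat.cast_ofNat]
    linarith


/-! ## §3 Cycle-2 regime: corner pairing, `(t₀ - t₂)^{-2}`, and the reduction engine (hand analysis)

Everything in this section is analysis handed to the lead; the Lean content is limited to the
rational-function identities that carry the chains (checked by `field_simp`/`ring`), so that a
prover can lift each chain to move instances without re-deriving the algebra.

### 3.0 First reduction (advice): Brown's lemma `f ∈ ℚ[u_{ij}]`

[BrownENS2009, §7 (proof of the corollary after Lemma "no poles"), arXiv math/0606419 p. 51]: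
write the genus-zero form as `f · ω_δ` with `ω_δ` the unique (up to `ℚ×`) algebraic top form with
neither zeros nor poles on the partial compactification `M^δ_{0,n}` and `f ∈ ℚ[u_{ij}^{±1}]`;
absolute convergence on the cell forces `f ∈ ℚ[u_{ij}]` (a POLYNOMIAL in the dihedral
coordinates), hence `f = Σ_α q_α u^α` with `α ∈ ℕ^{χ}` and EVERY monomial integral
`I(α) = ∫ u^α ω_δ` converges.  Inside the calculus this is a chain of rule-(1b) moves all of
whose intermediates converge.  CONSEQUENCE: the crux is equivalent to its restriction to the
countable family of DIHEDRAL MONOMIAL representations `[Δ_k, u^α ω_δ]`, `α ≥ 0` — in cubical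
coordinates exactly Brown's generalised Selberg integrals
`∫_{[0,1]^k} ∏ xᵢ^{aᵢ}(1-xᵢ)^{bᵢ} ∏ (1 - xᵢ⋯xⱼ)^{cᵢⱼ} dx` — and an induction on `α` (or a
uniform algorithm on monomials) proves it.  In our coordinates (`1 > t₀ > ⋯ > t_{k-1} > 0`):
`ω_δ = dt₀dt₁/(t₀(1-t₁))` for `k = 2` (the `ζ(2)` form) and `ω_δ = dt/(t₁(1-t₁)(t₀-t₂))` for
`k = 3` (generation 1's `r⋆`, value `2ζ(2)`; it is the unique letter monomial TIGHT on all nine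
faces of the associahedron `K₅`); the five `u`'s for `k = 2` are
`t₀, 1-t₁, t₁/t₀, (1-t₀)/(1-t₁), (t₀-t₁)/(t₀(1-t₁))`.

### 3.1 The engine (what worked in every instance)

(i) rule 2: a dihedral symmetry of the cell and/or the cubical chart `tᵢ = x₁⋯x_{i+1}`
(`dt = x₁^{k-1}x₂^{k-2}⋯ dx`); (ii) choose a fibre variable `s` and expand the integrand in
partial fractions in `s` over `ℚ(other variables)`: `G = E + Σ_a A_a/(s - p_a)` with `E` =
polynomial part + poles of order ≥ 2 (so `E = ∂_s R`, `R` RATIONAL) — linear reducibility of the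
braid arrangement keeps all pieces genus-zero; (iii) the step is LEGAL iff `[Δ, E]` converges on
its own (then the lumped simple-pole remainder `G - E` converges too, and the base integrand
`R|^{hi}_{lo}` of the Newton–Leibniz move is automatically absolutely integrable, being the fibre
integral); (iv) recurse; terminal objects are `ℚ`-combinations of ADMISSIBLE word forms (split by
1b).  The only failure mode of a step is "`E` diverges for this (chart, fibre)"; in every example
some other chart/fibre succeeds.  Brown's criterion used throughout: `G dt` converges iff its order
along each boundary divisor `D_I` (`I` a `δ`-consecutive block) is `≥ 0`, i.e. for a letter
monomial `∏ ℓ^{f_ℓ}` and `k = 3`: no negative exponent on `t₂, t₁-t₂, t₀-t₁, 1-t₀`;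
`f(t₁)+f(t₂)+f(t₁-t₂) ≥ -1`, `f(t₀-t₁)+f(t₁-t₂)+f(t₀-t₂) ≥ -1`, `f(1-t₀)+f(1-t₁)+f(t₀-t₁) ≥ -1`;
the six letters vanishing at the origin sum to `≥ -2`, the six vanishing at `(1,1,1)` sum to `≥ -2`.

### 3.2 Worked instance A (k = 2, BOTH corners paired): `r₁ = [Δ₂, t₁(1-t₀)/(t₀²(1-t₁)²)]`

Value `ζ(2) - 1`.  Both partial-fraction splits are ILLEGAL: in `t₁`,
`t₁/(1-t₁)² = 1/(1-t₁)² - 1/(1-t₁)` gives two pieces each `~ 1/t₀²` at the origin (divergent);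
in `t₀`, `(1-t₀)/t₀² = 1/t₀² - 1/t₀` gives pieces `~ 1/(1-t₁)` at `(1,1)` (divergent).  Chain
(4 moves + null sets): cubical chart `(t₀,t₁) = (x, xy)` turns the integrand into
`g = y(1-x)/(1-xy)²` on `(0,1)²`; `g = ∂ₓ[(1-x)/(1-xy)] + 1/(1-xy)` (`chainA_identity`); both
summands converge (`∫∫ (1-y)/(1-xy)² = 1`, `∫∫ 1/(1-xy) = ζ(2)`); Newton–Leibniz in `x` on the
first gives `[(0,1), -1]`; the second is the `ζ(2)` word in cubical form.  (The search of §3.4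
finds the equivalent simplicial chain: symmetry, then fibre `t₀` with `E = -1/(1-t₁)`.)

### 3.3 Worked instance B (k = 3, the `(t₀-t₂)^{-2}` regime): `G₁ = (t₀-t₁)/(t₁(1-t₂)(t₀-t₂)²)`

Convergent and tight on five faces; value `2ζ(3) - 1`.  Fibre `t₂` is ILLEGAL (`E` acquires
`(1-t₀)^{-1}`, a pole on a codimension-1 face).  Fibre `t₀ ∈ (t₁, 1)`:
`(t₀-t₁)/(t₀-t₂)² = 1/(t₀-t₂) - (t₁-t₂)/(t₀-t₂)²` (`chainB_identity`), `E = -(t₁-t₂)/(t₁(1-t₂)(t₀-t₂)²)`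
converges, `R = (t₁-t₂)/(t₁(1-t₂)(t₀-t₂))`, base `[R]_{t₁}^{1} = -(1-u₀)/(u₀(1-u₁)²)` on `Δ₂`
(value `-1`, one more NL to `[pt,-1]`); remainder `S = 1/(t₁(1-t₂)(t₀-t₂))` converges, value
`2ζ(3)`; cubical chart: `S ↦ 1/((1-yz)(1-xyz))`; the involution `(x,y,z) ↦ (z,y,x)` (rule 2; on
`Δ₃` it is `(t₀,t₁,t₂) ↦ (t₂/t₁, t₂/t₀, t₂)`) gives `1/((1-xy)(1-xyz)) = xy/((1-xy)(1-xyz)) +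
1/(1-xyz)` = `ζ(2,1)` word + `ζ(3)` word (both convergent).  Total ≈ 9 moves, all convergent.

### 3.4 Worked instance C (k = 3, tight everywhere): `ω_δ = [Δ₃, 1/(t₁(1-t₁)(t₀-t₂))]`

`1/(t₁(1-t₁)) = 1/t₁ + 1/(1-t₁)` splits into two CONVERGENT pieces (legal 1b although `E = 0`);
`[Δ₃, 1/(t₁(t₀-t₂))]` in the cubical chart is `1/(1-yz)`, independent of `x`: one NL in `x` gives
the `ζ(2)` word on the `(y,z)`-square; same for the other piece by the reflection.  5 moves
(generation 1 found a 7-move cross-ratio chain for the same `r⋆`).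

### 3.5 Why "false without domain additivity" is plausible but not certifiable

`ι([σ,f]) := χ(σ)·∫_σ f`, `χ` the o-minimal Euler characteristic (`χ(open d-cell) = (-1)^d`),
is additive on integrands, invariant under definable bijections (rule 2) and under bands
(`χ(band) = χ(base)` because `χ([a,b]) = 1`), but NOT additive in the domain.  It separates
`[Δ₁, 1]` (`ι = -1`) from `[pt, 1]` (`ι = +1`): without rule (1a) the open simplex can never be
closed up for a Newton–Leibniz band.  Turning this into `¬ CruxWithout1a` needs
`1 ∉ ℚ⟨ζ(ε) : |ε| odd⟩` (weight-grading, open) and an o-minimal `χ` in Lean (absent).  Recorded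
as the reason the open/closed null-set bookkeeping in every chain above is not cosmetic.
-/

/-- Instance A: the exact + remainder decomposition in the cubical chart,
`y(1-x)/(1-xy)² = ∂ₓ[(1-x)/(1-xy)] + 1/(1-xy)` with `∂ₓ[(1-x)/(1-xy)] = (y-1)/(1-xy)²`.
[folklore] -/
theorem chainA_identity (x y : ℝ) (_h : 1 - x * y ≠ 0) :
    y * (1 - x) / (1 - x * y) ^ 2 = (y - 1) / (1 - x * y) ^ 2 + 1 / (1 - x * y) := by
  field_simp
  ring

/-- Instance A: the primitive is right, `d/dx [(1-x)/(1-xy)] = (y-1)/(1-xy)²`. [folklore] -/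
theorem chainA_hasDerivAt (x y : ℝ) (h : 1 - x * y ≠ 0) :
    HasDerivAt (fun x => (1 - x) / (1 - x * y)) ((y - 1) / (1 - x * y) ^ 2) x := by
  have h1 : HasDerivAt (fun x => 1 - x) (-1) x := by
    simpa using (hasDerivAt_id x).const_sub 1
  have h2 : HasDerivAt (fun x => 1 - x * y) (-y) x := by
    simpa using ((hasDerivAt_id x).mul_const y).const_sub 1
  refine (h1.div h2 h).congr_deriv ?_
  field_simp
  ring

/-- Instance B: the partial-fraction split in the fibre variable `t₀`,
`(t₀-t₁)/(t₀-t₂)² = 1/(t₀-t₂) - (t₁-t₂)/(t₀-t₂)²`. [folklore] -/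
theorem chainB_identity (t₀ t₁ t₂ : ℝ) (_h : t₀ - t₂ ≠ 0) :
    (t₀ - t₁) / (t₀ - t₂) ^ 2 = 1 / (t₀ - t₂) - (t₁ - t₂) / (t₀ - t₂) ^ 2 := by
  field_simp
  ring

/-- Instance B: the base integrand after Newton–Leibniz in `t₀` over `(t₁, 1)`,
`[R]_{t₁}^{1} = (t₁-t₂)/(t₁(1-t₂)²) - 1/(t₁(1-t₂)) = -(1-t₁)/(t₁(1-t₂)²)`. [folklore] -/
theorem chainB_base (t₁ t₂ : ℝ) (_h₁ : t₁ ≠ 0) (_h₂ : 1 - t₂ ≠ 0) :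
    (t₁ - t₂) / (t₁ * (1 - t₂) ^ 2) - 1 / (t₁ * (1 - t₂)) = -(1 - t₁) / (t₁ * (1 - t₂) ^ 2) := by
  field_simp
  ring

/-- Instance B, remainder: in the cubical chart after the involution,
`1/((1-xy)(1-xyz)) = xy/((1-xy)(1-xyz)) + 1/(1-xyz)` (`ζ(2,1)` word + `ζ(3)` word). [folklore] -/
theorem chainB_words (x y z : ℝ) (_h₁ : 1 - x * y ≠ 0) (_h₂ : 1 - x * y * z ≠ 0) :
    1 / ((1 - x * y) * (1 - x * y * z)) =
      x * y / ((1 - x * y) * (1 - x * y * z)) + 1 / (1 - x * y * z) := by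
  field_simp
  ring

/-- Instance C: the cubical chart kills the tight form: with `t₀ = x`, `t₁ = xy`, `t₂ = xyz` and
`dt = x²y dx dy dz`, `x²y / (t₁ (t₀ - t₂)) = 1/(1 - yz)` (independent of `x`). [folklore] -/
theorem chainC_cubical (x y z : ℝ) (hx : x ≠ 0) (hy : y ≠ 0) (h : 1 - y * z ≠ 0) :
    x ^ 2 * y / ((x * y) * (x - x * y * z)) = 1 / (1 - y * z) := by
  have h' : x - x * y * z ≠ 0 := by
    have : x - x * y * z = x * (1 - y * z) := by ring
    rw [this]; exact mul_ne_zero hx h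
  rw [div_eq_div_iff (mul_ne_zero (mul_ne_zero hx hy) h') h]
  ring


/-! ### 3.6 Small-model computation: the `gzred` convergent-reduction search (this generation)

Script `gzred/gzred.py` (session folder; kit jobs `j008528` = k=3, |α|≤4 and `j008529` = k=3,
|α|≤6, queued, evidence auto-attached to the item on completion). Universe: the dihedral
monomials `[Δ_k, u^α ω_δ]` of §3.0 up to the action of `D_{k+3}` on chords. Oracle: Brown's
divisor criterion, exact. Moves: the 2(k+3) dihedral symmetries and the cubical chart (rule 2);
Newton–Leibniz on an exact part of the partial-fraction expansion in a fibre variable (rule 3,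
rational primitive, legal iff the exact part converges alone) in three variants — `full`
(polynomial part + poles of order ≥ 2), `poles` (poles of order ≥ 2 only), `vanish` (the
primitive corrected by the linear interpolant that makes it VANISH at both fibre ends, so the
NL output is `0`); lumping of simple poles (rule 1b); Brown's `u`-equations
`u_c + ∏_{c' crossing c} u_{c'} = 1` as 1b-splits; terminal = `ℚ`-combination of admissible words.
RESULTS so far (all intermediates certified absolutely convergent by the oracle):
* `k = 2`: ALL 236 orbits with `|α| ≤ 9` reduce to `ℚ`-combinations of the `ζ(2)` word and
  constants (`outputs/uenum_k2_d9_s0.jsonl`, each record a move-chain recipe).  With the `full`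
  variant alone exactly two orbits with `|α| ≤ 6` are STUCK in every one of the 10 frames × 4
  fibres: the `D₅`-INVARIANT monomial `u₁u₂u₃u₄u₅·ω_δ = [Δ₂, t₁(1-t₀)(t₀-t₁)/(t₀²(1-t₁)²)]`
  (value `5 - 3ζ(2)`) and `[Δ₂, t₁²(1-t₀)²/(t₀²(1-t₁)²)]`; `u`-equation splits map these two
  orbits into each other.  Both fall at once to the `vanish` variant: for the first, in the cubical
  chart `g = xy(1-x)(1-y)/(1-xy)²` and `R = x(1-x)(1-y)/(1-xy)` vanishes at `x = 0, 1` with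
  `∂ₓR = g + (1-2x)(1-y)/(1-xy)` (`chainD_hasDerivAt`), so `g ≡ -(1-2x)(1-y)/(1-xy)
  = -u₂u₅ω_δ + 2u₁u₂u₅ω_δ` (values `-(ζ(2)-1) + 2(2-ζ(2)) = 5-3ζ(2)` ✓), two monomials of lower
  complexity.  LESSON FOR THE LEAD: the exact part is canonical only up to `x`-polynomials; the
  convergent choice is the endpoint-vanishing primitive, not the partial-fraction polynomial part.
* `k = 3`, `|α| ≤ 3`: 33 orbits; 25 reduced so far (to `ζ(3)`, `ζ(2,1)`, `ζ(2)` words and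
  constants), 8 pending for CPU only (hub load; delegated to the kit jobs), NONE stuck:
  pending list `α` (chords `(0,2),(0,3),(0,4),(1,3),(1,4),(1,5),(2,4),(2,5),(3,5)`) =
  `(0…0,3)`, `(0…0,1,0,2)`, `(0…0,1,0,0,2)`, `(0…0,1,1,0,1)`, `(0…0,1,1,1,0)`, `(0…0,1,2,0,0)`,
  `(0,0,0,1,0,0,1,0,1)`, `(0,0,0,1,0,1,0,0,1)`.
No candidate counterexample pair emerged; every obstruction met was an artefact of a too-greedy
choice (frame, fibre, or primitive normalisation) and dissolved under another legal choice.
-/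

/-- Instance D (the `D₅`-invariant monomial): with `R = x(1-x)(1-y)/(1-xy)`, which vanishes on
both ends `x = 0, 1` of the fibre, `∂ₓR = xy(1-x)(1-y)/(1-xy)² + (1-2x)(1-y)/(1-xy)`. [folklore] -/
theorem chainD_hasDerivAt (x y : ℝ) (h : 1 - x * y ≠ 0) :
    HasDerivAt (fun x => x * (1 - x) * (1 - y) / (1 - x * y))
      (x * y * (1 - x) * (1 - y) / (1 - x * y) ^ 2 + (1 - 2 * x) * (1 - y) / (1 - x * y)) x := by
  have ha : HasDerivAt (fun x => x * (1 - x)) (1 * (1 - x) + x * (-1)) x :=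
    (hasDerivAt_id' x).mul ((hasDerivAt_id' x).const_sub 1)
  have h1 : HasDerivAt (fun x => x * (1 - x) * (1 - y)) ((1 * (1 - x) + x * (-1)) * (1 - y)) x :=
    ha.mul_const (1 - y)
  have h2 : HasDerivAt (fun x => 1 - x * y) (-(1 * y)) x :=
    ((hasDerivAt_id' x).mul_const y).const_sub 1
  refine (h1.div h2 h).congr_deriv ?_
  field_simp
  ring

/-- Instance D: the endpoint values vanish, so the Newton–Leibniz move contributes `0`. [folklore] -/
theorem chainD_endpoints (y : ℝ) :
    (fun x : ℝ => x * (1 - x) * (1 - y) / (1 - x * y)) 0 = 0 ∧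
    (fun x : ℝ => x * (1 - x) * (1 - y) / (1 - x * y)) 1 = 0 := by
  constructor <;> simp



/-! ## §4 Rule (3) is load-bearing, certified: the dimension-graded evaluation `evalDim`

(Generation 3; re-establishes generation 1's lost `dihedralNormalForm_false_without_newtonLeibniz`
with a simpler witness.)  The additivity moves (1a), (1b) and the change of variables (2) relate
representations of ONE dimension `n`; only Newton–Leibniz (3) changes the dimension.  Hence for
every `d` the graded evaluation `evalDim d` (sum of the values of the dimension-`d` generators) is
an additive invariant of the sub-calculus generated by (1a), (1b), (2).  The witness is the
simplest genus-zero representation of positive dimension, `[Δ₁, 1]` (`P = 1`, all exponents `0`,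
value `1`): a word representation of length `1` has value `0` (`value_word_one`), so
`evalDim 1 ([Δ₁,1] − m) = 1 ≠ 0` for every `m` in the word closure.  ANY proof of the crux uses
rule (3) already at `k = 1`; combined with §2 (the top word length `k` must be produced) the moves
budget of a proof is: at least one Newton–Leibniz descent per dimension `1 … k` that is removed,
and none can be traded for additivity or changes of variables. -/

/-- Dimension-graded evaluation: the additive map sending a generator `[r]` of dimension `n` to
`value r` if `n = d` and to `0` otherwise. [folklore] -/
def evalDim (d : ℕ) : KZ.FormalRep →+ ℝ :=
  FreeAbelianGroup.lift fun p => if p.1 = d then p.2.value else 0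

@[simp] theorem evalDim_of (d : ℕ) {n : ℕ} (r : KZ.IntegralRep n) :
    evalDim d (KZ.of r) = if n = d then r.value else 0 := by
  simp [evalDim, KZ.of]

/-- The sub-calculus WITHOUT Newton–Leibniz: the subgroup generated by moves (1a), (1b), (2).
[Kontsevich–Zagier 2001, §1.2] [folklore] -/
def relationsWithoutNL : AddSubgroup KZ.FormalRep :=
  AddSubgroup.closure (KZ.domainAddRel ∪ KZ.integrandAddRel ∪ KZ.changeOfVariablesRel)

theorem relationsWithoutNL_le_relations : relationsWithoutNL ≤ KZ.relations :=
  AddSubgroup.closure_mono subset_union_left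

theorem evalDim_three {n d : ℕ} (r r₁ r₂ : KZ.IntegralRep n) :
    evalDim d (KZ.of r - KZ.of r₁ - KZ.of r₂) =
      if n = d then KZ.eval (KZ.of r - KZ.of r₁ - KZ.of r₂) else 0 := by
  by_cases h : n = d <;> simp [h]

theorem evalDim_two {n d : ℕ} (r r' : KZ.IntegralRep n) :
    evalDim d (KZ.of r - KZ.of r') = if n = d then KZ.eval (KZ.of r - KZ.of r') else 0 := by
  by_cases h : n = d <;> simp [h]

/-- **`evalDim d` is an invariant of the sub-calculus (1a) + (1b) + (2)**: each of these moves
relates representations of a single dimension and evaluates to `0` (soundness), so its graded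
evaluation vanishes in every degree. [folklore] -/
theorem relationsWithoutNL_le_ker_evalDim (d : ℕ) : relationsWithoutNL ≤ (evalDim d).ker := by
  refine (AddSubgroup.closure_le _).mpr ?_
  rintro c ((hc | hc) | hc)
  · have h0 : KZ.eval c = 0 := KZ.eval_eq_zero_of_mem_domainAddRel_holds hc
    obtain ⟨n, r, r₁, r₂, -, -, -, -, rfl⟩ := hc
    rw [SetLike.mem_coe, AddMonoidHom.mem_ker, evalDim_three, h0, ite_self]
  · have h0 : KZ.eval c = 0 := KZ.eval_eq_zero_of_mem_integrandAddRel_holds hc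
    obtain ⟨n, r, r₁, r₂, -, -, -, rfl⟩ := hc
    rw [SetLike.mem_coe, AddMonoidHom.mem_ker, evalDim_three, h0, ite_self]
  · have h0 : KZ.eval c = 0 := KZ.eval_eq_zero_of_mem_changeOfVariablesRel_holds hc
    obtain ⟨n, r, r', Φ, Φ', -, -, -, -, -, rfl⟩ := hc
    rw [SetLike.mem_coe, AddMonoidHom.mem_ker, evalDim_two, h0, ite_self]

/-- In degree `1` the graded evaluation kills the whole word closure: word representations of
length `1` have value `0` (`value_word_one`), the others have the wrong dimension. [folklore] -/
theorem evalDim_one_eq_zero_of_mem_closure {m : KZ.FormalRep}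
    (hm : m ∈ AddSubgroup.closure wordRepSet) : evalDim 1 m = 0 := by
  induction hm using AddSubgroup.closure_induction with
  | mem x hx =>
    obtain ⟨w, ε, q, s, hdom, hint, rfl⟩ := hx
    rw [evalDim_of]
    split_ifs with h
    · subst h
      exact value_word_one hdom hint
    · rfl
  | zero => simp
  | add x y _ _ hx hy => simp [hx, hy]
  | neg x _ hx => simp [hx]

/-- The Lebesgue measure of the open interval `Δ₁ = (0,1) ⊂ ℝ¹` is `1`. [folklore] -/
theorem volume_simplex_one : volume (simplex 1) = 1 := by
  set e : (Fin 1 → ℝ) ≃ᵐ ℝ := MeasurableEquiv.funUnique (Fin 1) ℝ with he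
  have hmp : MeasurePreserving e volume volume := volume_preserving_funUnique (Fin 1) ℝ
  have hpre : e ⁻¹' Ioo (0 : ℝ) 1 = simplex 1 := by
    rw [simplex_one]; ext t; simp [he, MeasurableEquiv.funUnique]
  rw [← hpre, hmp.measure_preimage measurableSet_Ioo.nullMeasurableSet, Real.volume_Ioo]
  simp

/-- **The witness `[Δ₁, 1]`**: the open interval with the constant integrand `1` (KZ-literal data
`1/1`). [folklore] -/
def oneRep : KZ.IntegralRep 1 :=
  KZ.IntegralRep.ofRational (simplex 1) 1 1 (KZ.isSemialgebraic_openOrderedSimplex 1)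
    (fun x _ => by simp)
    (by
      have h : (fun x : Fin 1 → ℝ => MvPolynomial.aeval x (1 : MvPolynomial (Fin 1) ℚ) /
          MvPolynomial.aeval x (1 : MvPolynomial (Fin 1) ℚ)) = fun _ => (1 : ℝ) := by
        funext x; simp
      rw [h]
      exact integrableOn_const (by rw [volume_simplex_one]; simp))

theorem oneRep_domain : oneRep.domain = simplex 1 := rfl

theorem oneRep_integrand (x : Fin 1 → ℝ) : oneRep.integrand x = 1 := by
  simp [oneRep]

/-- `value [Δ₁, 1] = 1`. [folklore] -/
theorem oneRep_value : oneRep.value = 1 := by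
  rw [KZ.IntegralRep.value, oneRep_domain]
  have h : (fun x => oneRep.integrand x) = fun _ => (1 : ℝ) := funext oneRep_integrand
  rw [h, setIntegral_const, measureReal_def, volume_simplex_one]
  simp

/-- `[Δ₁, 1]` has the genus-zero shape of the crux (`P = 1`, `a = b = c = 0`). [folklore] -/
theorem isGenusZero_oneRep : IsGenusZero oneRep := by
  refine ⟨1, fun _ _ => 0, fun _ => 0, fun _ => 0, rfl, ?_⟩
  intro t _
  rw [oneRep_integrand]
  simp [gzIntegrand]

/-- **The crux WITHOUT rule (3)**: `KZ.relations` replaced by the subgroup generated by the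
additivity and change-of-variables moves only. [folklore] -/
def CruxWithoutNewtonLeibniz : Prop :=
  ∀ (k : ℕ) (r : KZ.IntegralRep k), IsGenusZero r →
    ∃ m ∈ AddSubgroup.closure wordRepSet, KZ.of r - m ∈ relationsWithoutNL

/-- **Rule (3) is load-bearing (any proof of the crux must use Newton–Leibniz).** The crux with
`relations` replaced by the sub-calculus (1a)+(1b)+(2) is FALSE: `evalDim 1` vanishes on that
sub-calculus and on the word closure, but `evalDim 1 [Δ₁, 1] = 1`. The same witness shows that no
chain staying in dimensions `≠ 1` after leaving `[Δ₁,1]` by non-NL moves can exist: the first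
move that changes `evalDim 1` is a Newton–Leibniz move out of (or into) dimension `1`. [folklore] -/
theorem dihedralNormalForm_false_without_newtonLeibniz : ¬ CruxWithoutNewtonLeibniz := by
  intro h
  obtain ⟨m, hm, hrel⟩ := h 1 oneRep isGenusZero_oneRep
  have h1 : evalDim 1 (KZ.of oneRep - m) = 0 :=
    (AddMonoidHom.mem_ker).1 (relationsWithoutNL_le_ker_evalDim 1 hrel)
  rw [map_sub, evalDim_of, if_pos rfl, oneRep_value, evalDim_one_eq_zero_of_mem_closure hm] at h1
  norm_num at h1

/-- Corollary: rule (3) is not derivable from (1a), (1b), (2) inside the typed calculus — the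
slab `[Δ₁ × [0,1], 1] − [Δ₁, 1]` is one Newton–Leibniz move with `evalDim 1 = −1`. [folklore] -/
theorem newtonLeibnizRel_not_subset_relationsWithoutNL :
    ¬ (KZ.newtonLeibnizRel ⊆ (relationsWithoutNL : Set KZ.FormalRep)) := by
  intro h
  have h1 := (AddMonoidHom.mem_ker).1
    (relationsWithoutNL_le_ker_evalDim 1 (h (oneRep.of_slab_sub_of_mem_newtonLeibnizRel 0)))
  rw [map_sub, evalDim_of, evalDim_of, if_pos rfl, oneRep_value] at h1
  norm_num at h1

/-- **The weight-homogeneous strengthening at `k = 1` (re-proof of generation 1's lost theorem):**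
"words of length EXACTLY `k`" is false at `k = 1` — every word representation of length `1` has
value `0`, while `[Δ₁, 1]` has value `1`; soundness. [folklore] -/
def CruxHomogeneousAt (k : ℕ) : Prop :=
  ∀ (r : KZ.IntegralRep k), IsGenusZero r →
    ∃ m ∈ AddSubgroup.closure {x : KZ.FormalRep | ∃ (ε : Fin k → Bool) (q : ℚ)
        (s : KZ.IntegralRep k), s.domain = simplex k ∧
        EqOn s.integrand (fun t => (q : ℝ) * ∏ i, if ε i then 1 / (1 - t i) else 1 / t i)
          s.domain ∧ x = KZ.of s},
      KZ.of r - m ∈ KZ.relations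

theorem not_cruxHomogeneousAt_one : ¬ CruxHomogeneousAt 1 := by
  intro h
  obtain ⟨m, hm, hrel⟩ := h oneRep isGenusZero_oneRep
  have hm0 : KZ.eval m = 0 := by
    clear hrel
    induction hm using AddSubgroup.closure_induction with
    | mem x hx =>
      obtain ⟨ε, q, s, hdom, hint, rfl⟩ := hx
      rw [KZ.eval_of]
      exact value_word_one hdom hint
    | zero => simp
    | add x y _ _ hx hy => simp [hx, hy]
    | neg x _ hx => simp [hx]
  have h0 : KZ.eval (KZ.of oneRep - m) = 0 :=
    (AddMonoidHom.mem_ker).1 (KZ.relations_le_ker_eval_holds hrel)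
  rw [map_sub, KZ.eval_of, oneRep_value, hm0] at h0
  norm_num at h0


/-! ## §5 Rule (2) is load-bearing: the typed Newton–Leibniz move sees only the LAST coordinate

(Generation 3, new.)  Rule (3) is typed along `Fin.last n`.  Without rule (2) the coordinate
system is rigid: the additivity moves and Newton–Leibniz never exchange the roles of two
coordinates.  The witness is the genus-zero representation `r_L = [Δ₂, 1/(1-t₁)]` (`P = 1`,
`b = 0`, `c = (0,1)`, `a = 0`; value `∫₀¹ (1-t₁)/(1-t₁) dt₁ = 1`).  WITH rule (2) it closes in four
moves: the transposition `(t₀,t₁) ↦ (t₁,t₀)` (an element of `KZ.permRel ⊆ changeOfVariablesRel`,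
tree) gives `[{0<y₀<y₁<1}, 1/(1-y₀)]`; closing the null faces (1a) and ONE Newton–Leibniz move in
`y₁ ∈ [y₀,1]` with the RATIONAL primitive `F = y₁/(1-y₀)` gives `[(0,1), (1-y₀)/(1-y₀) = 1]`, and a
last Newton–Leibniz move gives `[pt, 1]`.  WITHOUT rule (2):

**Theorem (paper proof below; Lean: `dihedralNormalForm_false_without_changeOfVariables`, PROVED in §9).** `[r_L] − m ∉ closure(1a ∪ 1b ∪ 3)` for every `m` in the word closure.

*Invariant.* For a representation `R = (σ, f)` of dimension `n ≥ 2` let `μ_R` be the push-forward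
of the signed measure `f·λⁿ|_σ` to the first two coordinates `(x₀,x₁)`; for `n = 1` let
`μ_R := (f·λ¹|_σ) ⊗ λ|_{[2,3]}` (embed along a far-away interval in `x₁`), and for `n = 0`,
`μ_{[pt,c]} := c·λ²|_{[2,3]²}`.  Let `D` be the subgroup of signed measures on `ℝ²` generated by
the differences `μ_R − μ_{R'}` over the Newton–Leibniz instances `[R] − [R']` with base dimension
`1` or `0` (bands in `ℝ²` over `τ ⊆ ℝ`, and intervals `[a,b] ⊆ ℝ` over the point).  Then
`ι([R]) := μ_R mod D` extends additively to `FormalRep` and KILLS `closure(1a ∪ 1b ∪ 3)`: the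
additivity moves are additive on measures (a.e.-disjoint unions, sums of integrable integrands);
a Newton–Leibniz instance with base dimension `n ≥ 2` integrates out the coordinate `x_n`, which
is neither `x₀` nor `x₁`, so Fubini on the band and the fibrewise fundamental theorem of calculus
(valid on a.e. fibre, exactly as in the soundness proof `KZ.eval_eq_zero_of_mem_newtonLeibnizRel_holds`)
give `μ_R = μ_{R'}` on the nose; base dimensions `1, 0` are quotiented out by definition.
*Evaluation on the two sides.* `μ_{r_L} = (1-x₁)⁻¹·λ²|_{Δ₂}`.  A word representation
`s = [Δ_w, q∏ω_ε]` with `q ≠ 0` is integrable only if `ε₀ = false` (the `x₀`-marginal of a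
positive word integrand is `ω_{ε₀}(x₀)·I(x₀)` with `I` increasing and positive, and
`∫^1 I(x₀)dx₀/(1-x₀) = ∞`), and then for `w ≥ 2` its push-forward to `(x₀,x₁)` has density
`(q/x₀)·ω_{ε₁}(x₁)·I_{ε''}(x₁)` on `Δ₂` (`I_{ε''}` the iterated integral of the remaining letters
from `0` to `x₁`; `I_∅ = 1`); words of length `≤ 1` and constants are supported in `x₁ ∈ [2,3]`.
Hence, if `[r_L] − Σ nᵢ[sᵢ] ∈ closure(1a ∪ 1b ∪ 3)`, then on `Δ₂`
`(1-x₁)⁻¹ − Ψ(x₁)/x₀ ≡ Σⱼ mⱼ ∂_{x₁}Fⱼ · 𝟙_{Bⱼ}  (mod null sets)`, with `Ψ` SOME function of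
`x₁` alone, finitely many bands `Bⱼ ⊆ ℝ²` and `ℚ`-semialgebraic `Fⱼ` on `Bⱼ`, differentiable in
`x₁` inside the fibres with integrable derivative.  *Elimination.* Choose an open box
`U = J₀ × J₁ ⊆ Δ₂` missing the (one-dimensional) boundaries `∂Bⱼ`; on `U` the right side is
`∂_{x₁}G(x₀,x₁)`, `G := Σ_{U ⊆ Bⱼ} mⱼFⱼ`.  For a.e. `x₀ = r ∈ J₀` the identity holds for a.e.
`x₁ ∈ J₁` and `x₁ ↦ ∂_{x₁}G(r,x₁)` is integrable on `J₁`; pick two such values `r₁ ≠ r₂` and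
subtract `r₁·(identity at r₁) − r₂·(identity at r₂)`: the unknown `Ψ` drops out and
`(r₁ − r₂)/(1-x₁) = ∂_{x₁}[r₁G(r₁,x₁) − r₂G(r₂,x₁)]` a.e. on `J₁`; since the bracket `H(x₁)` is
differentiable everywhere on `J₁` with integrable derivative, `H = −(r₁−r₂)log(1-x₁) + C` on
`J₁`.  But `H` is an `ℝ`-linear combination of the one-variable functions `Fⱼ(r_k, ·)`, each
semialgebraic (with the real parameter `r_k`), hence each satisfying a non-trivial polynomial
relation `Pⱼₖ(x₁, Fⱼ(r_k,x₁)) = 0` (steps (A)–(B) of the barrier file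
`AlgebraicPrimitivesObstruction`, verbatim with real coefficients), hence piecewise
analytic-algebraic; shrinking `J₁`, `H` is algebraic over `ℝ(x₁)` on `J₁`, and so is
`log(1-x₁) = (C − H)/(r₁−r₂)` — contradicting step (C) of the same file (a function with
derivative `N/((X−x₀)V)`, simple pole with non-zero residue, here `1/(1-x₁)` at `x₀ = 1`,
satisfies no polynomial relation; one-variable, one-function case = `no_semialgebraic_primitive_letter`
below).  ∎  No hyperlogarithm independence is needed: the `1/x₀`-homogeneity of everything
coming from MZV words eliminates the word side.  (The one-coordinate marginal `x₀ ↦ ∫ f(x₀,·)`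
modulo derivatives of semialgebraic functions is also an invariant, but concluding with it needs
the linear independence of the hyperlogarithms `L_w`, `w ∈ {x₀,x₁}*`, over algebraic functions
[Deneufchâtel–Duchamp–Minh–Solomon 2011].)

**Consequences for the lead.** (i) Every chain needs rule-(2) moves; for `r_L` a single
TRANSPOSITION of coordinates suffices, so the indispensable part of rule (2) is the symmetric
group acting on coordinates (`KZ.permRel`, proved `⊆ changeOfVariablesRel` in the tree): the move
library of any line must contain `permutationMove`, and "Newton–Leibniz in the variable `tᵢ`" is
always `perm ∘ NL ∘ perm⁻¹`.  (ii) OPEN (stated as `CruxWithPermutations` below, no claim): do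
permutations suffice, i.e. is the crux provable inside `closure(1a ∪ 1b ∪ 3 ∪ permRel)`?  The
cubical chart `tᵢ = x₁⋯x_{i+1}` and the dihedral symmetries used by every computed chain (§3) are
NOT permutations; but in dimension `1` a monotone `C¹` semialgebraic substitution
`[σ, (f∘Φ)·Φ'] ~ [Φσ, f]` IS derivable from (1a), (1b), (3) and one transposition when `f` is
differentiable with semialgebraic integrable `f'` (Ayoub's remark that the one-variable change of
variables is two Stokes elements in two variables, [Ayoub 2015, Rem. 1.5]: integrate
`f'(y)·Φ'(x)` over `{x ∈ σ, Φ(inf σ) ≤ y ≤ Φ(x)}` along `y`, and along `x` after transposing), so a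
positive answer is plausible for integrands with enough semialgebraic derivatives — which
genus-zero integrands have.  (iii) Rule (1b) is NEVER load-bearing (CERTIFIED in §6 with a polynomial variant of the
following construction): `integrandAddRel ⊆ closure(domainAddRel ∪ newtonLeibnizRel)` — given `f = f₁ + f₂` on `σ`, the band `σ × [0,2]` with
the integrand `h(x,t) = f₁(x)φ(t) + f₂(x)φ(t-1)`, `φ(t) = 6t(1-t)·𝟙_{[0,1]}` (continuous, so the
primitive `f₁Φ(t) + f₂Φ(t-1)`, `Φ = 3t²-2t³` clamped, is fibrewise `C¹` and semialgebraic),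
descends by ONE Newton–Leibniz move to `[σ, f₁+f₂]`, splits by ONE domain-additivity move at
`t = 1`, and the halves descend to `[σ,f₁]`, `[σ,f₂]` (paper proof; all four side conditions of
`newtonLeibnizRel` are met because `φ` is continuous and piecewise polynomial).  Hence an additive
invariant finer than `eval` need only be tested against (1a), (2), (3) — and, if (ii) has a
positive answer on the relevant class, against (1a), (3) and coordinate permutations.  (iv) Rule
(1a) is NOT derivable from the other three (the o-minimal Euler characteristic `χ(σ)·∫_σ f` of
§3.5 separates `[(0,1),1]` from `[(0,½],1] + [(½,1),1]`), but whether the CRUX needs it is open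
(§3.5: blocked by `1 ∉ ℚ⟨odd-weight MZVs⟩`). -/

/-- **No `ℚ`-semialgebraic primitive of a letter.** Neither `1/(1-t)` nor `1/t` has a
`ℚ`-semialgebraic primitive on `[0,1]` (derivative on `(0,1)`): the one-function case of the
elimination step above, and the reason the direct Newton–Leibniz fold of `[Δ₂, 1/(1-t₁)]` along
its last coordinate does not exist (its fibrewise primitive would be `-log(1-t₁) + C(t₀)`).
Proof: steps (A)–(C) of the barrier file (`NoSemialgPrimKernel.exists_ne_zero_evalEval_eq_zero`,
`NoSemialgPrimKernel.eq_zero_of_evalEval_eq_zero` with the simple pole at `x₀ = 1`, resp. `0`).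
[cite: Ayoub2015, Rem. 1.2] [folklore] -/
theorem no_semialgebraic_primitive_letter (ε : Bool) :
    ¬ ∃ F : (Fin 1 → ℝ) → ℝ, IsSemialgebraicFunOn ℚ {x | x 0 ∈ Icc (0 : ℝ) 1} F ∧
      ∀ t ∈ Ioo (0 : ℝ) 1,
        HasDerivAt (fun s : ℝ => F (fun _ => s)) (if ε then 1 / (1 - t) else 1 / t) t := by
  rintro ⟨F, hF, hderiv⟩
  obtain ⟨P, hP0, hPv⟩ :=
    Literature.Barriers.KontsevichZagierPeriods.KZ.NoSemialgPrimKernel.exists_ne_zero_evalEval_eq_zero hF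
  -- the pole `x₀` and the data `V`, `N` of step (C): `((X - x₀)·V)·g' = N`
  let x₀ : ℝ := if ε then 1 else 0
  let V : Polynomial ℝ := if ε then Polynomial.C (-1) else Polynomial.C 1
  have hV : V.eval x₀ ≠ 0 := by cases ε <;> simp [V, x₀]
  have hN : (Polynomial.C (1 : ℝ)).eval x₀ ≠ 0 := by simp
  have hDN : ∀ t ∈ Ioo (0 : ℝ) 1, ((Polynomial.X - Polynomial.C x₀) * V).eval t *
      (if ε then 1 / (1 - t) else 1 / t) = (Polynomial.C (1 : ℝ)).eval t := by
    intro t ht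
    have h0 : t ≠ 0 := ht.1.ne'
    have h1 : (1 : ℝ) - t ≠ 0 := by have := ht.2; intro h; linarith
    cases ε
    · simp only [V, x₀, Bool.false_eq_true, if_false, Polynomial.eval_mul, Polynomial.eval_sub,
        Polynomial.eval_X, Polynomial.eval_C]
      field_simp
      ring
    · simp only [V, x₀, if_true, Polynomial.eval_mul, Polynomial.eval_sub, Polynomial.eval_X,
        Polynomial.eval_C]
      field_simp
      ring
  exact hP0 (Literature.Barriers.KontsevichZagierPeriods.KZ.NoSemialgPrimKernel.eq_zero_of_evalEval_eq_zero
    (G := fun s : ℝ => F fun _ => s) hderiv hDN hV hN P.natDegree P le_rfl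
    (fun t ht => hPv t (Ioo_subset_Icc_self ht)))

/-- `1/(1-t₁)` is dominated on `Δ₂` by the `ζ(2)` integrand `1/(t₀(1-t₁))` (as `t₀ < 1`), hence
absolutely integrable there. [folklore] -/
theorem integrableOn_one_div_one_sub : IntegrableOn (fun t : Fin 2 → ℝ => 1 / (1 - t 1)) (simplex 2) := by
  have hg : IntegrableOn zeta2Rep.integrand (simplex 2) := zeta2Rep.integrableOn
  refine Integrable.mono' hg ?_ ?_
  · have hm : Measurable fun t : Fin 2 → ℝ => 1 / (1 - t 1) :=
      (measurable_const.sub (measurable_pi_apply 1)).const_div 1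
    exact hm.aestronglyMeasurable
  · rw [simplex_eq_openOrderedSimplex, ae_restrict_iff' (KZ.measurableSet_openOrderedSimplex 2)]
    refine ae_of_all _ fun t ht => ?_
    obtain ⟨h0, h1, -⟩ := ht
    have ht0 : 0 < t 0 := h0 0
    have ht0' : t 0 < 1 := h1 0
    have ht1 : 0 < 1 - t 1 := by linarith [h1 1]
    rw [zeta2Rep_integrand, Real.norm_eq_abs, abs_of_pos (by positivity)]
    rw [div_mul_div_comm, one_mul, le_div_iff₀ (by positivity), div_mul_eq_mul_div, one_mul,
      div_le_iff₀ ht1]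
    nlinarith

/-- **The witness `r_L = [Δ₂, 1/(1-t₁)]`** (KZ-literal data `1/(1 - X₁)`; value `1`). [folklore] -/
def letterRep : KZ.IntegralRep 2 :=
  KZ.IntegralRep.ofRational (simplex 2) 1 (1 - MvPolynomial.X 1) (KZ.isSemialgebraic_openOrderedSimplex 2)
    (fun t ht => by
      have := ht.2.1 1
      simp only [map_sub, map_one, MvPolynomial.aeval_X, ne_eq]
      linarith)
    (by
      refine integrableOn_one_div_one_sub.congr_fun (fun t _ => ?_) (KZ.measurableSet_openOrderedSimplex 2)
      simp)

theorem letterRep_domain : letterRep.domain = simplex 2 := rfl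

theorem letterRep_integrand (t : Fin 2 → ℝ) : letterRep.integrand t = 1 / (1 - t 1) := by
  simp [letterRep]

/-- `r_L` has the genus-zero shape of the crux (`P = 1`, `a = 0`, `b = 0`, `c = (0,1)`). [folklore] -/
theorem isGenusZero_letterRep : IsGenusZero letterRep := by
  refine ⟨1, fun _ _ => 0, ![0, 0], ![0, 1], rfl, ?_⟩
  intro t _
  rw [letterRep_integrand]
  simp [gzIntegrand, Fin.prod_univ_two]

/-- The sub-calculus WITHOUT change of variables: moves (1a), (1b), (3). [folklore] -/
def relationsWithoutCoV : AddSubgroup KZ.FormalRep :=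
  AddSubgroup.closure (KZ.domainAddRel ∪ KZ.integrandAddRel ∪ KZ.newtonLeibnizRel)

theorem relationsWithoutCoV_le_relations : relationsWithoutCoV ≤ KZ.relations := by
  refine AddSubgroup.closure_mono ?_
  rintro c ((hc | hc) | hc)
  · exact Or.inl (Or.inl (Or.inl hc))
  · exact Or.inl (Or.inl (Or.inr hc))
  · exact Or.inr hc

/-- **The crux WITHOUT rule (2).** [folklore] -/
def CruxWithoutChangeOfVariables : Prop :=
  ∀ (k : ℕ) (r : KZ.IntegralRep k), IsGenusZero r →
    ∃ m ∈ AddSubgroup.closure wordRepSet, KZ.of r - m ∈ relationsWithoutCoV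

/-- OPEN QUESTION (no claim either way): the crux inside the sub-calculus generated by the
additivity moves, Newton–Leibniz, and coordinate PERMUTATIONS as the only changes of variables.
A proof of the crux in this form would show that the cubical charts and dihedral symmetries of §3
are conveniences; a refutation needs an invariant of `permRel` finer than the push-forward
invariants of §5 (which die under transpositions). [folklore] -/
def CruxWithPermutations : Prop :=
  ∀ (k : ℕ) (r : KZ.IntegralRep k), IsGenusZero r →
    ∃ m ∈ AddSubgroup.closure wordRepSet, KZ.of r - m ∈
      AddSubgroup.closure (KZ.domainAddRel ∪ KZ.integrandAddRel ∪ KZ.newtonLeibnizRel ∪ KZ.permRel)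


/-! ## §6 Rule (1b) is derivable from (1a) + (3) — certified (generation 3)

`integrandAddRel ⊆ closure(domainAddRel ∪ newtonLeibnizRel)`: given `f = f₁ + f₂` on `σ`, the
MIXING BAND `[σ × [0,2], h]`, `h(x,t) = f₁(x)(3/2 − t) + f₂(x)(t − 1/2)` — chosen so that
`∫₀¹ h dt = f₁`, `∫₁² h dt = f₂`, `∫₀² h dt = f₁ + f₂` with a primitive POLYNOMIAL in `t` (no
bump functions, no junction derivatives) — descends by one Newton–Leibniz move to `[σ, f₁+f₂]`,
splits by one domain-additivity move along the null hyperplane `t = 1`, and the two unit slabs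
descend by Newton–Leibniz moves to `[σ, f₁]`, `[σ, f₂]`.  Hence `relations = closure((1a) ∪ (2) ∪
(3))` (`relations_eq_closure_three`): integrand additivity is never the rule an invariant dies on,
and the load-bearing analysis of the crux is complete for three of the four rules — (3) and (2)
are load-bearing (§4, §5), (1b) never is; (1a) remains open (§3.5). -/

/-- A coordinate hyperplane `{z | z i = c}` of `ℝⁿ⁺¹` is Lebesgue-null. [folklore] -/
theorem volume_setOf_apply_eq (i : Fin (n + 1)) (c : ℝ) :
    volume {z : Fin (n + 1) → ℝ | z i = c} = 0 := by
  have h : {z : Fin (n + 1) → ℝ | z i = c} = Set.pi univ (fun j => if j = i then {c} else univ) := by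
    ext z
    simp only [mem_setOf_eq, mem_pi, mem_univ, true_implies]
    constructor
    · intro hz j
      split_ifs with hj
      · subst hj; simpa using hz
      · trivial
    · intro hz
      simpa using hz i
  rw [h, volume_pi_pi]
  apply Finset.prod_eq_zero (Finset.mem_univ i)
  simp

section Mix

variable (r₁ r₂ : KZ.IntegralRep n) (h₁₂ : r₂.domain = r₁.domain)

/-- The mixing integrand `h(x,t) = f₁(x)(3/2 - t) + f₂(x)(t - 1/2)` on `σ × [0,2]`:
`∫₀¹ h dt = f₁`, `∫₁² h dt = f₂`, `∫₀² h dt = f₁ + f₂`. [folklore] -/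
def mixFun (z : Fin (n + 1) → ℝ) : ℝ :=
  r₁.integrand (Fin.init z) * (3 / 2 - z (Fin.last n)) +
    r₂.integrand (Fin.init z) * (z (Fin.last n) - 1 / 2)

/-- Its fibrewise (polynomial in `t`) primitive. [folklore] -/
def mixPrim (z : Fin (n + 1) → ℝ) : ℝ :=
  r₁.integrand (Fin.init z) * (3 / 2 * z (Fin.last n) - z (Fin.last n) ^ 2 / 2) +
    r₂.integrand (Fin.init z) * (z (Fin.last n) ^ 2 / 2 - z (Fin.last n) / 2)

/-- The band `σ × [0,2]` as the union of the two unit slabs. [folklore] -/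
def bigBand : Set (Fin (n + 1) → ℝ) := r₁.slabDomain 0 ∪ r₁.slabDomain 1

theorem bigBand_eq : bigBand r₁ =
    {z | (Fin.init z : Fin n → ℝ) ∈ r₁.domain ∧ (0 : ℝ) ≤ z (Fin.last n) ∧ z (Fin.last n) ≤ 2} := by
  ext z
  simp only [bigBand, KZ.IntegralRep.slabDomain, mem_union, mem_setOf_eq, Nat.cast_zero,
    Nat.cast_one]
  constructor
  · rintro (⟨h, h0, h1⟩ | ⟨h, h0, h1⟩) <;> exact ⟨h, by linarith, by linarith⟩
  · rintro ⟨h, h0, h2⟩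
    by_cases hz : z (Fin.last n) ≤ 1
    · exact Or.inl ⟨h, h0, by linarith⟩
    · exact Or.inr ⟨h, by linarith, by linarith⟩

theorem init_mem_of_mem_bigBand {z : Fin (n + 1) → ℝ} (hz : z ∈ bigBand r₁) :
    (Fin.init z : Fin n → ℝ) ∈ r₁.domain := by
  rcases hz with h | h <;> exact h.1

include h₁₂ in
/-- The mixing integrand is `ℚ`-semialgebraic on every `ℚ`-semialgebraic set over `σ`
(Tarski–Seidenberg for sums and products, tree facts `add_holds`, `mul_holds`). [folklore] -/
theorem isSemialgebraicFunOn_mixFun {S : Set (Fin (n + 1) → ℝ)}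
    (hS : Literature.ModelTheory.ExponentialFields.IsSemialgebraic ℚ S)
    (hsub : ∀ z ∈ S, (Fin.init z : Fin n → ℝ) ∈ r₁.domain) : IsSemialgebraicFunOn ℚ S (mixFun r₁ r₂) := by
  have hf₁ : IsSemialgebraicFunOn ℚ S (fun z => r₁.integrand (Fin.init z)) :=
    r₁.isSemialgebraicFunOn_integrand.comp_init.mono (fun z hz => hsub z hz) hS
  have hf₂ : IsSemialgebraicFunOn ℚ S (fun z => r₂.integrand (Fin.init z)) :=
    r₂.isSemialgebraicFunOn_integrand.comp_init.mono
      (fun z hz => by show (Fin.init z : Fin n → ℝ) ∈ r₂.domain; rw [h₁₂]; exact hsub z hz) hS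
  have hp₁ : IsSemialgebraicFunOn ℚ S (fun z => (3 / 2 : ℝ) - z (Fin.last n)) :=
    (isSemialgebraicFunOn_aeval hS (MvPolynomial.C (3 / 2 : ℚ) - MvPolynomial.X (Fin.last n))).congr fun z _ => by
      simp only [map_sub, MvPolynomial.aeval_C, MvPolynomial.aeval_X, eq_ratCast]; push_cast; ring
  have hp₂ : IsSemialgebraicFunOn ℚ S (fun z => z (Fin.last n) - (1 / 2 : ℝ)) :=
    (isSemialgebraicFunOn_aeval hS (MvPolynomial.X (Fin.last n) - MvPolynomial.C (1 / 2 : ℚ))).congr fun z _ => by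
      simp only [map_sub, MvPolynomial.aeval_C, MvPolynomial.aeval_X, eq_ratCast]; push_cast; ring
  exact IsSemialgebraicFunOn.add_holds (IsSemialgebraicFunOn.mul_holds hf₁ hp₁)
    (IsSemialgebraicFunOn.mul_holds hf₂ hp₂)

include h₁₂ in
/-- The primitive is `ℚ`-semialgebraic likewise. [folklore] -/
theorem isSemialgebraicFunOn_mixPrim {S : Set (Fin (n + 1) → ℝ)}
    (hS : Literature.ModelTheory.ExponentialFields.IsSemialgebraic ℚ S)
    (hsub : ∀ z ∈ S, (Fin.init z : Fin n → ℝ) ∈ r₁.domain) : IsSemialgebraicFunOn ℚ S (mixPrim r₁ r₂) := by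
  have hf₁ : IsSemialgebraicFunOn ℚ S (fun z => r₁.integrand (Fin.init z)) :=
    r₁.isSemialgebraicFunOn_integrand.comp_init.mono (fun z hz => hsub z hz) hS
  have hf₂ : IsSemialgebraicFunOn ℚ S (fun z => r₂.integrand (Fin.init z)) :=
    r₂.isSemialgebraicFunOn_integrand.comp_init.mono
      (fun z hz => by show (Fin.init z : Fin n → ℝ) ∈ r₂.domain; rw [h₁₂]; exact hsub z hz) hS
  have hp₁ : IsSemialgebraicFunOn ℚ S
      (fun z => (3 / 2 : ℝ) * z (Fin.last n) - z (Fin.last n) ^ 2 / 2) :=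
    (isSemialgebraicFunOn_aeval hS
      (MvPolynomial.C (3 / 2 : ℚ) * MvPolynomial.X (Fin.last n) - MvPolynomial.C (1 / 2 : ℚ) * MvPolynomial.X (Fin.last n) ^ 2)).congr fun z _ => by
      simp only [map_sub, map_mul, map_pow, MvPolynomial.aeval_C, MvPolynomial.aeval_X, eq_ratCast]; push_cast; ring
  have hp₂ : IsSemialgebraicFunOn ℚ S
      (fun z => z (Fin.last n) ^ 2 / 2 - z (Fin.last n) / 2) :=
    (isSemialgebraicFunOn_aeval hS
      (MvPolynomial.C (1 / 2 : ℚ) * MvPolynomial.X (Fin.last n) ^ 2 - MvPolynomial.C (1 / 2 : ℚ) * MvPolynomial.X (Fin.last n))).congr fun z _ => by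
      simp only [map_sub, map_mul, map_pow, MvPolynomial.aeval_C, MvPolynomial.aeval_X, eq_ratCast]; push_cast; ring
  exact IsSemialgebraicFunOn.add_holds (IsSemialgebraicFunOn.mul_holds hf₁ hp₁)
    (IsSemialgebraicFunOn.mul_holds hf₂ hp₂)

include h₁₂ in
theorem slabDomain_eq (j : ℕ) : r₂.slabDomain j = r₁.slabDomain j := by
  simp only [KZ.IntegralRep.slabDomain, h₁₂]

include h₁₂ in
/-- The mixing integrand is absolutely integrable on each slab `σ × [j, j+1]`, `j ≤ 1`
(integrable factor times a bounded polynomial). [folklore] -/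
theorem integrableOn_mixFun_slab (j : ℕ) (hj : j ≤ 1) :
    IntegrableOn (mixFun r₁ r₂) (r₁.slabDomain j) := by
  have hm : MeasurableSet (r₁.slabDomain j) :=
    Literature.ModelTheory.ExponentialFields.IsSemialgebraic.measurableSet_holds
      (r₁.isSemialgebraic_slabDomain j)
  have hI₁ : IntegrableOn (fun z : Fin (n + 1) → ℝ => r₁.integrand (Fin.init z))
      (r₁.slabDomain j) := r₁.integrableOn_slabDomain j
  have hI₂ : IntegrableOn (fun z : Fin (n + 1) → ℝ => r₂.integrand (Fin.init z))
      (r₁.slabDomain j) := slabDomain_eq r₁ r₂ h₁₂ j ▸ r₂.integrableOn_slabDomain j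
  have hj' : (j : ℝ) ≤ 1 := by exact_mod_cast hj
  have hb₁ : ∀ᵐ z ∂(volume.restrict (r₁.slabDomain j)),
      ‖(3 / 2 : ℝ) - z (Fin.last n)‖ ≤ 4 := by
    rw [ae_restrict_iff' hm]
    refine ae_of_all _ fun z hz => ?_
    obtain ⟨-, hz1, hz2⟩ := hz
    rw [Real.norm_eq_abs, abs_le]
    constructor <;> linarith
  have hb₂ : ∀ᵐ z ∂(volume.restrict (r₁.slabDomain j)),
      ‖z (Fin.last n) - (1 / 2 : ℝ)‖ ≤ 4 := by
    rw [ae_restrict_iff' hm]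
    refine ae_of_all _ fun z hz => ?_
    obtain ⟨-, hz1, hz2⟩ := hz
    rw [Real.norm_eq_abs, abs_le]
    constructor <;> linarith
  have hc₁ : AEStronglyMeasurable (fun z : Fin (n + 1) → ℝ => (3 / 2 : ℝ) - z (Fin.last n))
      (volume.restrict (r₁.slabDomain j)) :=
    (continuous_const.sub (continuous_apply _)).aestronglyMeasurable
  have hc₂ : AEStronglyMeasurable (fun z : Fin (n + 1) → ℝ => z (Fin.last n) - (1 / 2 : ℝ))
      (volume.restrict (r₁.slabDomain j)) :=
    ((continuous_apply _).sub continuous_const).aestronglyMeasurable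
  exact (Integrable.mul_bdd hI₁ hc₁ hb₁).add (Integrable.mul_bdd hI₂ hc₂ hb₂)

/-- The mixing representation on the big band `σ × [0,2]`. [folklore] -/
def mixRep : KZ.IntegralRep (n + 1) where
  domain := bigBand r₁
  integrand := mixFun r₁ r₂
  isSemialgebraic_domain := (r₁.isSemialgebraic_slabDomain 0).union (r₁.isSemialgebraic_slabDomain 1)
  isSemialgebraicFunOn_integrand :=
    isSemialgebraicFunOn_mixFun r₁ r₂ h₁₂
      ((r₁.isSemialgebraic_slabDomain 0).union (r₁.isSemialgebraic_slabDomain 1))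
      (fun _ hz => init_mem_of_mem_bigBand r₁ hz)
  integrableOn :=
    (integrableOn_mixFun_slab r₁ r₂ h₁₂ 0 (by norm_num)).union
      (integrableOn_mixFun_slab r₁ r₂ h₁₂ 1 le_rfl)

/-- The mixing representation on the slab `σ × [j, j+1]`. [folklore] -/
def mixSlab (j : ℕ) (hj : j ≤ 1) : KZ.IntegralRep (n + 1) where
  domain := r₁.slabDomain j
  integrand := mixFun r₁ r₂
  isSemialgebraic_domain := r₁.isSemialgebraic_slabDomain j
  isSemialgebraicFunOn_integrand :=
    isSemialgebraicFunOn_mixFun r₁ r₂ h₁₂ (r₁.isSemialgebraic_slabDomain j) (fun _ hz => hz.1)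
  integrableOn := integrableOn_mixFun_slab r₁ r₂ h₁₂ j hj

/-- Fibrewise derivative of the primitive. [folklore] -/
theorem hasDerivAt_mixPrim (x : Fin n → ℝ) (t : ℝ) :
    HasDerivAt (fun s : ℝ => mixPrim r₁ r₂ (Fin.snoc x s)) (mixFun r₁ r₂ (Fin.snoc x t)) t := by
  simp only [mixPrim, mixFun, Fin.init_snoc, Fin.snoc_last]
  have h1 : HasDerivAt (fun s : ℝ => 3 / 2 * s - s ^ 2 / 2) (3 / 2 * 1 - (2 : ℕ) * t ^ (2 - 1) * 1 / 2) t :=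
    ((hasDerivAt_id t).const_mul (3 / 2)).sub (((hasDerivAt_id t).pow 2).div_const 2)
  have h2 : HasDerivAt (fun s : ℝ => s ^ 2 / 2 - s / 2) ((2 : ℕ) * t ^ (2 - 1) * 1 / 2 - 1 / 2) t :=
    (((hasDerivAt_id t).pow 2).div_const 2).sub ((hasDerivAt_id t).div_const 2)
  refine ((h1.const_mul (r₁.integrand x)).add (h2.const_mul (r₂.integrand x))).congr_deriv ?_
  push_cast
  ring

/-- `[mixSlab 0] − [r₁]` is one Newton–Leibniz move (`∫₀¹ h dt = f₁`). [folklore] -/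
theorem of_mixSlab_zero_sub_mem :
    KZ.of (mixSlab r₁ r₂ h₁₂ 0 (by norm_num)) - KZ.of r₁ ∈ KZ.newtonLeibnizRel := by
  refine ⟨n, mixSlab r₁ r₂ h₁₂ 0 (by norm_num), r₁, fun _ => ((0 : ℕ) : ℝ), fun _ => ((0 : ℕ) : ℝ) + 1,
    mixPrim r₁ r₂, ?_, isSemialgebraicFunOn_natCast r₁.isSemialgebraic_domain 0, ?_,
    fun _ _ => by norm_num, rfl, ?_, ?_, ?_, rfl⟩
  · exact isSemialgebraicFunOn_mixPrim r₁ r₂ h₁₂ (r₁.isSemialgebraic_slabDomain 0) (fun _ hz => hz.1)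
  · exact (isSemialgebraicFunOn_aeval r₁.isSemialgebraic_domain
      (((0 : ℕ) : MvPolynomial (Fin n) ℚ) + 1)).congr fun x _ => by simp
  · intro x _
    simp only [mixPrim, Fin.snoc_last, Fin.init_snoc]
    fun_prop
  · intro x _ t _
    exact hasDerivAt_mixPrim r₁ r₂ x t
  · intro x _
    simp only [mixPrim, Fin.snoc_last, Fin.init_snoc]
    push_cast
    ring

/-- `[mixSlab 1] − [r₂]` is one Newton–Leibniz move (`∫₁² h dt = f₂`). [folklore] -/
theorem of_mixSlab_one_sub_mem :
    KZ.of (mixSlab r₁ r₂ h₁₂ 1 le_rfl) - KZ.of r₂ ∈ KZ.newtonLeibnizRel := by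
  refine ⟨n, mixSlab r₁ r₂ h₁₂ 1 le_rfl, r₂, fun _ => ((1 : ℕ) : ℝ), fun _ => ((1 : ℕ) : ℝ) + 1,
    mixPrim r₁ r₂, ?_, isSemialgebraicFunOn_natCast r₂.isSemialgebraic_domain 1, ?_,
    fun _ _ => by norm_num, ?_, ?_, ?_, ?_, rfl⟩
  · exact isSemialgebraicFunOn_mixPrim r₁ r₂ h₁₂ (r₁.isSemialgebraic_slabDomain 1) (fun _ hz => hz.1)
  · exact (isSemialgebraicFunOn_aeval r₂.isSemialgebraic_domain
      (((1 : ℕ) : MvPolynomial (Fin n) ℚ) + 1)).congr fun x _ => by simp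
  · show r₁.slabDomain 1 = _
    rw [← slabDomain_eq r₁ r₂ h₁₂ 1]
    rfl
  · intro x _
    simp only [mixPrim, Fin.snoc_last, Fin.init_snoc]
    fun_prop
  · intro x _ t _
    exact hasDerivAt_mixPrim r₁ r₂ x t
  · intro x _
    simp only [mixPrim, Fin.snoc_last, Fin.init_snoc]
    push_cast
    ring

/-- `[mixRep] − [mixSlab 0] − [mixSlab 1]` is one domain-additivity move (cut at `t = 1`, a
null hyperplane). [folklore] -/
theorem of_mixRep_sub_sub_mem :
    KZ.of (mixRep r₁ r₂ h₁₂) - KZ.of (mixSlab r₁ r₂ h₁₂ 0 (by norm_num)) -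
      KZ.of (mixSlab r₁ r₂ h₁₂ 1 le_rfl) ∈ KZ.domainAddRel := by
  refine ⟨n + 1, mixRep r₁ r₂ h₁₂, mixSlab r₁ r₂ h₁₂ 0 (by norm_num), mixSlab r₁ r₂ h₁₂ 1 le_rfl,
    rfl, ?_, fun _ _ => rfl, fun _ _ => rfl, rfl⟩
  refine measure_mono_null (fun z hz => ?_) (volume_setOf_apply_eq (Fin.last n) 1)
  obtain ⟨⟨-, -, h0⟩, ⟨-, h1, -⟩⟩ := hz
  simp only [Nat.cast_zero, zero_add, Nat.cast_one] at h0 h1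
  exact le_antisymm h0 h1

end Mix

/-- **Rule (1b) is derivable from rules (1a) and (3).** Given `f = f₁ + f₂` on `σ`, the mixing
band `[σ × [0,2], f₁(x)(3/2 - t) + f₂(x)(t - 1/2)]` descends by ONE Newton–Leibniz move to
`[σ, f₁ + f₂]`, splits by ONE domain-additivity move at `t = 1`, and the two slabs descend by
Newton–Leibniz moves to `[σ, f₁]` and `[σ, f₂]` (all primitives polynomial in `t`).  Consequence:
integrand additivity is never a load-bearing rule; an additive invariant of the calculus need only
be tested against (1a), (2), (3). [Kontsevich–Zagier 2001, §1.2] [folklore] -/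
theorem integrandAddRel_subset_closure :
    KZ.integrandAddRel ⊆ (AddSubgroup.closure (KZ.domainAddRel ∪ KZ.newtonLeibnizRel) :
      Set KZ.FormalRep) := by
  rintro c ⟨n, r, r₁, r₂, h₁, h₂, hadd, rfl⟩
  have h₁₂ : r₂.domain = r₁.domain := h₂.trans h₁.symm
  set S := AddSubgroup.closure (KZ.domainAddRel ∪ KZ.newtonLeibnizRel) with hS
  have hNL : ∀ {x}, x ∈ KZ.newtonLeibnizRel → x ∈ S := fun hx => AddSubgroup.subset_closure (Or.inr hx)
  have hDA : ∀ {x}, x ∈ KZ.domainAddRel → x ∈ S := fun hx => AddSubgroup.subset_closure (Or.inl hx)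
  -- the big band descends to `r`
  have hbig : KZ.of (mixRep r₁ r₂ h₁₂) - KZ.of r ∈ KZ.newtonLeibnizRel := by
    refine ⟨n, mixRep r₁ r₂ h₁₂, r, fun _ => ((0 : ℕ) : ℝ), fun _ => ((2 : ℕ) : ℝ),
      mixPrim r₁ r₂, ?_, isSemialgebraicFunOn_natCast r.isSemialgebraic_domain 0,
      isSemialgebraicFunOn_natCast r.isSemialgebraic_domain 2, fun _ _ => by norm_num, ?_, ?_, ?_, ?_, rfl⟩
    · exact isSemialgebraicFunOn_mixPrim r₁ r₂ h₁₂
        ((r₁.isSemialgebraic_slabDomain 0).union (r₁.isSemialgebraic_slabDomain 1))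
        (fun _ hz => init_mem_of_mem_bigBand r₁ hz)
    · show bigBand r₁ = _
      rw [bigBand_eq, h₁]
      ext z
      simp only [mem_setOf_eq, Nat.cast_zero, Nat.cast_ofNat]
    · intro x _
      simp only [mixPrim, Fin.snoc_last, Fin.init_snoc]
      fun_prop
    · intro x _ t _
      exact hasDerivAt_mixPrim r₁ r₂ x t
    · intro x hx
      have := hadd hx
      simp only [Pi.add_apply] at this
      simp only [mixPrim, Fin.snoc_last, Fin.init_snoc, this]
      push_cast
      ring
  have key : KZ.of r - KZ.of r₁ - KZ.of r₂ =
      -(KZ.of (mixRep r₁ r₂ h₁₂) - KZ.of r) +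
      (KZ.of (mixRep r₁ r₂ h₁₂) - KZ.of (mixSlab r₁ r₂ h₁₂ 0 (by norm_num)) -
        KZ.of (mixSlab r₁ r₂ h₁₂ 1 le_rfl)) +
      (KZ.of (mixSlab r₁ r₂ h₁₂ 0 (by norm_num)) - KZ.of r₁) +
      (KZ.of (mixSlab r₁ r₂ h₁₂ 1 le_rfl) - KZ.of r₂) := by abel
  rw [SetLike.mem_coe, key]
  exact add_mem (add_mem (add_mem (neg_mem (hNL hbig)) (hDA (of_mixRep_sub_sub_mem r₁ r₂ h₁₂)))
    (hNL (of_mixSlab_zero_sub_mem r₁ r₂ h₁₂))) (hNL (of_mixSlab_one_sub_mem r₁ r₂ h₁₂))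

/-- Hence the three move sets (1a), (2), (3) already generate `KZ.relations`. [folklore] -/
theorem relations_eq_closure_three :
    KZ.relations = AddSubgroup.closure (KZ.domainAddRel ∪ KZ.changeOfVariablesRel ∪ KZ.newtonLeibnizRel) := by
  apply le_antisymm
  · refine (AddSubgroup.closure_le _).mpr ?_
    rintro c (((hc | hc) | hc) | hc)
    · exact AddSubgroup.subset_closure (Or.inl (Or.inl hc))
    · refine AddSubgroup.closure_mono ?_ (integrandAddRel_subset_closure hc)
      rintro x (hx | hx)
      · exact Or.inl (Or.inl hx)
      · exact Or.inr hx
    · exact AddSubgroup.subset_closure (Or.inl (Or.inr hc))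
    · exact AddSubgroup.subset_closure (Or.inr hc)
  · refine AddSubgroup.closure_mono ?_
    rintro c ((hc | hc) | hc)
    · exact Or.inl (Or.inl (Or.inl hc))
    · exact Or.inl (Or.inr hc)
    · exact Or.inr hc


section Elimination

open Polynomial
open scoped Polynomial.Bivariate

/-! ## §7 The elimination step of §5, certified (generation 3): no linear combination of algebraic functions is a primitive of a simple pole

Items (3)–(4) of the obstruction list of `dihedralNormalForm_false_without_changeOfVariables` are
DISCHARGED here in a stronger and simpler form than announced: no piecewise-analytic structure is
needed.  If each `φᵢ` satisfies a REAL polynomial relation `Pᵢ(t, φᵢ t) = 0` on an interval, then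
`(∏ lead Pᵢ)·Σ λᵢφᵢ` is INTEGRAL over `ℝ[t]` in the ring of all real functions on the interval
(`exists_monic_evalEval_eq_zero`), so it satisfies a monic relation; rescaling the relation and the
barrier's simple-pole descent, transported to an arbitrary interval
(`eq_zero_of_evalEval_eq_zero_Ioo`), give `no_linearCombination_algebraic_primitive(_letter)`.
What remains for a Lean proof of §5: (1) the two-coordinate push-forward of `f·λ|_σ` and its
invariance under Newton–Leibniz in a third coordinate; (2) unpacking `AddSubgroup.closure`
membership into a finite `ℤ`-combination of move instances and selecting two a.e.-generic lines
`x₀ = r₁, r₂`; (3') the real-coefficient version of steps (A)–(B) of the barrier in `ℝ³` (a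
`ℚ`-semialgebraic `F(x₀,x₁)` satisfies `q(x₀,x₁,F) = 0`, `q ≠ 0 ∈ ℝ[x₀,x₁,y]`, whence
`q(r,·,·) ≠ 0` for all but finitely many `r`). -/

/-! ### (A) bivariate evaluation in the ring of functions on a set -/

/-- The ring of real functions on `J` as an algebra over `ℝ[X]` through evaluation. -/
def evalFun (J : Set ℝ) : ℝ[X] →+* (J → ℝ) :=
  RingHom.pi fun t : J => Polynomial.evalRingHom (t : ℝ)

@[simp] theorem evalFun_apply (J : Set ℝ) (p : ℝ[X]) (t : J) : evalFun J p t = p.eval (t : ℝ) := rfl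

/-- `eval₂` into the function ring is pointwise bivariate evaluation. [folklore] -/
theorem eval₂_evalFun_apply (J : Set ℝ) (P : ℝ[X][Y]) (x : J → ℝ) (t : J) :
    (P.eval₂ (evalFun J) x) t = P.evalEval (t : ℝ) (x t) := by
  induction P using Polynomial.induction_on' with
  | add p q hp hq => simp [eval₂_add, evalEval_add, hp, hq]
  | monomial n a =>
    simp [eval₂_monomial, evalEval, eval_monomial]

/-! ### (B) integrality of linear combinations -/

/-- If each `φᵢ` satisfies a non-trivial polynomial relation `Pᵢ(t, φᵢ t) = 0` on `J`, then
`a(t) · Σ λᵢ φᵢ(t)`, `a = ∏ᵢ lead(Pᵢ)`, satisfies a MONIC polynomial relation on `J` (integrality of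
`lead(Pᵢ)·φᵢ` over `ℝ[t]` in the ring of functions on `J`, and closure of integral elements under
ring operations). [folklore] -/
theorem exists_monic_evalEval_eq_zero {ι : Type*} [Fintype ι] [DecidableEq ι] {J : Set ℝ}
    (φ : ι → ℝ → ℝ) (P : ι → ℝ[X][Y])
    (hrel : ∀ i, ∀ t ∈ J, (P i).evalEval t (φ i t) = 0) (lam : ι → ℝ) :
    ∃ Q : ℝ[X][Y], Q.Monic ∧ ∀ t ∈ J,
      Q.evalEval t ((∏ i, ((P i).leadingCoeff).eval t) * ∑ i, lam i * φ i t) = 0 := by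
  set f := evalFun J with hf
  let x : ι → J → ℝ := fun i t => φ i t
  have hx : ∀ i, (P i).eval₂ f (x i) = 0 := by
    intro i
    funext t
    rw [eval₂_evalFun_apply]
    exact hrel i t t.2
  have hint : ∀ i, f.IsIntegralElem (f (P i).leadingCoeff * x i) := fun i =>
    f.isIntegralElem_leadingCoeff_mul (P i) (x i) (hx i)
  -- the combination, written inside the integral closure
  set H : J → ℝ := ∑ i, f (C (lam i) * ∏ i' ∈ Finset.univ.erase i, (P i').leadingCoeff) *
    (f (P i).leadingCoeff * x i) with hH
  have hHint : f.IsIntegralElem H := by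
    rw [hH]
    refine Finset.sum_induction _ (fun y => f.IsIntegralElem y)
      (fun a b ha hb => RingHom.IsIntegralElem.add f ha hb) ?_
      (fun i _ => RingHom.IsIntegralElem.mul f f.isIntegralElem_map (hint i))
    simpa using f.isIntegralElem_map (x := 0)
  obtain ⟨Q, hQm, hQ⟩ := hHint
  refine ⟨Q, hQm, fun t ht => ?_⟩
  have happ := congrFun hQ ⟨t, ht⟩
  rw [eval₂_evalFun_apply] at happ
  simp only [Pi.zero_apply] at happ
  convert happ using 2
  -- pointwise identity `a(t) Σ λᵢ φᵢ(t) = H t`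
  simp only [hH, hf, Finset.sum_apply, Pi.mul_apply, evalFun_apply, eval_mul, eval_C, eval_prod, x,
    Finset.mul_sum]
  refine Finset.sum_congr rfl fun i _ => ?_
  rw [← Finset.prod_erase_mul _ _ (Finset.mem_univ i)]
  ring

/-! ### (C) the simple-pole descent on an arbitrary open interval -/

/-- Coefficientwise composition commutes with bivariate evaluation. [folklore] -/
theorem evalEval_map_compRingHom (P : ℝ[X][Y]) (q : ℝ[X]) (s y : ℝ) :
    (P.map q.compRingHom).evalEval s y = P.evalEval (q.eval s) y := by
  induction P using Polynomial.induction_on' with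
  | add p r hp hr => simp [Polynomial.map_add, evalEval_add, hp, hr]
  | monomial n a =>
    simp [Polynomial.map_monomial, evalEval, eval_monomial, eval_comp]

/-- **Step (C) of the barrier on an arbitrary interval** (transport by an affine substitution): a
function whose derivative on `(u, v)` is `N/((X − x₀) V)` with `V(x₀) N(x₀) ≠ 0` satisfies no
non-trivial polynomial relation `P(t, G t) = 0` on `(u, v)`. [folklore] -/
theorem eq_zero_of_evalEval_eq_zero_Ioo {u v : ℝ} (huv : u < v) {G g' : ℝ → ℝ} {V N : ℝ[X]}
    {x₀ : ℝ} (hG : ∀ t ∈ Ioo u v, HasDerivAt G (g' t) t)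
    (hDN : ∀ t ∈ Ioo u v, ((X - C x₀) * V).eval t * g' t = N.eval t)
    (hV : V.eval x₀ ≠ 0) (hN : N.eval x₀ ≠ 0) (P : ℝ[X][Y])
    (hv : ∀ t ∈ Ioo u v, P.evalEval t (G t) = 0) : P = 0 := by
  have hw : v - u ≠ 0 := by linarith
  have hw0 : 0 < v - u := by linarith
  set q : ℝ[X] := C u + C (v - u) * X with hq
  have hqe : ∀ s, q.eval s = u + (v - u) * s := fun s => by simp [hq]
  have hφ : ∀ s ∈ Ioo (0 : ℝ) 1, q.eval s ∈ Ioo u v := by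
    intro s hs
    rw [hqe]
    constructor <;> nlinarith [hs.1, hs.2]
  set x₁ : ℝ := (x₀ - u) / (v - u) with hx₁
  have hqx₁ : q.eval x₁ = x₀ := by
    rw [hqe, hx₁]; field_simp; ring
  have hG' : ∀ s ∈ Ioo (0 : ℝ) 1,
      HasDerivAt (fun s => G (q.eval s)) ((v - u) * g' (q.eval s)) s := by
    intro s hs
    have h1 : HasDerivAt (fun s : ℝ => u + (v - u) * s) (v - u) s := by
      simpa using ((hasDerivAt_id s).const_mul (v - u)).const_add u
    have h2 := (hG _ (hφ s hs)).comp s (h1.congr_of_eventuallyEq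
      (Filter.Eventually.of_forall fun s => (hqe s)))
    simpa [mul_comm, Function.comp_def, hqe] using h2
  have hDN' : ∀ s ∈ Ioo (0 : ℝ) 1,
      ((X - C x₁) * V.comp q).eval s * ((v - u) * g' (q.eval s)) = (N.comp q).eval s := by
    intro s hs
    have h := hDN _ (hφ s hs)
    simp only [eval_mul, eval_sub, eval_X, eval_C, eval_comp] at h ⊢
    have e : (s - x₁) * (v - u) = q.eval s - x₀ := by
      rw [hqe, hx₁]; field_simp; ring
    calc (s - x₁) * V.eval (q.eval s) * ((v - u) * g' (q.eval s))
        = ((s - x₁) * (v - u)) * V.eval (q.eval s) * g' (q.eval s) := by ring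
      _ = N.eval (q.eval s) := by rw [e]; exact h
  have hV' : (V.comp q).eval x₁ ≠ 0 := by rwa [eval_comp, hqx₁]
  have hN' : (N.comp q).eval x₁ ≠ 0 := by rwa [eval_comp, hqx₁]
  have key := Literature.Barriers.KontsevichZagierPeriods.KZ.NoSemialgPrimKernel.eq_zero_of_evalEval_eq_zero
    (G := fun s => G (q.eval s)) hG' hDN' hV' hN' _ (P.map q.compRingHom) le_rfl
    (fun s hs => by rw [evalEval_map_compRingHom]; exact hv _ (hφ s hs))
  have hinj : Function.Injective (q.compRingHom : ℝ[X] → ℝ[X]) := by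
    intro a b hab
    have h0 : (a - b).comp q = 0 := by
      have : a.comp q = b.comp q := hab
      rw [sub_comp, this, sub_self]
    rcases (comp_eq_zero_iff.1 h0) with h | ⟨-, h⟩
    · exact sub_eq_zero.1 h
    · exfalso
      have := congrArg (Polynomial.coeff · 1) h
      simp [hq, coeff_C, coeff_X] at this
      exact hw this
  exact Polynomial.map_injective _ hinj (key.trans (Polynomial.map_zero _).symm)

/-! ### (D) the combination lemma -/

/-- **No `ℝ`-linear combination of pointwise-algebraic functions is a primitive of a simple pole.**
If `G = Σ λᵢ φᵢ` on `(u,v)` with each `φᵢ` satisfying a non-trivial polynomial relation there, then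
`G' = N/((X − x₀)V)` with `V(x₀)N(x₀) ≠ 0` is impossible.  (Elimination step of the rule-(2)
analysis of crux `DihedralNormalForm`, work file §5; generalises the one-function barrier
`AlgebraicPrimitivesObstruction`.) [folklore] -/
theorem no_linearCombination_algebraic_primitive {ι : Type*} [Fintype ι] [DecidableEq ι]
    {u v : ℝ} (huv : u < v) (φ : ι → ℝ → ℝ) (P : ι → ℝ[X][Y]) (hP0 : ∀ i, P i ≠ 0)
    (hrel : ∀ i, ∀ t ∈ Ioo u v, (P i).evalEval t (φ i t) = 0) (lam : ι → ℝ)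
    {G g' : ℝ → ℝ} (hGsum : ∀ t ∈ Ioo u v, G t = ∑ i, lam i * φ i t)
    (hG : ∀ t ∈ Ioo u v, HasDerivAt G (g' t) t) {V N : ℝ[X]} {x₀ : ℝ}
    (hDN : ∀ t ∈ Ioo u v, ((X - C x₀) * V).eval t * g' t = N.eval t)
    (hV : V.eval x₀ ≠ 0) (hN : N.eval x₀ ≠ 0) : False := by
  obtain ⟨Q, hQm, hQ⟩ := exists_monic_evalEval_eq_zero φ P hrel lam
  set a : ℝ[X] := ∏ i, (P i).leadingCoeff with ha
  have ha0 : a ≠ 0 := Finset.prod_ne_zero_iff.2 fun i _ => leadingCoeff_ne_zero.2 (hP0 i)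
  have hae : ∀ t, a.eval t = ∏ i, ((P i).leadingCoeff).eval t := fun t => by rw [ha, eval_prod]
  -- `P* (t, Y) := Q(t, a(t) Y)`
  set d := Q.natDegree with hd
  set Pstar : ℝ[X][Y] := ∑ j ∈ Finset.range (d + 1), C (Q.coeff j * a ^ j) * Y ^ j with hPstar
  have hPstar_eval : ∀ t y, Pstar.evalEval t y = Q.evalEval t (a.eval t * y) := by
    intro t y
    have hQsum : Q = ∑ j ∈ Finset.range (d + 1), C (Q.coeff j) * Y ^ j := Q.as_sum_range_C_mul_X_pow
    conv_rhs => rw [hQsum]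
    simp only [hPstar, evalEval_finsetSum, evalEval_mul, evalEval_C, evalEval_pow, evalEval_X,
      eval_mul, eval_pow]
    refine Finset.sum_congr rfl fun j _ => ?_
    ring
  have hPstar0 : Pstar ≠ 0 := by
    intro h0
    have hc := congrArg (Polynomial.coeff · d) h0
    simp only [hPstar, coeff_zero] at hc
    rw [Literature.Barriers.KontsevichZagierPeriods.KZ.NoSemialgPrim.coeff_sum_C_mul_X_pow] at hc
    simp only [lt_add_iff_pos_right, zero_lt_one, if_true] at hc
    have hlead : Q.coeff d = 1 := hQm
    rw [hlead, one_mul] at hc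
    exact pow_ne_zero d ha0 hc
  refine hPstar0 (eq_zero_of_evalEval_eq_zero_Ioo huv hG hDN hV hN Pstar fun t ht => ?_)
  rw [hPstar_eval, hGsum t ht, hae]
  exact hQ t ht

/-- Corollary for the letters: no `ℝ`-linear combination of pointwise-algebraic functions on an
interval `(u,v)`, `v ≤ 1` (resp. `0 ≤ u`), has derivative `c/(1-t)` (resp. `c/t`), `c ≠ 0`. [folklore] -/
theorem no_linearCombination_algebraic_primitive_letter {ι : Type*} [Fintype ι] [DecidableEq ι]
    (ε : Bool) {u v : ℝ} (huv : u < v) (hside : if ε then v ≤ 1 else 0 ≤ u)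
    (φ : ι → ℝ → ℝ) (P : ι → ℝ[X][Y]) (hP0 : ∀ i, P i ≠ 0)
    (hrel : ∀ i, ∀ t ∈ Ioo u v, (P i).evalEval t (φ i t) = 0) (lam : ι → ℝ)
    {G : ℝ → ℝ} (hGsum : ∀ t ∈ Ioo u v, G t = ∑ i, lam i * φ i t) {c : ℝ} (hc : c ≠ 0)
    (hG : ∀ t ∈ Ioo u v, HasDerivAt G (if ε then c / (1 - t) else c / t) t) : False := by
  let x₀ : ℝ := if ε then 1 else 0
  let V : ℝ[X] := if ε then C (-1) else C 1
  have hV : V.eval x₀ ≠ 0 := by cases ε <;> simp [V, x₀]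
  have hN : (C c : ℝ[X]).eval x₀ ≠ 0 := by simpa using hc
  refine no_linearCombination_algebraic_primitive huv φ P hP0 hrel lam hGsum hG
    (V := V) (N := C c) (x₀ := x₀) (fun t ht => ?_) hV hN
  cases ε
  · simp only [Bool.false_eq_true, if_false] at hside ⊢
    have h0 : t ≠ 0 := by intro h; rw [h] at ht; linarith [ht.1]
    simp only [V, x₀, Bool.false_eq_true, if_false, eval_mul, eval_sub, eval_X, eval_C]
    field_simp
    ring
  · simp only [if_true] at hside ⊢
    have h1 : (1 : ℝ) - t ≠ 0 := by intro h; linarith [ht.2]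
    simp only [V, x₀, if_true, eval_mul, eval_sub, eval_X, eval_C]
    field_simp
    ring

end Elimination

/-! ## §8 Slices of the semialgebraic primitives satisfy REAL polynomial relations — certified (generation 3)

Item (3) of the remaining list for `dihedralNormalForm_false_without_changeOfVariables`: the
elimination of §7 runs along two lines `x₀ = r₁, r₂` with real a.e.-generic parameters, so the
slices `x₁ ↦ Fⱼ(r, x₁)` of the `ℚ`-semialgebraic primitives must satisfy polynomial relations
with REAL coefficients.  Base change `ℚ → ℝ`, slicing as a polynomial preimage, and steps (A)–(B)
of the barrier over `ℝ` on an arbitrary base set give `exists_ne_zero_evalEval_slice` for EVERY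
real `r` (no exceptional parameters).  The measure-theoretic part (push-forward invariant, generic
lines) follows in §9, which completes the Lean proof. -/

section Slices

open Polynomial
open scoped Polynomial.Bivariate
open Literature.ModelTheory.ExponentialFields

/-! ### (a) base change `ℚ → ℝ` -/

/-- A `ℚ`-semialgebraic set is `ℝ`-semialgebraic. [folklore] -/
theorem isSemialgebraic_real_of_rat {ι : Type*} {s : Set (ι → ℝ)} (hs : IsSemialgebraic ℚ s) :
    IsSemialgebraic ℝ s := by
  unfold IsSemialgebraic semialgebraicSets at hs
  induction hs using BooleanSubalgebra.closure_bot_sup_induction with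
  | mem t ht =>
    rcases ht with ⟨p, rfl⟩ | ⟨p, rfl⟩
    · convert isSemialgebraic_setOf_eval_eq_zero (k := ℝ) (R := ℝ)
        (MvPolynomial.map (algebraMap ℚ ℝ) p) using 1
      ext x
      simp [MvPolynomial.aeval_map_algebraMap]
    · convert isSemialgebraic_setOf_eval_pos (k := ℝ) (R := ℝ)
        (MvPolynomial.map (algebraMap ℚ ℝ) p) using 1
      ext x
      simp [MvPolynomial.aeval_map_algebraMap]
  | bot => exact isSemialgebraic_empty
  | sup t _ u _ iht ihu => exact iht.union ihu
  | compl t _ iht => exact iht.compl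

/-! ### (b) slicing at a real first coordinate -/

/-- The slice `{x | (r, x) ∈ S}` of an `ℝ`-semialgebraic set at a real first coordinate is
`ℝ`-semialgebraic (a polynomial preimage). [folklore] -/
theorem isSemialgebraic_slice_cons {n : ℕ} {S : Set (Fin (n + 1) → ℝ)} (hS : IsSemialgebraic ℝ S)
    (r : ℝ) : IsSemialgebraic ℝ {x : Fin n → ℝ | (Fin.cons r x : Fin (n + 1) → ℝ) ∈ S} := by
  convert hS.preimage_aeval (Fin.cons (MvPolynomial.C r) (fun i => MvPolynomial.X i)) using 1
  ext x
  simp only [mem_setOf_eq, mem_preimage]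
  refine iff_of_eq (congrArg (· ∈ S) ?_)
  ext j
  refine Fin.cases ?_ (fun i => ?_) j
  · simp
  · simp

/-- `init` of a `cons` is the `cons` of the `init`. [folklore] -/
theorem init_cons {n : ℕ} (r : ℝ) (w : Fin (n + 1) → ℝ) :
    Fin.init (Fin.cons r w : Fin (n + 2) → ℝ) = Fin.cons r (Fin.init w) := by
  ext j
  refine Fin.cases ?_ (fun i => ?_) j
  · simp [Fin.init]
  · simp only [Fin.init, Fin.cons_succ]
    have : (Fin.castSucc (Fin.succ i) : Fin (n + 2)) = Fin.succ (Fin.castSucc i) := rfl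
    rw [this, Fin.cons_succ]

/-- The last entry of a `cons`. [folklore] -/
theorem cons_apply_last {n : ℕ} (r : ℝ) (w : Fin (n + 1) → ℝ) :
    (Fin.cons r w : Fin (n + 2) → ℝ) (Fin.last (n + 1)) = w (Fin.last n) := by
  rw [← Fin.succ_last, Fin.cons_succ]

/-- Slicing a semialgebraic function of two variables at a real first coordinate gives a
semialgebraic function of one variable (over `ℝ`). [folklore] -/
theorem isSemialgebraicFunOn_slice {B : Set (Fin 2 → ℝ)} {F : (Fin 2 → ℝ) → ℝ}
    (hF : IsSemialgebraicFunOn ℚ B F) (r : ℝ) :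
    IsSemialgebraicFunOn ℝ {x : Fin 1 → ℝ | (Fin.cons r x : Fin 2 → ℝ) ∈ B}
      (fun x => F (Fin.cons r x)) := by
  unfold IsSemialgebraicFunOn at hF ⊢
  have h := isSemialgebraic_slice_cons (isSemialgebraic_real_of_rat hF) r
  convert h using 1
  ext w
  simp only [mem_setOf_eq]
  constructor
  · rintro ⟨x, hx, rfl⟩
    exact ⟨Fin.cons r x, hx, Fin.cons_snoc_eq_snoc_cons r x (F (Fin.cons r x))⟩
  · rintro ⟨z, hz, hzw⟩
    have hzi : z = Fin.cons r (Fin.init w) := by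
      have := congrArg Fin.init hzw
      rw [Fin.init_snoc, init_cons] at this
      exact this.symm
    have hFz : F z = w (Fin.last 1) := by
      have := congrFun hzw (Fin.last 2)
      rw [cons_apply_last, Fin.snoc_last] at this
      exact this.symm
    refine ⟨Fin.init w, by rw [← hzi]; exact hz, ?_⟩
    rw [← hzi, hFz]
    exact (Fin.snoc_init_self w).symm

/-! ### (c) steps (A)–(B) of the barrier over `ℝ` -/

/-- Over `ℝ`, `aeval` is `eval`. [folklore] -/
theorem aeval_eq_eval_real {ι : Type*} (z : ι → ℝ) (p : MvPolynomial ι ℝ) :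
    MvPolynomial.aeval z p = MvPolynomial.eval z p := rfl

/-- **Step (A) over `ℝ`.** Every `ℝ`-semialgebraic subset of `ℝ²` is, off the zero set of some
non-zero real polynomial, both open and closed (induction over the Boolean algebra; copy of the
barrier's `NoSemialgPrim.exists_ne_zero_isOpen` with real coefficients). [folklore] -/
theorem exists_ne_zero_isOpen_real {S : Set (Fin 2 → ℝ)} (hS : IsSemialgebraic ℝ S) :
    ∃ q : MvPolynomial (Fin 2) ℝ, q ≠ 0 ∧ IsOpen (S ∩ {z | MvPolynomial.eval z q ≠ 0}) ∧
      IsOpen (Sᶜ ∩ {z | MvPolynomial.eval z q ≠ 0}) := by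
  unfold IsSemialgebraic semialgebraicSets at hS
  induction hS using BooleanSubalgebra.closure_bot_sup_induction with
  | mem S hS =>
    rcases hS with ⟨p, rfl⟩ | ⟨p, rfl⟩
    · by_cases hp : p = 0
      · subst hp
        refine ⟨1, one_ne_zero, ?_, ?_⟩
        · convert isOpen_univ
          ext z
          simp [aeval_eq_eval_real]
        · convert isOpen_empty
          ext z
          simp [aeval_eq_eval_real]
      · refine ⟨p, hp, ?_, ?_⟩
        · convert isOpen_empty
          ext z
          simp only [mem_inter_iff, mem_setOf_eq, aeval_eq_eval_real, mem_empty_iff_false,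
            iff_false, not_and, not_not]
          exact fun h => h
        · convert Literature.Barriers.KontsevichZagierPeriods.KZ.NoSemialgPrim.isOpen_eval_ne_zero p
            using 1
          ext z
          simp only [mem_inter_iff, mem_compl_iff, mem_setOf_eq, aeval_eq_eval_real]
          tauto
    · by_cases hp : p = 0
      · subst hp
        refine ⟨1, one_ne_zero, ?_, ?_⟩
        · convert isOpen_empty
          ext z
          simp [aeval_eq_eval_real]
        · convert isOpen_univ
          ext z
          simp [aeval_eq_eval_real]
      · refine ⟨p, hp, ?_, ?_⟩
        · have hopen : IsOpen {z : Fin 2 → ℝ | 0 < MvPolynomial.eval z p} :=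
            isOpen_lt continuous_const (MvPolynomial.continuous_eval _)
          convert hopen using 1
          ext z
          simp only [mem_inter_iff, mem_setOf_eq, aeval_eq_eval_real]
          exact ⟨fun h => h.1, fun h => ⟨h, h.ne'⟩⟩
        · have hopen : IsOpen {z : Fin 2 → ℝ | MvPolynomial.eval z p < 0} :=
            isOpen_lt (MvPolynomial.continuous_eval _) continuous_const
          convert hopen using 1
          ext z
          simp only [mem_inter_iff, mem_compl_iff, mem_setOf_eq, aeval_eq_eval_real, not_lt]
          exact ⟨fun h => lt_of_le_of_ne h.1 h.2, fun h => ⟨h.le, h.ne⟩⟩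
  | bot =>
    exact ⟨1, one_ne_zero, by simp, by simp⟩
  | sup S hS T hT ihS ihT =>
    obtain ⟨p, hp, hp1, hp2⟩ := ihS
    obtain ⟨q, hq, hq1, hq2⟩ := ihT
    refine ⟨p * q, mul_ne_zero hp hq, ?_, ?_⟩
    · have : ((S ⊔ T) ∩ {z : Fin 2 → ℝ | MvPolynomial.eval z (p * q) ≠ 0}) =
          (S ∩ {z | MvPolynomial.eval z p ≠ 0}) ∩ {z | MvPolynomial.eval z q ≠ 0} ∪
            (T ∩ {z | MvPolynomial.eval z q ≠ 0}) ∩ {z | MvPolynomial.eval z p ≠ 0} := by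
        ext z
        simp only [sup_eq_union, mem_inter_iff, mem_union, mem_setOf_eq, map_mul, mul_ne_zero_iff]
        tauto
      rw [this]
      exact (hp1.inter (Literature.Barriers.KontsevichZagierPeriods.KZ.NoSemialgPrim.isOpen_eval_ne_zero q)).union
        (hq1.inter (Literature.Barriers.KontsevichZagierPeriods.KZ.NoSemialgPrim.isOpen_eval_ne_zero p))
    · have : ((S ⊔ T)ᶜ ∩ {z : Fin 2 → ℝ | MvPolynomial.eval z (p * q) ≠ 0}) =
          (Sᶜ ∩ {z | MvPolynomial.eval z p ≠ 0}) ∩ (Tᶜ ∩ {z | MvPolynomial.eval z q ≠ 0}) := by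
        ext z
        simp only [sup_eq_union, compl_union, mem_inter_iff, mem_compl_iff, mem_setOf_eq, map_mul,
          mul_ne_zero_iff]
        tauto
      rw [this]
      exact hp2.inter hq2
  | compl S hS ih =>
    obtain ⟨p, hp, h1, h2⟩ := ih
    exact ⟨p, hp, h2, by simpa only [compl_compl] using h1⟩

/-- **Steps (A)+(B) over `ℝ`, packaged**: an `ℝ`-semialgebraic function of one variable on any
set `B` satisfies a non-trivial real polynomial relation on `B` (a graph has empty interior).
[folklore] -/
theorem exists_ne_zero_evalEval_eq_zero_real {B : Set (Fin 1 → ℝ)} {F : (Fin 1 → ℝ) → ℝ}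
    (hF : IsSemialgebraicFunOn ℝ B F) :
    ∃ P : ℝ[X][Y], P ≠ 0 ∧ ∀ x ∈ B, P.evalEval (x 0) (F x) = 0 := by
  set Γ : Set (Fin 2 → ℝ) :=
    {z | ∃ x ∈ B, z = Fin.snoc x (F x)} with hΓ
  have hΓ' : IsSemialgebraic ℝ Γ := hF
  obtain ⟨q, hq0, hopen, -⟩ := exists_ne_zero_isOpen_real hΓ'
  have hvan : ∀ z ∈ Γ, MvPolynomial.eval z q = 0 := by
    intro z hz
    by_contra hne
    obtain ⟨ε, hε, hball⟩ := Metric.isOpen_iff.mp hopen z ⟨hz, hne⟩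
    obtain ⟨x, hx, rfl⟩ := hz
    have hmem : (Fin.snoc x (F x + ε / 2) : Fin 2 → ℝ) ∈
        Metric.ball (Fin.snoc x (F x) : Fin 2 → ℝ) ε := by
      rw [Metric.mem_ball, dist_pi_lt_iff hε]
      intro i
      fin_cases i
      · simp [Fin.snoc, hε]
      · simp [Fin.snoc, abs_of_pos hε, half_lt_self hε]
    obtain ⟨⟨x', -, hxx'⟩, -⟩ := hball hmem
    have h0 : x = x' := by
      funext j
      fin_cases j
      simpa [Fin.snoc] using congrFun hxx' 0
    have h1 := congrFun hxx' 1
    simp only [Fin.snoc] at h1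
    simp [← h0] at h1
    exact absurd h1 hε.ne'
  refine ⟨(Polynomial.Bivariate.equivMvPolynomial ℝ).symm q, by simpa using hq0, ?_⟩
  intro x hx
  have hz : (Fin.snoc x (F x) : Fin 2 → ℝ) ∈ Γ := ⟨x, hx, rfl⟩
  have h := hvan _ hz
  rw [← Literature.Barriers.KontsevichZagierPeriods.KZ.NoSemialgPrim.evalEval_equivMvPolynomial_symm] at h
  have hx0 : (Fin.snoc x (F x) : Fin 2 → ℝ) 0 = x 0 := by simp [Fin.snoc]
  have hx1 : (Fin.snoc x (F x) : Fin 2 → ℝ) 1 = F x := by simp [Fin.snoc]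
  rw [hx0, hx1] at h
  exact h

/-! ### (d) slices of semialgebraic functions of two variables -/

/-- **Slices satisfy real polynomial relations.** For a `ℚ`-semialgebraic function `F` of two
variables on `B ⊆ ℝ²` and every real `r`, the slice `x₁ ↦ F(r, x₁)` satisfies a non-trivial REAL
polynomial relation `P(x₁, F(r,x₁)) = 0` on the fibre `{x₁ | (r,x₁) ∈ B}` — the input of the
elimination lemma `no_linearCombination_algebraic_primitive` (work file §7) for the primitives of
Newton–Leibniz moves in the rule-(2) analysis (§5). [folklore] -/
theorem exists_ne_zero_evalEval_slice {B : Set (Fin 2 → ℝ)} {F : (Fin 2 → ℝ) → ℝ}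
    (hF : IsSemialgebraicFunOn ℚ B F) (r : ℝ) :
    ∃ P : ℝ[X][Y], P ≠ 0 ∧ ∀ x₁ : ℝ, (Fin.cons r (fun _ => x₁) : Fin 2 → ℝ) ∈ B →
      P.evalEval x₁ (F (Fin.cons r fun _ => x₁)) = 0 := by
  obtain ⟨P, hP0, hP⟩ := exists_ne_zero_evalEval_eq_zero_real (isSemialgebraicFunOn_slice hF r)
  exact ⟨P, hP0, fun x₁ hx => hP (fun _ => x₁) hx⟩

end Slices



/-! ## §9 RULE (2) IS LOAD-BEARING — CERTIFIED (generation 3): the two-coordinate push-forward invariant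

The near-miss of §5 is closed.  Sub-namespace `RuleTwo` (self-contained; it re-declares the few
§0/§5/§7/§8 names it needs so that it can be landed independently):
* two-coordinate slices (`cons2`, measure preservation, a.e. integrable slices, null slices);
* densities `dens n r : ℝ² → ℝ` (push-forward to `(x₀,x₁)` for `n ≥ 2`, strip embeddings for
  `n ≤ 1`), the null subgroup `Nul`, the low-dimensional Newton–Leibniz differences `Dsub`, the
  invariant `invariant : FormalRep →+ (ℝ² → ℝ) ⧸ (Nul ⊔ Dsub)` and
  `relationsWithoutCoV_le_ker` (vanishing on (1a), (1b), (3) — the last via Fubini + FTC on raw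
  measurable band data `integral_band_eq`, applied to real-parameter slices);
* extraction: the word side is `1/x₀`-homogeneous on `U = (½,1) × (0,½)` (`good_dens_word`, using
  `MzvKernelInKZ.Negative.not_integrableOn_wordFun_of_head` for the head letter), the `Dsub` side is
  a finite `ℤ`-combination of band terms (`pd_of_mem_Dsub`); two generic lines (`exists_two_of_ae`),
  a test interval missing the fibre endpoints (`exists_Ioo_avoid`), the FTC upgrade
  (`hasDerivAt_of_ae_eq`), and the elimination (§7) with the slice relations (§8);
* `RuleTwo.not_cruxWithoutChangeOfVariables` — sorry-free, standard axioms. -/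

namespace RuleTwo


variable {m : ℕ}

/-- The double cons `((s,t),x) ↦ (s,t,x) : (ℝ × ℝ) × ℝᵐ → ℝᵐ⁺²`. -/
def cons2 (p : (ℝ × ℝ) × (Fin m → ℝ)) : Fin (m + 2) → ℝ :=
  Matrix.vecCons p.1.1 (Matrix.vecCons p.1.2 p.2)

/-- `cons2` as a measurable equivalence. -/
def cons2Equiv : (ℝ × ℝ) × (Fin m → ℝ) ≃ᵐ (Fin (m + 2) → ℝ) :=
  MeasurableEquiv.prodAssoc.trans
    ((MeasurableEquiv.prodCongr (MeasurableEquiv.refl ℝ)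
      (MeasurableEquiv.piFinSuccAbove (fun _ : Fin (m + 1) => ℝ) 0).symm).trans
      (MeasurableEquiv.piFinSuccAbove (fun _ : Fin (m + 2) => ℝ) 0).symm)

theorem cons2Equiv_apply (p : (ℝ × ℝ) × (Fin m → ℝ)) : cons2Equiv p = cons2 p := by
  have h1 : ∀ q : ℝ × (Fin (m + 1) → ℝ),
      (MeasurableEquiv.piFinSuccAbove (fun _ : Fin (m + 2) => ℝ) 0).symm q =
        Matrix.vecCons q.1 q.2 := KZ.piFinSuccAbove_zero_symm_apply
  have h2 : ∀ q : ℝ × (Fin m → ℝ),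
      (MeasurableEquiv.piFinSuccAbove (fun _ : Fin (m + 1) => ℝ) 0).symm q =
        Matrix.vecCons q.1 q.2 := KZ.piFinSuccAbove_zero_symm_apply
  show (MeasurableEquiv.piFinSuccAbove (fun _ : Fin (m + 2) => ℝ) 0).symm
      (MeasurableEquiv.prodCongr (MeasurableEquiv.refl ℝ)
        (MeasurableEquiv.piFinSuccAbove (fun _ : Fin (m + 1) => ℝ) 0).symm
        (MeasurableEquiv.prodAssoc p)) = cons2 p
  rw [h1]
  simp only [MeasurableEquiv.prodCongr, MeasurableEquiv.coe_mk, Equiv.prodCongr_apply,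
    MeasurableEquiv.prodAssoc, Equiv.prodAssoc_apply, Prod.map_fst, Prod.map_snd, cons2]
  congr 1
  exact h2 _

theorem coe_cons2Equiv : ⇑(cons2Equiv (m := m)) = cons2 := funext cons2Equiv_apply

/-- `cons2` is a measurable embedding. [folklore] -/
theorem measurableEmbedding_cons2 : MeasurableEmbedding (cons2 (m := m)) := by
  rw [← coe_cons2Equiv]
  exact cons2Equiv.measurableEmbedding

/-- `cons2` is measure preserving from `(vol × vol) × vol` to Lebesgue measure on `ℝᵐ⁺²`. [folklore] -/
theorem measurePreserving_cons2 :
    MeasurePreserving (cons2 (m := m))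
      (((volume : Measure ℝ).prod (volume : Measure ℝ)).prod (volume : Measure (Fin m → ℝ)))
      volume := by
  have h1 : MeasurePreserving (MeasurableEquiv.prodAssoc : (ℝ × ℝ) × (Fin m → ℝ) ≃ᵐ _)
      (((volume : Measure ℝ).prod (volume : Measure ℝ)).prod volume)
      ((volume : Measure ℝ).prod ((volume : Measure ℝ).prod volume)) :=
    measurePreserving_prodAssoc volume volume volume
  have h2 : MeasurePreserving
      (Prod.map id fun q : ℝ × (Fin m → ℝ) => Matrix.vecCons q.1 q.2)
      ((volume : Measure ℝ).prod ((volume : Measure ℝ).prod volume))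
      ((volume : Measure ℝ).prod (volume : Measure (Fin (m + 1) → ℝ))) :=
    (MeasurePreserving.id volume).prod KZ.measurePreserving_vecCons
  have h3 := (KZ.measurePreserving_vecCons (n := m + 1)).comp (h2.comp h1)
  convert h3 using 1
  funext p
  simp [cons2, MeasurableEquiv.prodAssoc, Equiv.prodAssoc]

/-- A measurable-equivalence change of variables: integrability transfers to `cons2`. [folklore] -/
theorem integrable_comp_cons2 {G : (Fin (m + 2) → ℝ) → ℝ} (hG : Integrable G) :
    Integrable (fun p : (ℝ × ℝ) × (Fin m → ℝ) => G (cons2 p))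
      (((volume : Measure ℝ).prod (volume : Measure ℝ)).prod volume) :=
  (measurePreserving_cons2.integrable_comp_emb measurableEmbedding_cons2).mpr hG

/-- Almost every two-coordinate slice of an integrable function is integrable. [folklore] -/
theorem ae_integrable_slice2 {G : (Fin (m + 2) → ℝ) → ℝ} (hG : Integrable G) :
    ∀ᵐ q : ℝ × ℝ, Integrable fun x : Fin m → ℝ => G (cons2 (q, x)) := by
  rw [Measure.volume_eq_prod]
  exact (integrable_comp_cons2 hG).prod_right_ae

/-- The two-coordinate slice integrals form an integrable function of the two coordinates.
[folklore] -/
theorem integrable_integral_slice2 {G : (Fin (m + 2) → ℝ) → ℝ} (hG : Integrable G) :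
    Integrable fun q : ℝ × ℝ => ∫ x : Fin m → ℝ, G (cons2 (q, x)) := by
  rw [Measure.volume_eq_prod]
  exact (integrable_comp_cons2 hG).integral_prod_left

/-- Almost every two-coordinate slice of a null set is null. [folklore] -/
theorem ae_volume_slice2_eq_zero {N : Set (Fin (m + 2) → ℝ)} (hN : volume N = 0) :
    ∀ᵐ q : ℝ × ℝ, volume {x : Fin m → ℝ | cons2 (q, x) ∈ N} = 0 := by
  have h : (((volume : Measure ℝ).prod (volume : Measure ℝ)).prod (volume : Measure (Fin m → ℝ)))
      (cons2 ⁻¹' N) = 0 :=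
    (measurePreserving_cons2.measure_preimage (NullMeasurableSet.of_null hN)).trans hN
  rw [Measure.volume_eq_prod]
  filter_upwards [Measure.measure_ae_null_of_prod_null h] with q hq
  exact hq

/-- Two-coordinate Fubini: the slice integrals integrate to the total integral. [folklore] -/
theorem integral_integral_slice2 {G : (Fin (m + 2) → ℝ) → ℝ} (hG : Integrable G) :
    ∫ q : ℝ × ℝ, ∫ x : Fin m → ℝ, G (cons2 (q, x)) = ∫ z, G z := by
  have h := integral_prod (fun p : (ℝ × ℝ) × (Fin m → ℝ) => G (cons2 p)) (integrable_comp_cons2 hG)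
  rw [Measure.volume_eq_prod, ← h]
  exact measurePreserving_cons2.integral_comp measurableEmbedding_cons2 G

/-! ### Structural identities for `cons2` -/

theorem cons2_mk (q : ℝ × ℝ) (x : Fin m → ℝ) :
    cons2 (q, x) = Matrix.vecCons q.1 (Matrix.vecCons q.2 x) := rfl

/-- `init` commutes with `cons2`. [folklore] -/
theorem init_cons2 (q : ℝ × ℝ) (z : Fin (m + 1) → ℝ) :
    Fin.init (cons2 (q, z)) = cons2 (q, Fin.init z) := by
  ext j
  simp only [cons2, Fin.init]
  refine Fin.cases ?_ (fun i => ?_) j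
  · simp
  · refine Fin.cases ?_ (fun i' => ?_) i
    · simp
    · have e1 : (Fin.castSucc (Fin.succ (Fin.succ i')) : Fin (m + 3)) =
          Fin.succ (Fin.succ (Fin.castSucc i')) := rfl
      rw [e1]
      simp [Matrix.vecCons]
      rfl

/-- The last entry of `cons2`. [folklore] -/
theorem cons2_apply_last (q : ℝ × ℝ) (z : Fin (m + 1) → ℝ) :
    cons2 (q, z) (Fin.last (m + 2)) = z (Fin.last m) := by
  simp only [cons2]
  rw [show (Fin.last (m + 2)) = Fin.succ (Fin.succ (Fin.last m)) from rfl]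
  simp [Matrix.vecCons]

/-- `snoc` commutes with `cons2`. [folklore] -/
theorem cons2_snoc (q : ℝ × ℝ) (y : Fin m → ℝ) (w : ℝ) :
    cons2 (q, Fin.snoc y w) = Fin.snoc (cons2 (q, y)) w := by
  simp only [cons2, Matrix.vecCons]
  rw [Fin.cons_snoc_eq_snoc_cons, Fin.cons_snoc_eq_snoc_cons]

/-! ### The far-away strip, densities -/

/-- Indicator of the far-away interval `[2,3]`. -/
def stripInd (t : ℝ) : ℝ := (Icc (2 : ℝ) 3).indicator (fun _ => (1 : ℝ)) t

theorem stripInd_of_lt {t : ℝ} (ht : t < 2) : stripInd t = 0 := by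
  unfold stripInd
  apply indicator_of_notMem
  intro h
  exact absurd h.1 (not_le.mpr ht)

/-- **The density of a generator**: push-forward of `f·λ|_σ` to the first two coordinates for
dimension `≥ 2`; for dimensions `1`, `0` the data are embedded along the far-away strip. -/
def dens : (n : ℕ) → KZ.IntegralRep n → ℝ × ℝ → ℝ
  | 0, r => fun q => r.domain.indicator r.integrand ![] * (stripInd q.1 * stripInd q.2)
  | 1, r => fun q => r.domain.indicator r.integrand ![q.1] * stripInd q.2
  | _ + 2, r => fun q => ∫ x, r.domain.indicator r.integrand (cons2 (q, x))

theorem dens_two_add (r : KZ.IntegralRep (m + 2)) (q : ℝ × ℝ) :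
    dens (m + 2) r q = ∫ x, r.domain.indicator r.integrand (cons2 (q, x)) := rfl

theorem dens_one (r : KZ.IntegralRep 1) (q : ℝ × ℝ) :
    dens 1 r q = r.domain.indicator r.integrand ![q.1] * stripInd q.2 := rfl

theorem dens_zero (r : KZ.IntegralRep 0) (q : ℝ × ℝ) :
    dens 0 r q = r.domain.indicator r.integrand ![] * (stripInd q.1 * stripInd q.2) := rfl

/-- The extended integrand of a representation is integrable. [folklore] -/
theorem integrable_indicator (r : KZ.IntegralRep m) : Integrable (r.domain.indicator r.integrand) :=
  (integrable_indicator_iff (KZ.IntegralRep.measurableSet_domain_holds r)).mpr r.integrableOn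

/-! ### The null subgroup and the invariant's target -/

/-- Functions on `ℝ²` vanishing almost everywhere. -/
def Nul : AddSubgroup (ℝ × ℝ → ℝ) where
  carrier := {g | g =ᵐ[volume] 0}
  zero_mem' := show (0 : ℝ × ℝ → ℝ) =ᵐ[volume] 0 from Filter.EventuallyEq.rfl
  add_mem' := fun {a b} (ha : a =ᵐ[volume] 0) (hb : b =ᵐ[volume] 0) =>
    show a + b =ᵐ[volume] 0 from by simpa using ha.add hb
  neg_mem' := fun {a} (ha : a =ᵐ[volume] 0) => show -a =ᵐ[volume] 0 from by simpa using ha.neg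

theorem mem_Nul {g : ℝ × ℝ → ℝ} : g ∈ Nul ↔ g =ᵐ[volume] 0 := Iff.rfl

/-! ### Pointwise additivity of extended integrands -/

theorem indicator_domainAdd {n : ℕ} {r r₁ r₂ : KZ.IntegralRep n}
    (hdom : r.domain = r₁.domain ∪ r₂.domain)
    (h₁ : EqOn r.integrand r₁.integrand r₁.domain) (h₂ : EqOn r.integrand r₂.integrand r₂.domain)
    {z : Fin n → ℝ} (hz : z ∉ r₁.domain ∩ r₂.domain) :
    r.domain.indicator r.integrand z =
      r₁.domain.indicator r₁.integrand z + r₂.domain.indicator r₂.integrand z := by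
  by_cases hz1 : z ∈ r₁.domain
  · have hz2 : z ∉ r₂.domain := fun h => hz ⟨hz1, h⟩
    rw [indicator_of_mem (hdom ▸ Or.inl hz1), indicator_of_mem hz1, indicator_of_notMem hz2,
      add_zero, h₁ hz1]
  · by_cases hz2 : z ∈ r₂.domain
    · rw [indicator_of_mem (hdom ▸ Or.inr hz2), indicator_of_notMem hz1, indicator_of_mem hz2,
        zero_add, h₂ hz2]
    · have hz0 : z ∉ r.domain := by rw [hdom]; rintro (h | h) <;> contradiction
      rw [indicator_of_notMem hz0, indicator_of_notMem hz1, indicator_of_notMem hz2, add_zero]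

theorem indicator_integrandAdd {n : ℕ} {r r₁ r₂ : KZ.IntegralRep n}
    (hd₁ : r₁.domain = r.domain) (hd₂ : r₂.domain = r.domain)
    (hadd : EqOn r.integrand (r₁.integrand + r₂.integrand) r.domain) (z : Fin n → ℝ) :
    r.domain.indicator r.integrand z =
      r₁.domain.indicator r₁.integrand z + r₂.domain.indicator r₂.integrand z := by
  by_cases hz : z ∈ r.domain
  · rw [indicator_of_mem hz, indicator_of_mem (hd₁ ▸ hz), indicator_of_mem (hd₂ ▸ hz), hadd hz]
    rfl
  · rw [indicator_of_notMem hz, indicator_of_notMem (hd₁ ▸ hz :), indicator_of_notMem (hd₂ ▸ hz :),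
      add_zero]

/-! ### Vanishing on domain additivity -/

/-- In dimension `≥ 2`: the densities of a domain-additivity instance add almost everywhere.
[folklore] -/
theorem dens_domainAdd_two_add {r r₁ r₂ : KZ.IntegralRep (m + 2)}
    (hdom : r.domain = r₁.domain ∪ r₂.domain) (hnull : volume (r₁.domain ∩ r₂.domain) = 0)
    (h₁ : EqOn r.integrand r₁.integrand r₁.domain) (h₂ : EqOn r.integrand r₂.integrand r₂.domain) :
    (dens (m + 2) r - dens (m + 2) r₁ - dens (m + 2) r₂) ∈ Nul := by
  rw [mem_Nul]
  filter_upwards [ae_integrable_slice2 (integrable_indicator r),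
    ae_integrable_slice2 (integrable_indicator r₁), ae_integrable_slice2 (integrable_indicator r₂),
    ae_volume_slice2_eq_zero (m := m) hnull] with q hq hq₁ hq₂ hqn
  simp only [Pi.sub_apply, Pi.zero_apply, dens_two_add]
  have e : ∫ x, (r.domain.indicator r.integrand (cons2 (q, x)) -
      r₁.domain.indicator r₁.integrand (cons2 (q, x)) - r₂.domain.indicator r₂.integrand (cons2 (q, x))) =
      (∫ x, r.domain.indicator r.integrand (cons2 (q, x))) -
        (∫ x, r₁.domain.indicator r₁.integrand (cons2 (q, x))) -
        ∫ x, r₂.domain.indicator r₂.integrand (cons2 (q, x)) := by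
    have hq01 : Integrable (fun x => r.domain.indicator r.integrand (cons2 (q, x)) -
        r₁.domain.indicator r₁.integrand (cons2 (q, x))) := hq.sub hq₁
    rw [← integral_sub hq hq₁, ← integral_sub hq01 hq₂]
  rw [← e]
  refine integral_eq_zero_of_ae ?_
  have hae : ∀ᵐ x : Fin m → ℝ, cons2 (q, x) ∉ r₁.domain ∩ r₂.domain :=
    (measure_eq_zero_iff_ae_notMem (s := {x : Fin m → ℝ | cons2 (q, x) ∈ r₁.domain ∩ r₂.domain})).1 hqn
  filter_upwards [hae] with x hx
  simp only [Pi.zero_apply]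
  rw [indicator_domainAdd hdom h₁ h₂ hx]
  ring

/-- `s ↦ ![s]` is measure preserving `ℝ → ℝ¹`. [folklore] -/
theorem measurePreserving_vecOne :
    MeasurePreserving (fun s : ℝ => (![s] : Fin 1 → ℝ)) volume volume := by
  have hfun : (fun s : ℝ => (![s] : Fin 1 → ℝ)) = ⇑(MeasurableEquiv.funUnique (Fin 1) ℝ).symm := by
    funext s; ext i; fin_cases i; rfl
  rw [hfun]
  exact (volume_preserving_funUnique (Fin 1) ℝ).symm _

/-- A null set of `ℝ¹` pulls back to a null set of parameters. [folklore] -/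
theorem volume_setOf_vecOne_mem {N : Set (Fin 1 → ℝ)} (hN : volume N = 0) :
    volume {s : ℝ | (![s] : Fin 1 → ℝ) ∈ N} = 0 :=
  (measurePreserving_vecOne.measure_preimage (NullMeasurableSet.of_null hN)).trans hN

/-- A set of pairs whose first coordinate lies in a null set is null. [folklore] -/
theorem volume_fst_mem_eq_zero {S : Set ℝ} (hS : volume S = 0) :
    volume {q : ℝ × ℝ | q.1 ∈ S} = 0 := by
  have : {q : ℝ × ℝ | q.1 ∈ S} = S ×ˢ (univ : Set ℝ) := by ext q; simp
  rw [this, Measure.volume_eq_prod, Measure.prod_prod, hS, zero_mul]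

/-- In dimension `1`: the densities of a domain-additivity instance add almost everywhere.
[folklore] -/
theorem dens_domainAdd_one {r r₁ r₂ : KZ.IntegralRep 1}
    (hdom : r.domain = r₁.domain ∪ r₂.domain) (hnull : volume (r₁.domain ∩ r₂.domain) = 0)
    (h₁ : EqOn r.integrand r₁.integrand r₁.domain) (h₂ : EqOn r.integrand r₂.integrand r₂.domain) :
    (dens 1 r - dens 1 r₁ - dens 1 r₂) ∈ Nul := by
  rw [mem_Nul]
  have h0 := volume_fst_mem_eq_zero (volume_setOf_vecOne_mem hnull)
  have hae : ∀ᵐ q : ℝ × ℝ, (![q.1] : Fin 1 → ℝ) ∉ r₁.domain ∩ r₂.domain :=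
    (measure_eq_zero_iff_ae_notMem (s := {q : ℝ × ℝ | q.1 ∈ {s : ℝ | (![s] : Fin 1 → ℝ) ∈
      r₁.domain ∩ r₂.domain}})).1 h0
  filter_upwards [hae] with q hq
  simp only [Pi.sub_apply, Pi.zero_apply, dens_one]
  rw [indicator_domainAdd hdom h₁ h₂ hq]
  ring

/-- A Lebesgue-null subset of `ℝ⁰` is empty. [folklore] -/
theorem eq_empty_of_volume_fin_zero {N : Set (Fin 0 → ℝ)} (hN : volume N = 0) : N = ∅ := by
  by_contra h
  obtain ⟨x, hx⟩ := Set.nonempty_iff_ne_empty.2 h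
  have hN' : N = univ := by
    ext y; simp only [mem_univ, iff_true]; rwa [Subsingleton.elim y x]
  rw [hN', volume_pi, Measure.pi_univ] at hN
  simp at hN

/-- In dimension `0`: the densities of a domain-additivity instance add everywhere. [folklore] -/
theorem dens_domainAdd_zero {r r₁ r₂ : KZ.IntegralRep 0}
    (hdom : r.domain = r₁.domain ∪ r₂.domain) (hnull : volume (r₁.domain ∩ r₂.domain) = 0)
    (h₁ : EqOn r.integrand r₁.integrand r₁.domain) (h₂ : EqOn r.integrand r₂.integrand r₂.domain) :
    (dens 0 r - dens 0 r₁ - dens 0 r₂) ∈ Nul := by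
  rw [mem_Nul]
  refine Filter.Eventually.of_forall fun q => ?_
  have hq : (![] : Fin 0 → ℝ) ∉ r₁.domain ∩ r₂.domain := by
    rw [eq_empty_of_volume_fin_zero hnull]; exact notMem_empty _
  simp only [Pi.sub_apply, Pi.zero_apply, dens_zero]
  rw [indicator_domainAdd hdom h₁ h₂ hq]
  ring

/-! ### Vanishing on integrand additivity -/

theorem dens_integrandAdd_two_add {r r₁ r₂ : KZ.IntegralRep (m + 2)}
    (hd₁ : r₁.domain = r.domain) (hd₂ : r₂.domain = r.domain)
    (hadd : EqOn r.integrand (r₁.integrand + r₂.integrand) r.domain) :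
    (dens (m + 2) r - dens (m + 2) r₁ - dens (m + 2) r₂) ∈ Nul := by
  rw [mem_Nul]
  filter_upwards [ae_integrable_slice2 (integrable_indicator r₁),
    ae_integrable_slice2 (integrable_indicator r₂)] with q hq₁ hq₂
  simp only [Pi.sub_apply, Pi.zero_apply, dens_two_add]
  have : (fun x => r.domain.indicator r.integrand (cons2 (q, x))) =
      fun x => r₁.domain.indicator r₁.integrand (cons2 (q, x)) +
        r₂.domain.indicator r₂.integrand (cons2 (q, x)) :=
    funext fun x => indicator_integrandAdd hd₁ hd₂ hadd _
  rw [this, integral_add hq₁ hq₂]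
  ring

theorem dens_integrandAdd_one {r r₁ r₂ : KZ.IntegralRep 1}
    (hd₁ : r₁.domain = r.domain) (hd₂ : r₂.domain = r.domain)
    (hadd : EqOn r.integrand (r₁.integrand + r₂.integrand) r.domain) :
    (dens 1 r - dens 1 r₁ - dens 1 r₂) ∈ Nul := by
  rw [mem_Nul]
  refine Filter.Eventually.of_forall fun q => ?_
  simp only [Pi.sub_apply, Pi.zero_apply, dens_one]
  rw [indicator_integrandAdd hd₁ hd₂ hadd]
  ring

theorem dens_integrandAdd_zero {r r₁ r₂ : KZ.IntegralRep 0}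
    (hd₁ : r₁.domain = r.domain) (hd₂ : r₂.domain = r.domain)
    (hadd : EqOn r.integrand (r₁.integrand + r₂.integrand) r.domain) :
    (dens 0 r - dens 0 r₁ - dens 0 r₂) ∈ Nul := by
  rw [mem_Nul]
  refine Filter.Eventually.of_forall fun q => ?_
  simp only [Pi.sub_apply, Pi.zero_apply, dens_zero]
  rw [indicator_integrandAdd hd₁ hd₂ hadd]
  ring

/-! ### Newton–Leibniz along the last coordinate for raw measurable data -/

/-- **Fubini + FTC on a band, raw data** (the computation of
`KZ.eval_eq_zero_of_mem_newtonLeibnizRel_holds` with the semialgebraicity fields replaced by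
measurability hypotheses, so that it applies to real-parameter slices). [folklore] -/
theorem integral_band_eq {k : ℕ} {τ : Set (Fin k → ℝ)} (hτm : MeasurableSet τ)
    {a b : (Fin k → ℝ) → ℝ} {F g : (Fin (k + 1) → ℝ) → ℝ} {B : Set (Fin (k + 1) → ℝ)}
    (hbm : MeasurableSet B) (hab : ∀ x ∈ τ, a x ≤ b x)
    (hdom : B = {z | (Fin.init z : Fin k → ℝ) ∈ τ ∧ a (Fin.init z) ≤ z (Fin.last k) ∧
      z (Fin.last k) ≤ b (Fin.init z)})
    (hcont : ∀ x ∈ τ, ContinuousOn (fun t : ℝ => F (Fin.snoc x t)) (Icc (a x) (b x)))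
    (hderiv : ∀ x ∈ τ, ∀ t ∈ Ioo (a x) (b x),
      HasDerivAt (fun s : ℝ => F (Fin.snoc x s)) (g (Fin.snoc x t)) t)
    (hint : IntegrableOn g B) :
    ∫ z in B, g z = ∫ x in τ, (F (Fin.snoc x (b x)) - F (Fin.snoc x (a x))) := by
  set e : (Fin (k + 1) → ℝ) ≃ᵐ ℝ × (Fin k → ℝ) :=
    MeasurableEquiv.piFinSuccAbove (fun _ => ℝ) (Fin.last k) with he_def
  have he : MeasurePreserving e volume volume :=
    volume_preserving_piFinSuccAbove (fun _ => ℝ) (Fin.last k)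
  have he_symm : ∀ p : ℝ × (Fin k → ℝ), e.symm p = Fin.snoc p.2 p.1 := fun p => by
    simp [he_def, MeasurableEquiv.piFinSuccAbove, Fin.snocEquiv]
  have hmem : ∀ x t, Fin.snoc x t ∈ B ↔ x ∈ τ ∧ t ∈ Icc (a x) (b x) := by
    intro x t
    rw [hdom]
    simp only [mem_setOf_eq, Fin.init_snoc, Fin.snoc_last, mem_Icc]
  set G : (Fin (k + 1) → ℝ) → ℝ := B.indicator g with hG_def
  have hG : Integrable G := (integrable_indicator_iff hbm).mpr hint
  have hfib_in : ∀ x ∈ τ, (fun t => G (Fin.snoc x t)) =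
      (Icc (a x) (b x)).indicator (fun t => g (Fin.snoc x t)) := by
    intro x hx
    ext t
    by_cases ht : t ∈ Icc (a x) (b x)
    · rw [Set.indicator_of_mem ht, hG_def, Set.indicator_of_mem ((hmem x t).2 ⟨hx, ht⟩)]
    · rw [Set.indicator_of_notMem ht, hG_def,
        Set.indicator_of_notMem (fun h => ht ((hmem x t).1 h).2)]
  have hfib_out : ∀ x ∉ τ, (fun t => G (Fin.snoc x t)) = fun _ => 0 := by
    intro x hx
    ext t
    rw [hG_def, Set.indicator_of_notMem (fun h => hx ((hmem x t).1 h).1)]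
  have hG2 : Integrable (fun p : ℝ × (Fin k → ℝ) => G (Fin.snoc p.2 p.1))
      ((volume : Measure ℝ).prod (volume : Measure (Fin k → ℝ))) := by
    have h := ((he.symm e).integrable_comp_emb e.symm.measurableEmbedding (g := G)).mpr hG
    rw [← Measure.volume_eq_prod]
    convert h using 1
    ext p
    simp [he_symm]
  calc ∫ z in B, g z
      = ∫ z, G z := (integral_indicator hbm).symm
    _ = ∫ p, G (e.symm p) := ((he.symm e).integral_comp' G).symm
    _ = ∫ p : ℝ × (Fin k → ℝ), G (Fin.snoc p.2 p.1) ∂(volume.prod volume) := by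
        simp_rw [he_symm, Measure.volume_eq_prod]
    _ = ∫ x, ∫ t, G (Fin.snoc x t) := integral_prod_symm _ hG2
    _ = ∫ x, τ.indicator (fun x => F (Fin.snoc x (b x)) - F (Fin.snoc x (a x))) x := by
        apply integral_congr_ae
        filter_upwards [hG2.prod_left_ae] with x hx
        by_cases hxτ : x ∈ τ
        · rw [Set.indicator_of_mem hxτ, hfib_in x hxτ, integral_indicator measurableSet_Icc,
            integral_Icc_eq_integral_Ioc, ← intervalIntegral.integral_of_le (hab x hxτ)]
          apply intervalIntegral.integral_eq_sub_of_hasDerivAt_of_le (hab x hxτ) (hcont x hxτ)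
            (hderiv x hxτ)
          rw [intervalIntegrable_iff_integrableOn_Icc_of_le (hab x hxτ)]
          have hx' : Integrable (fun t => G (Fin.snoc x t)) := hx
          rw [hfib_in x hxτ] at hx'
          exact (integrable_indicator_iff measurableSet_Icc).mp hx'
        · rw [Set.indicator_of_notMem hxτ]
          rw [hfib_out x hxτ, integral_zero]
    _ = ∫ x in τ, (F (Fin.snoc x (b x)) - F (Fin.snoc x (a x))) := integral_indicator hτm

/-! ### Vanishing on Newton–Leibniz with base dimension `≥ 2` -/

/-- `cons2 (q, ·)` is measurable. [folklore] -/
theorem measurable_cons2_mk (q : ℝ × ℝ) : Measurable fun x : Fin m → ℝ => cons2 (q, x) :=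
  (KZ.measurable_vecCons q.1).comp (KZ.measurable_vecCons q.2)

/-- **Newton–Leibniz in a coordinate beyond the first two does not change the density** (a.e.).
[folklore] -/
theorem dens_newtonLeibniz_two_add {r : KZ.IntegralRep (m + 3)} {r' : KZ.IntegralRep (m + 2)}
    {a b : (Fin (m + 2) → ℝ) → ℝ} {F : (Fin (m + 3) → ℝ) → ℝ}
    (hab : ∀ x ∈ r'.domain, a x ≤ b x)
    (hdom : r.domain = {z | (Fin.init z : Fin (m + 2) → ℝ) ∈ r'.domain ∧
      a (Fin.init z) ≤ z (Fin.last (m + 2)) ∧ z (Fin.last (m + 2)) ≤ b (Fin.init z)})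
    (hcont : ∀ x ∈ r'.domain, ContinuousOn (fun t : ℝ => F (Fin.snoc x t)) (Icc (a x) (b x)))
    (hderiv : ∀ x ∈ r'.domain, ∀ t ∈ Ioo (a x) (b x),
      HasDerivAt (fun s : ℝ => F (Fin.snoc x s)) (r.integrand (Fin.snoc x t)) t)
    (hbase : ∀ x ∈ r'.domain, r'.integrand x = F (Fin.snoc x (b x)) - F (Fin.snoc x (a x))) :
    (dens (m + 3) r - dens (m + 2) r') ∈ Nul := by
  rw [mem_Nul]
  filter_upwards [ae_integrable_slice2 (m := m + 1) (integrable_indicator r)] with q hq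
  simp only [Pi.sub_apply, Pi.zero_apply, sub_eq_zero]
  rw [dens_two_add, dens_two_add]
  -- sliced data
  set τq : Set (Fin m → ℝ) := {y | cons2 (q, y) ∈ r'.domain} with hτq
  set Bq : Set (Fin (m + 1) → ℝ) := {z | cons2 (q, z) ∈ r.domain} with hBq
  have hτqm : MeasurableSet τq :=
    measurable_cons2_mk q (KZ.IntegralRep.measurableSet_domain_holds r')
  have hBqm : MeasurableSet Bq :=
    measurable_cons2_mk q (KZ.IntegralRep.measurableSet_domain_holds r)
  have hind : ∀ z, r.domain.indicator r.integrand (cons2 (q, z)) =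
      Bq.indicator (fun z => r.integrand (cons2 (q, z))) z := fun z => by
    by_cases hz : cons2 (q, z) ∈ r.domain
    · rw [indicator_of_mem hz, indicator_of_mem (show z ∈ Bq from hz)]
    · rw [indicator_of_notMem hz, indicator_of_notMem (show z ∉ Bq from hz)]
  have hind' : ∀ y, r'.domain.indicator r'.integrand (cons2 (q, y)) =
      τq.indicator (fun y => r'.integrand (cons2 (q, y))) y := fun y => by
    by_cases hy : cons2 (q, y) ∈ r'.domain
    · rw [indicator_of_mem hy, indicator_of_mem (show y ∈ τq from hy)]
    · rw [indicator_of_notMem hy, indicator_of_notMem (show y ∉ τq from hy)]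
  have hint : IntegrableOn (fun z => r.integrand (cons2 (q, z))) Bq := by
    rw [← integrable_indicator_iff hBqm]
    exact hq.congr (Filter.Eventually.of_forall hind)
  simp_rw [hind, hind', integral_indicator hBqm, integral_indicator hτqm]
  have key := integral_band_eq (τ := τq) hτqm (a := fun y => a (cons2 (q, y)))
    (b := fun y => b (cons2 (q, y))) (F := fun z => F (cons2 (q, z)))
    (g := fun z => r.integrand (cons2 (q, z))) (B := Bq) hBqm
    (fun y hy => hab _ hy) ?_ ?_ ?_ hint
  · rw [key]
    refine setIntegral_congr_fun hτqm fun y hy => ?_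
    simp only [cons2_snoc]
    exact (hbase _ hy).symm
  · ext z
    simp only [hBq, hτq, mem_setOf_eq, hdom, init_cons2, cons2_apply_last]
  · intro y hy
    simp only [cons2_snoc]
    exact hcont _ hy
  · intro y hy t ht
    simp only [cons2_snoc]
    exact hderiv _ hy t ht

/-! ### The invariant -/

/-- Newton–Leibniz differences with base dimension `1` (data kept: the primitive and the band). -/
def DgenOne : Set (ℝ × ℝ → ℝ) :=
  {g | ∃ (r : KZ.IntegralRep 2) (r' : KZ.IntegralRep 1) (a b : (Fin 1 → ℝ) → ℝ)
      (F : (Fin 2 → ℝ) → ℝ),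
    IsSemialgebraicFunOn ℚ r.domain F ∧ (∀ x ∈ r'.domain, a x ≤ b x) ∧
    r.domain = {z | (Fin.init z : Fin 1 → ℝ) ∈ r'.domain ∧ a (Fin.init z) ≤ z (Fin.last 1) ∧
      z (Fin.last 1) ≤ b (Fin.init z)} ∧
    (∀ x ∈ r'.domain, ContinuousOn (fun t : ℝ => F (Fin.snoc x t)) (Icc (a x) (b x))) ∧
    (∀ x ∈ r'.domain, ∀ t ∈ Ioo (a x) (b x),
      HasDerivAt (fun s : ℝ => F (Fin.snoc x s)) (r.integrand (Fin.snoc x t)) t) ∧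
    (∀ x ∈ r'.domain, r'.integrand x = F (Fin.snoc x (b x)) - F (Fin.snoc x (a x))) ∧
    g = dens 2 r - dens 1 r'}

/-- Newton–Leibniz differences with base dimension `0`. -/
def DgenZero : Set (ℝ × ℝ → ℝ) :=
  {g | ∃ (r : KZ.IntegralRep 1) (r' : KZ.IntegralRep 0), g = dens 1 r - dens 0 r'}

/-- The subgroup of low-dimensional Newton–Leibniz differences. -/
def Dsub : AddSubgroup (ℝ × ℝ → ℝ) := AddSubgroup.closure (DgenOne ∪ DgenZero)

/-- The kernel of the invariant: a.e.-zero functions plus low-dimensional NL differences. -/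
def Ksub : AddSubgroup (ℝ × ℝ → ℝ) := Nul ⊔ Dsub

/-- **The push-forward invariant** `ι : FormalRep →+ (ℝ² → ℝ) ⧸ K`. -/
def invariant : KZ.FormalRep →+ (ℝ × ℝ → ℝ) ⧸ Ksub :=
  FreeAbelianGroup.lift fun p => (QuotientAddGroup.mk (dens p.1 p.2) : (ℝ × ℝ → ℝ) ⧸ Ksub)

theorem invariant_of {n : ℕ} (r : KZ.IntegralRep n) :
    invariant (KZ.of r) = (QuotientAddGroup.mk (dens n r) : (ℝ × ℝ → ℝ) ⧸ Ksub) := by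
  simp [invariant, KZ.of]

theorem mk_eq_zero_of_mem_Nul {g : ℝ × ℝ → ℝ} (hg : g ∈ Nul) :
    (QuotientAddGroup.mk g : (ℝ × ℝ → ℝ) ⧸ Ksub) = 0 :=
  (QuotientAddGroup.eq_zero_iff g).2 (AddSubgroup.mem_sup_left hg)

theorem mk_eq_zero_of_mem_Dsub {g : ℝ × ℝ → ℝ} (hg : g ∈ Dsub) :
    (QuotientAddGroup.mk g : (ℝ × ℝ → ℝ) ⧸ Ksub) = 0 :=
  (QuotientAddGroup.eq_zero_iff g).2 (AddSubgroup.mem_sup_right hg)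

/-- The sub-calculus WITHOUT change of variables. -/
def relationsWithoutCoV : AddSubgroup KZ.FormalRep :=
  AddSubgroup.closure (KZ.domainAddRel ∪ KZ.integrandAddRel ∪ KZ.newtonLeibnizRel)

/-- **The invariant kills the change-of-variables-free sub-calculus.** [folklore] -/
theorem relationsWithoutCoV_le_ker : relationsWithoutCoV ≤ invariant.ker := by
  refine (AddSubgroup.closure_le _).mpr ?_
  rintro c ((hc | hc) | hc)
  · obtain ⟨n, r, r₁, r₂, hdom, hnull, h₁, h₂, rfl⟩ := hc
    rw [SetLike.mem_coe, AddMonoidHom.mem_ker, map_sub, map_sub, invariant_of, invariant_of,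
      invariant_of, ← QuotientAddGroup.mk_sub, ← QuotientAddGroup.mk_sub]
    apply mk_eq_zero_of_mem_Nul
    rcases n with _ | _ | m
    · exact dens_domainAdd_zero hdom hnull h₁ h₂
    · exact dens_domainAdd_one hdom hnull h₁ h₂
    · exact dens_domainAdd_two_add hdom hnull h₁ h₂
  · obtain ⟨n, r, r₁, r₂, hd₁, hd₂, hadd, rfl⟩ := hc
    rw [SetLike.mem_coe, AddMonoidHom.mem_ker, map_sub, map_sub, invariant_of, invariant_of,
      invariant_of, ← QuotientAddGroup.mk_sub, ← QuotientAddGroup.mk_sub]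
    apply mk_eq_zero_of_mem_Nul
    rcases n with _ | _ | m
    · exact dens_integrandAdd_zero hd₁ hd₂ hadd
    · exact dens_integrandAdd_one hd₁ hd₂ hadd
    · exact dens_integrandAdd_two_add hd₁ hd₂ hadd
  · obtain ⟨n, r, r', a, b, F, hF, -, -, hab, hdom, hcont, hderiv, hbase, rfl⟩ := hc
    rw [SetLike.mem_coe, AddMonoidHom.mem_ker, map_sub, invariant_of, invariant_of,
      ← QuotientAddGroup.mk_sub]
    rcases n with _ | _ | m
    · exact mk_eq_zero_of_mem_Dsub (AddSubgroup.subset_closure (Or.inr ⟨r, r', rfl⟩))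
    · exact mk_eq_zero_of_mem_Dsub (AddSubgroup.subset_closure
        (Or.inl ⟨r, r', a, b, F, hF, hab, hdom, hcont, hderiv, hbase, rfl⟩))
    · exact mk_eq_zero_of_mem_Nul (dens_newtonLeibniz_two_add hab hdom hcont hderiv hbase)

/-! ### Extraction, I: the word side is `1/x₀`-homogeneous on the region `U` -/

open Summit.KontsevichZagierPeriods.MzvKernelInKZ.Negative (simplex wordFun
  not_integrableOn_wordFun_of_head)

/-- The test region: two generic lines `x₀ = r ∈ (½,1)` crossed with `x₁ ∈ (0,½)`. -/
def U : Set (ℝ × ℝ) := {q | q.1 ∈ Ioo (1 / 2 : ℝ) 1 ∧ q.2 ∈ Ioo (0 : ℝ) (1 / 2)}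

/-- `1/x₀`-homogeneity on `U`. -/
def Good (h : ℝ × ℝ → ℝ) : Prop := ∃ Λ : ℝ → ℝ, ∀ q ∈ U, h q = Λ q.2 / q.1

theorem Good.zero : Good 0 := ⟨0, fun q _ => by simp⟩

theorem Good.add {h₁ h₂ : ℝ × ℝ → ℝ} (g₁ : Good h₁) (g₂ : Good h₂) : Good (h₁ + h₂) := by
  obtain ⟨Λ₁, e₁⟩ := g₁; obtain ⟨Λ₂, e₂⟩ := g₂
  exact ⟨Λ₁ + Λ₂, fun q hq => by simp [e₁ q hq, e₂ q hq, add_div]⟩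

theorem Good.neg {h : ℝ × ℝ → ℝ} (g : Good h) : Good (-h) := by
  obtain ⟨Λ, e⟩ := g
  exact ⟨-Λ, fun q hq => by simp [e q hq, neg_div]⟩

/-- The letter forms. -/
def letter (b : Bool) (u : ℝ) : ℝ := if b then 1 / (1 - u) else 1 / u

/-- On `U`, membership of `(s,t,x)` in the simplex reduces to membership of `(t,x)`. [folklore] -/
theorem cons2_mem_simplex_iff {q : ℝ × ℝ} (hq : q ∈ U) (x : Fin m → ℝ) :
    cons2 (q, x) ∈ simplex (m + 2) ↔ Matrix.vecCons q.2 x ∈ simplex (m + 1) := by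
  obtain ⟨⟨hs1, hs2⟩, ht1, ht2⟩ := hq
  simp only [simplex, mem_setOf_eq, cons2, Fin.forall_fin_succ, Matrix.cons_val_zero,
    Matrix.cons_val_succ, strictAnti_vecCons]
  constructor
  · rintro ⟨⟨-, h0⟩, ⟨-, h1⟩, -, hanti⟩
    exact ⟨h0, h1, hanti⟩
  · rintro ⟨h0, h1, hanti⟩
    refine ⟨⟨by linarith, h0⟩, ⟨hs2, h1⟩, by linarith [h0.1], hanti⟩

/-- The word integrand splits off its first letter along `cons2`. [folklore] -/
theorem wordFun_cons2 {w : ℕ} (ε : Fin (w + 2) → Bool) (q₀ : ℚ) (q : ℝ × ℝ) (x : Fin w → ℝ) :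
    wordFun ε q₀ (cons2 (q, x)) =
      letter (ε 0) q.1 * ((q₀ : ℝ) * ∏ j : Fin (w + 1), letter (ε j.succ) (Matrix.vecCons q.2 x j)) := by
  simp only [wordFun, letter, cons2, Fin.prod_univ_succ (n := w + 1), Matrix.cons_val_zero,
    Matrix.cons_val_succ]
  ring

/-- **The density of a word representation is `1/x₀`-homogeneous on `U`.** [folklore] -/
theorem good_dens_word {w : ℕ} (s : KZ.IntegralRep w) (ε : Fin w → Bool) (q₀ : ℚ)
    (hdom : s.domain = simplex w) (hint : EqOn s.integrand (wordFun ε q₀) s.domain) :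
    Good (dens w s) := by
  rcases w with _ | _ | m
  · refine ⟨0, fun q hq => ?_⟩
    rw [dens_zero, stripInd_of_lt (by linarith [hq.2.2] : q.2 < 2)]
    simp
  · refine ⟨0, fun q hq => ?_⟩
    rw [dens_one, stripInd_of_lt (by linarith [hq.2.2] : q.2 < 2)]
    simp
  · -- dimension `m + 2`
    set Θ : ℝ → ℝ := fun t => ∫ x : Fin m → ℝ, (simplex (m + 1)).indicator
      (fun y => (q₀ : ℝ) * ∏ j : Fin (m + 1), letter (ε j.succ) (y j)) (Matrix.vecCons t x) with hΘ
    have key : ∀ q ∈ U, dens (m + 2) s q = letter (ε 0) q.1 * Θ q.2 := by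
      intro q hq
      rw [dens_two_add, hΘ, ← integral_const_mul]
      refine integral_congr_ae (Filter.Eventually.of_forall fun x => ?_)
      beta_reduce
      rw [hdom]
      by_cases hx : cons2 (q, x) ∈ simplex (m + 1 + 1)
      · have hx' : cons2 (q, x) ∈ s.domain := by rw [hdom]; exact hx
        rw [indicator_of_mem hx, indicator_of_mem ((cons2_mem_simplex_iff hq x).1 hx),
          hint hx', wordFun_cons2]
      · rw [indicator_of_notMem hx,
          indicator_of_notMem (fun h => hx ((cons2_mem_simplex_iff hq x).2 h)), mul_zero]
    cases h0 : ε 0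
    · refine ⟨Θ, fun q hq => ?_⟩
      rw [key q hq, h0]
      simp [letter, div_eq_inv_mul]
    · by_cases hq0 : q₀ = 0
      · refine ⟨0, fun q hq => ?_⟩
        rw [key q hq, hΘ]
        simp [hq0]
      · exfalso
        refine not_integrableOn_wordFun_of_head ε h0 hq0 ?_
        have h := s.integrableOn.congr_fun hint (KZ.IntegralRep.measurableSet_domain_holds s)
        rw [hdom] at h
        exact h

/-- The word representations (as in the crux). -/
def wordRepSet : Set KZ.FormalRep :=
  {x | ∃ (w : ℕ) (ε : Fin w → Bool) (q : ℚ) (s : KZ.IntegralRep w),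
    s.domain = simplex w ∧
    EqOn s.integrand (fun t => (q : ℝ) * ∏ i, if ε i then 1 / (1 - t i) else 1 / t i) s.domain ∧
    x = KZ.of s}

/-- **Extraction I**: every element of the word closure has a `1/x₀`-homogeneous density. [folklore] -/
theorem exists_good_of_mem_closure {m : KZ.FormalRep} (hm : m ∈ AddSubgroup.closure wordRepSet) :
    ∃ h : ℝ × ℝ → ℝ, Good h ∧ invariant m = (QuotientAddGroup.mk h : (ℝ × ℝ → ℝ) ⧸ Ksub) := by
  induction hm using AddSubgroup.closure_induction with
  | mem x hx =>
    obtain ⟨w, ε, q₀, s, hdom, hint, rfl⟩ := hx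
    exact ⟨dens w s, good_dens_word s ε q₀ hdom hint, invariant_of s⟩
  | zero => exact ⟨0, Good.zero, by simp⟩
  | add x y _ _ hx hy =>
    obtain ⟨h₁, g₁, e₁⟩ := hx; obtain ⟨h₂, g₂, e₂⟩ := hy
    exact ⟨h₁ + h₂, g₁.add g₂, by rw [map_add, e₁, e₂, QuotientAddGroup.mk_add]⟩
  | neg x _ hx =>
    obtain ⟨h, g, e⟩ := hx
    exact ⟨-h, g.neg, by rw [map_neg, e, QuotientAddGroup.mk_neg]⟩

/-! ### Extraction, II: the low-dimensional Newton–Leibniz side on `U` -/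

/-- Small vector identities. -/
theorem init_vecTwo (r t : ℝ) : Fin.init (![r, t] : Fin 2 → ℝ) = ![r] := by
  ext i; fin_cases i; rfl

theorem vecTwo_last (r t : ℝ) : (![r, t] : Fin 2 → ℝ) (Fin.last 1) = t := rfl

theorem snoc_vecOne (r t : ℝ) : Fin.snoc (![r] : Fin 1 → ℝ) t = ![r, t] := by
  ext i; fin_cases i <;> rfl

theorem vecTwo_eq_cons (r t : ℝ) : (![r, t] : Fin 2 → ℝ) = Fin.cons r (fun _ => t) := by
  ext i; fin_cases i <;> rfl

theorem cons2_vecEmpty (q : ℝ × ℝ) : cons2 (q, (![] : Fin 0 → ℝ)) = ![q.1, q.2] := rfl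

/-- Integral over the one-point space `ℝ⁰`. [folklore] -/
theorem integral_fin_zero (G : (Fin 0 → ℝ) → ℝ) : ∫ x, G x = G ![] := by
  have h : (volume : Measure (Fin 0 → ℝ)) = Measure.dirac ![] := by
    rw [volume_pi, Measure.pi_of_empty]
    congr 1
  rw [h, integral_dirac]

/-- The density of a dimension-`2` representation is its extended integrand. [folklore] -/
theorem dens_two (r : KZ.IntegralRep 2) (q : ℝ × ℝ) :
    dens 2 r q = r.domain.indicator r.integrand ![q.1, q.2] := by
  rw [dens_two_add (m := 0), integral_fin_zero, cons2_vecEmpty]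

/-- The data of a Newton–Leibniz instance with base dimension `1`. -/
structure NLOne where
  r : KZ.IntegralRep 2
  r' : KZ.IntegralRep 1
  a : (Fin 1 → ℝ) → ℝ
  b : (Fin 1 → ℝ) → ℝ
  F : (Fin 2 → ℝ) → ℝ
  hF : IsSemialgebraicFunOn ℚ r.domain F
  hdom : r.domain = {z | (Fin.init z : Fin 1 → ℝ) ∈ r'.domain ∧ a (Fin.init z) ≤ z (Fin.last 1) ∧
    z (Fin.last 1) ≤ b (Fin.init z)}
  hderiv : ∀ x ∈ r'.domain, ∀ t ∈ Ioo (a x) (b x),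
    HasDerivAt (fun s : ℝ => F (Fin.snoc x s)) (r.integrand (Fin.snoc x t)) t

/-- The band term of an instance on the line data `(s,t)`. -/
def bandTerm (d : NLOne) (q : ℝ × ℝ) : ℝ := d.r.domain.indicator d.r.integrand ![q.1, q.2]

/-- Finite-family shape on `U`. -/
def PD (δ : ℝ × ℝ → ℝ) : Prop :=
  ∃ (L : ℕ) (c : Fin L → ℤ) (d : Fin L → NLOne), ∀ q ∈ U, δ q = ∑ i, (c i : ℝ) * bandTerm (d i) q

theorem PD.zero : PD 0 := ⟨0, Fin.elim0, Fin.elim0, fun q _ => by simp⟩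

theorem PD.add {δ₁ δ₂ : ℝ × ℝ → ℝ} (h₁ : PD δ₁) (h₂ : PD δ₂) : PD (δ₁ + δ₂) := by
  obtain ⟨L₁, c₁, d₁, e₁⟩ := h₁
  obtain ⟨L₂, c₂, d₂, e₂⟩ := h₂
  refine ⟨L₁ + L₂, Fin.append c₁ c₂, Fin.append d₁ d₂, fun q hq => ?_⟩
  rw [Pi.add_apply, e₁ q hq, e₂ q hq, Fin.sum_univ_add]
  simp

theorem PD.neg {δ : ℝ × ℝ → ℝ} (h : PD δ) : PD (-δ) := by
  obtain ⟨L, c, d, e⟩ := h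
  refine ⟨L, fun i => -c i, d, fun q hq => ?_⟩
  rw [Pi.neg_apply, e q hq, ← Finset.sum_neg_distrib]
  simp [neg_mul]

/-- **Extraction II**: on `U` every element of `Dsub` is a finite `ℤ`-combination of band terms
of Newton–Leibniz instances with base dimension `1` (the strip-supported parts vanish on `U`).
[folklore] -/
theorem pd_of_mem_Dsub {δ : ℝ × ℝ → ℝ} (hδ : δ ∈ Dsub) : PD δ := by
  induction hδ using AddSubgroup.closure_induction with
  | mem g hg =>
    rcases hg with hg | hg
    · obtain ⟨r, r', a, b, F, hF, hab, hdom, hcont, hderiv, hbase, rfl⟩ := hg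
      refine ⟨1, fun _ => 1, fun _ => ⟨r, r', a, b, F, hF, hdom, hderiv⟩, fun q hq => ?_⟩
      simp only [Pi.sub_apply, Fin.sum_univ_one, Int.cast_one, one_mul, bandTerm]
      rw [dens_two, dens_one, stripInd_of_lt (by linarith [hq.2.2] : q.2 < 2)]
      simp
    · obtain ⟨r, r', rfl⟩ := hg
      refine ⟨0, Fin.elim0, Fin.elim0, fun q hq => ?_⟩
      simp only [Pi.sub_apply, Finset.univ_eq_empty, Finset.sum_empty]
      rw [dens_one, dens_zero, stripInd_of_lt (by linarith [hq.2.2] : q.2 < 2)]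
      simp
  | zero => exact PD.zero
  | add x y _ _ hx hy => exact hx.add hy
  | neg x _ hx => exact hx.neg

/-! ### Generic lines, avoiding intervals, line integrability -/

/-- Two distinct parameters in `(½,1)` at which an a.e. property holds. [folklore] -/
theorem exists_two_of_ae {P : ℝ → Prop} (h : ∀ᵐ s, P s) :
    ∃ r₁ r₂ : ℝ, r₁ ∈ Ioo (1 / 2 : ℝ) 1 ∧ r₂ ∈ Ioo (1 / 2 : ℝ) 1 ∧ r₁ ≠ r₂ ∧ P r₁ ∧ P r₂ := by
  have hN : volume {s | ¬ P s} = 0 := ae_iff.1 h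
  have hpos : volume (Ioo (1 / 2 : ℝ) 1) ≠ 0 := by
    rw [Real.volume_Ioo]; norm_num
  have h1 : volume (Ioo (1 / 2 : ℝ) 1 \ {s | ¬ P s}) ≠ 0 := by rwa [measure_sdiff_null hN]
  obtain ⟨r₁, hr₁⟩ := nonempty_of_measure_ne_zero h1
  have h2 : volume ((Ioo (1 / 2 : ℝ) 1 \ {s | ¬ P s}) \ {r₁}) ≠ 0 := by
    rwa [measure_sdiff_null (Real.volume_singleton (a := r₁))]
  obtain ⟨r₂, hr₂⟩ := nonempty_of_measure_ne_zero h2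
  refine ⟨r₁, r₂, hr₁.1, hr₂.1.1, fun h => hr₂.2 (h ▸ rfl), ?_, ?_⟩
  · simpa using hr₁.2
  · simpa using hr₂.1.2

/-- An open subinterval avoiding a finite set. [folklore] -/
theorem exists_Ioo_avoid (E : Finset ℝ) {u₀ v₀ : ℝ} (h : u₀ < v₀) :
    ∃ u v : ℝ, u₀ ≤ u ∧ u < v ∧ v ≤ v₀ ∧ ∀ e ∈ E, e ∉ Ioo u v := by
  induction E using Finset.induction_on with
  | empty => exact ⟨u₀, v₀, le_rfl, h, le_rfl, fun e he => absurd he (Finset.notMem_empty e)⟩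
  | insert x E hx ih =>
    obtain ⟨u, v, hu, huv, hv, hE⟩ := ih
    by_cases hxm : x ∈ Ioo u v
    · refine ⟨u, x, hu, hxm.1, hxm.2.le.trans hv, fun e he => ?_⟩
      rcases Finset.mem_insert.1 he with rfl | he
      · exact fun h' => lt_irrefl _ h'.2
      · exact fun h' => hE e he ⟨h'.1, h'.2.trans hxm.2⟩
    · refine ⟨u, v, hu, huv, hv, fun e he => ?_⟩
      rcases Finset.mem_insert.1 he with rfl | he
      · exact hxm
      · exact hE e he

/-- Along almost every line `x₀ = s` the extended integrand of a dimension-`2` representation is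
integrable in `x₁`. [folklore] -/
theorem ae_integrable_line (r : KZ.IntegralRep 2) :
    ∀ᵐ s : ℝ, Integrable fun t : ℝ => r.domain.indicator r.integrand ![s, t] := by
  have hG := integrable_indicator r
  have h := ((volume_preserving_finTwoArrow ℝ).symm _).integrable_comp_emb
    (MeasurableEquiv.finTwoArrow (α := ℝ)).symm.measurableEmbedding (g := r.domain.indicator r.integrand)
  have h2 : Integrable (fun p : ℝ × ℝ => r.domain.indicator r.integrand ![p.1, p.2])
      ((volume : Measure ℝ).prod volume) := by
    rw [← Measure.volume_eq_prod]
    have h3 := h.mpr hG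
    have hfun : (fun p : ℝ × ℝ => r.domain.indicator r.integrand ![p.1, p.2]) =
        r.domain.indicator r.integrand ∘ ⇑(MeasurableEquiv.finTwoArrow (α := ℝ)).symm := by
      funext p
      simp [MeasurableEquiv.finTwoArrow_symm_apply]
    rw [hfun]
    exact h3
  exact h2.prod_right_ae

/-- Constancy of an interval condition along an interval missing the endpoints. [folklore] -/
theorem Icc_iff_of_notMem {a b u v t t₀ : ℝ} (ha : a ∉ Ioo u v) (hb : b ∉ Ioo u v)
    (ht : t ∈ Ioo u v) (ht₀ : t₀ ∈ Ioo u v) : (a ≤ t ∧ t ≤ b) ↔ (a ≤ t₀ ∧ t₀ ≤ b) := by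
  constructor
  · rintro ⟨hat, htb⟩
    have hau : a ≤ u := by
      by_contra h'; exact ha ⟨lt_of_not_ge h', lt_of_le_of_lt hat ht.2⟩
    have hbv : v ≤ b := by
      by_contra h'; exact hb ⟨lt_of_lt_of_le ht.1 htb, lt_of_not_ge h'⟩
    exact ⟨hau.trans ht₀.1.le, ht₀.2.le.trans hbv⟩
  · rintro ⟨hat, htb⟩
    have hau : a ≤ u := by
      by_contra h'; exact ha ⟨lt_of_not_ge h', lt_of_le_of_lt hat ht₀.2⟩
    have hbv : v ≤ b := by
      by_contra h'; exact hb ⟨lt_of_lt_of_le ht₀.1 htb, lt_of_not_ge h'⟩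
    exact ⟨hau.trans ht.1.le, ht.2.le.trans hbv⟩

/-- If moreover the condition holds, the point is in the OPEN fibre. [folklore] -/
theorem mem_Ioo_of_Icc_of_notMem {a b u v t : ℝ} (ha : a ∉ Ioo u v) (hb : b ∉ Ioo u v)
    (ht : t ∈ Ioo u v) (h : a ≤ t ∧ t ≤ b) : t ∈ Ioo a b := by
  refine ⟨lt_of_le_of_ne h.1 ?_, lt_of_le_of_ne h.2 ?_⟩
  · rintro rfl; exact ha ht
  · rintro rfl; exact hb ht

/-! ## The witness and the crux without rule (2) -/

section Witness

open Summit.KontsevichZagierPeriods.MzvKernelInKZ.Negative (Adm integrableOn_wordFun)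

/-- The genus-zero integrand of the crux, as inlined in the route file. -/
def gzIntegrand (k : ℕ) (p : MvPolynomial (Fin k) ℚ) (a : Fin k → Fin k → ℕ) (b c : Fin k → ℕ)
    (t : Fin k → ℝ) : ℝ :=
  MvPolynomial.aeval t p / ((∏ i, t i ^ b i) * (∏ i, (1 - t i) ^ c i) *
    ∏ i, ∏ j, if i < j then (t i - t j) ^ a i j else 1)

/-- Hypothesis of the crux on a representation `r`: genus-zero shape on the open simplex. -/
def IsGenusZero {k : ℕ} (r : KZ.IntegralRep k) : Prop :=
  ∃ (p : MvPolynomial (Fin k) ℚ) (a : Fin k → Fin k → ℕ) (b c : Fin k → ℕ),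
    r.domain = simplex k ∧ EqOn r.integrand (gzIntegrand k p a b c) r.domain

/-- The letters `01` (the `ζ(2)` word) are admissible. [folklore] -/
theorem adm_zetaTwo : Adm (![false, true] : Fin 2 → Bool) := by
  intro h
  simp

/-- `1/(1-t₁)` is dominated on `Δ₂` by the `ζ(2)` integrand, hence integrable. [folklore] -/
theorem integrableOn_one_div_one_sub :
    IntegrableOn (fun t : Fin 2 → ℝ => 1 / (1 - t 1)) (simplex 2) := by
  have hg : IntegrableOn (wordFun (![false, true] : Fin 2 → Bool) 1) (simplex 2) :=
    integrableOn_wordFun adm_zetaTwo 1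
  refine Integrable.mono' hg ?_ ?_
  · exact ((measurable_const.sub (measurable_pi_apply 1)).const_div 1).aestronglyMeasurable
  · rw [show simplex 2 = KZ.openOrderedSimplex 2 from rfl,
      ae_restrict_iff' (KZ.measurableSet_openOrderedSimplex 2)]
    refine ae_of_all _ fun t ht => ?_
    obtain ⟨h0, h1, -⟩ := ht
    have ht0 : 0 < t 0 := h0 0
    have ht0' : t 0 < 1 := h1 0
    have ht1 : 0 < 1 - t 1 := by linarith [h1 1]
    simp only [wordFun, Fin.prod_univ_two, Matrix.cons_val_zero, Matrix.cons_val_one,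
      Bool.false_eq_true, if_false, if_true, Rat.cast_one, one_mul]
    rw [Real.norm_eq_abs, abs_of_pos (by positivity)]
    rw [div_mul_div_comm, one_mul, le_div_iff₀ (by positivity), div_mul_eq_mul_div, one_mul,
      div_le_iff₀ ht1]
    nlinarith

/-- **The witness `r_L = [Δ₂, 1/(1-t₁)]`**. -/
def letterRep : KZ.IntegralRep 2 :=
  KZ.IntegralRep.ofRational (simplex 2) 1 (1 - MvPolynomial.X 1) (KZ.isSemialgebraic_openOrderedSimplex 2)
    (fun t ht => by
      have := ht.2.1 1
      simp only [map_sub, map_one, MvPolynomial.aeval_X, ne_eq]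
      linarith)
    (by
      refine integrableOn_one_div_one_sub.congr_fun (fun t _ => ?_) (KZ.measurableSet_openOrderedSimplex 2)
      simp)

theorem letterRep_domain : letterRep.domain = simplex 2 := rfl

theorem letterRep_integrand (t : Fin 2 → ℝ) : letterRep.integrand t = 1 / (1 - t 1) := by
  simp [letterRep]

/-- `r_L` has the genus-zero shape (`P = 1`, `a = 0`, `b = 0`, `c = (0,1)`). [folklore] -/
theorem isGenusZero_letterRep : IsGenusZero letterRep := by
  refine ⟨1, fun _ _ => 0, ![0, 0], ![0, 1], rfl, ?_⟩
  intro t _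
  rw [letterRep_integrand]
  simp [gzIntegrand, Fin.prod_univ_two]

/-- On `U` the density of the witness is `1/(1-x₁)`. [folklore] -/
theorem letterRep_dens {q : ℝ × ℝ} (hq : q ∈ U) : dens 2 letterRep q = 1 / (1 - q.2) := by
  obtain ⟨⟨hs1, hs2⟩, ht1, ht2⟩ := hq
  have hmem : (![q.1, q.2] : Fin 2 → ℝ) ∈ letterRep.domain := by
    rw [letterRep_domain]
    refine ⟨?_, ?_, ?_⟩
    · intro i; fin_cases i <;> simp <;> linarith
    · intro i; fin_cases i <;> simp <;> linarith
    · rw [strictAnti_vecCons]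
      refine ⟨by simp; linarith, fun i j hij => ?_⟩
      exact absurd hij (by rw [Fin.fin_one_eq_zero i, Fin.fin_one_eq_zero j]; exact lt_irrefl _)
  rw [dens_two, indicator_of_mem hmem, letterRep_integrand]
  rfl

/-- **The crux WITHOUT rule (2).** -/
def CruxWithoutChangeOfVariables : Prop :=
  ∀ (k : ℕ) (r : KZ.IntegralRep k), IsGenusZero r →
    ∃ m ∈ AddSubgroup.closure wordRepSet, KZ.of r - m ∈ relationsWithoutCoV

end Witness

/-! ## Along a line: activity, the primitive sum and its derivative -/

section Line

open Classical in
/-- Activity of the `i`-th band on the line `x₀ = r` over the test interval `(u,v)` (tested at the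
midpoint). -/
def act {L : ℕ} (d : Fin L → NLOne) (u v r : ℝ) (i : Fin L) : Prop :=
  (![r, (u + v) / 2] : Fin 2 → ℝ) ∈ (d i).r.domain

/-- Membership in a band along a line is equivalent to the base point lying in the base domain and
the fibre coordinate lying in the closed fibre. [folklore] -/
theorem mem_band_iff (d : NLOne) (r t : ℝ) :
    (![r, t] : Fin 2 → ℝ) ∈ d.r.domain ↔ (![r] : Fin 1 → ℝ) ∈ d.r'.domain ∧ d.a ![r] ≤ t ∧ t ≤ d.b ![r] := by
  rw [d.hdom]
  simp only [mem_setOf_eq, init_vecTwo, vecTwo_last]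

/-- Activity is constant along the test interval when it misses the fibre endpoints. [folklore] -/
theorem mem_band_iff_act {L : ℕ} (d : Fin L → NLOne) {u v r : ℝ} (huv : u < v) (i : Fin L)
    (ha : (d i).a ![r] ∉ Ioo u v) (hb : (d i).b ![r] ∉ Ioo u v) {t : ℝ} (ht : t ∈ Ioo u v) :
    (![r, t] : Fin 2 → ℝ) ∈ (d i).r.domain ↔ act d u v r i := by
  have ht₀ : (u + v) / 2 ∈ Ioo u v := ⟨by linarith, by linarith⟩
  rw [act, mem_band_iff, mem_band_iff, Icc_iff_of_notMem ha hb ht ht₀]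

open Classical in
/-- The primitive sum along the line. -/
def Gfun {L : ℕ} (c : Fin L → ℤ) (d : Fin L → NLOne) (u v r : ℝ) (t : ℝ) : ℝ :=
  ∑ i, (c i : ℝ) * (if act d u v r i then (d i).F ![r, t] else 0)

open Classical in
/-- Its derivative along the line. -/
def Dfun {L : ℕ} (c : Fin L → ℤ) (d : Fin L → NLOne) (u v r : ℝ) (t : ℝ) : ℝ :=
  ∑ i, (c i : ℝ) * (if act d u v r i then (d i).r.integrand ![r, t] else 0)

/-- On the test interval the derivative sum is the band sum. [folklore] -/
theorem Dfun_eq {L : ℕ} (c : Fin L → ℤ) (d : Fin L → NLOne) {u v r : ℝ} (huv : u < v)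
    (ha : ∀ i, (d i).a ![r] ∉ Ioo u v) (hb : ∀ i, (d i).b ![r] ∉ Ioo u v) {t : ℝ} (ht : t ∈ Ioo u v) :
    Dfun c d u v r t = ∑ i, (c i : ℝ) * bandTerm (d i) (r, t) := by
  unfold Dfun bandTerm
  refine Finset.sum_congr rfl fun i _ => ?_
  congr 1
  simp only [indicator]
  by_cases h : (![r, t] : Fin 2 → ℝ) ∈ (d i).r.domain
  · rw [if_pos h, if_pos ((mem_band_iff_act d huv i (ha i) (hb i) ht).1 h)]
  · rw [if_neg h, if_neg (fun h' => h ((mem_band_iff_act d huv i (ha i) (hb i) ht).2 h'))]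

/-- The derivative sum is integrable on the test interval if the band terms are integrable along
the line. [folklore] -/
theorem integrableOn_Dfun {L : ℕ} (c : Fin L → ℤ) (d : Fin L → NLOne) {u v r : ℝ} (huv : u < v)
    (ha : ∀ i, (d i).a ![r] ∉ Ioo u v) (hb : ∀ i, (d i).b ![r] ∉ Ioo u v)
    (hI : ∀ i, Integrable fun t : ℝ => bandTerm (d i) (r, t)) :
    IntegrableOn (Dfun c d u v r) (Ioo u v) := by
  have h : IntegrableOn (fun t => ∑ i, (c i : ℝ) * bandTerm (d i) (r, t)) (Ioo u v) :=
    (integrable_finsetSum _ fun i _ => (hI i).const_mul (c i : ℝ)).integrableOn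
  exact h.congr_fun (fun t ht => (Dfun_eq c d huv ha hb ht).symm) measurableSet_Ioo

/-- The primitive sum is differentiable on the test interval with derivative the derivative sum.
[folklore] -/
theorem hasDerivAt_Gfun {L : ℕ} (c : Fin L → ℤ) (d : Fin L → NLOne) {u v r : ℝ} (huv : u < v)
    (ha : ∀ i, (d i).a ![r] ∉ Ioo u v) (hb : ∀ i, (d i).b ![r] ∉ Ioo u v) {t : ℝ} (ht : t ∈ Ioo u v) :
    HasDerivAt (Gfun c d u v r) (Dfun c d u v r t) t := by
  unfold Gfun Dfun
  refine HasDerivAt.fun_sum fun i _ => ?_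
  by_cases h : act d u v r i
  · simp only [if_pos h]
    have hmem : (![r, t] : Fin 2 → ℝ) ∈ (d i).r.domain := (mem_band_iff_act d huv i (ha i) (hb i) ht).2 h
    obtain ⟨hx, hat, htb⟩ := (mem_band_iff (d i) r t).1 hmem
    have ht' : t ∈ Ioo ((d i).a ![r]) ((d i).b ![r]) := mem_Ioo_of_Icc_of_notMem (ha i) (hb i) ht ⟨hat, htb⟩
    have hd := ((d i).hderiv _ hx t ht').const_mul (c i : ℝ)
    simp only [snoc_vecOne] at hd
    exact hd
  · simp only [if_neg h, mul_zero]
    exact hasDerivAt_const t 0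

/-- **FTC upgrade**: a function with an integrable derivative that agrees a.e. with `c/(1-t)` on
an interval left of `½` has derivative `c/(1-t)` everywhere there. [folklore] -/
theorem hasDerivAt_of_ae_eq {u v : ℝ} (hv : v ≤ 1 / 2) {H φ : ℝ → ℝ} {c : ℝ}
    (hH : ∀ t ∈ Ioo u v, HasDerivAt H (φ t) t) (hφ : IntegrableOn φ (Ioo u v))
    (hae : ∀ᵐ t, t ∈ Ioo u v → φ t = c / (1 - t)) :
    ∀ t ∈ Ioo u v, HasDerivAt H (c / (1 - t)) t := by
  set Φ : ℝ → ℝ := fun t => H t + c * Real.log (1 - t) with hΦ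
  set ψ : ℝ → ℝ := fun t => φ t + c * ((-1) / (1 - t)) with hψ
  have hne : ∀ t ∈ Ioo u v, (1 : ℝ) - t ≠ 0 := fun t ht => by linarith [ht.2]
  have hΦd : ∀ t ∈ Ioo u v, HasDerivAt Φ (ψ t) t := by
    intro t ht
    have hlog : HasDerivAt (fun s => Real.log (1 - s)) ((-1) / (1 - t)) t := by
      simpa using ((hasDerivAt_id t).const_sub 1).log (hne t ht)
    exact (hH t ht).add (hlog.const_mul c)
  have hψae : ∀ᵐ t, t ∈ Ioo u v → ψ t = 0 := by
    filter_upwards [hae] with t ht htJ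
    rw [hψ]; simp only
    rw [ht htJ]
    have := hne t htJ
    field_simp
    ring
  have hcont : ContinuousOn (fun t : ℝ => c * ((-1) / (1 - t))) (Icc u v) := by
    refine continuousOn_const.mul (continuousOn_const.div (continuousOn_const.sub continuousOn_id) ?_)
    intro t ht h0
    have : t ≤ v := ht.2
    linarith
  have hψint : IntegrableOn ψ (Ioo u v) :=
    hφ.add ((hcont.integrableOn_Icc).mono_set Ioo_subset_Icc_self)
  -- `Φ` is constant on the interval
  have hconst : ∀ x ∈ Ioo u v, ∀ y ∈ Ioo u v, x ≤ y → Φ y = Φ x := by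
    intro x hx y hy hxy
    have hsub : uIcc x y ⊆ Ioo u v := (ordConnected_Ioo).uIcc_subset hx hy
    have h1 : ∫ t in x..y, ψ t = Φ y - Φ x :=
      intervalIntegral.integral_eq_sub_of_hasDerivAt (fun t ht => hΦd t (hsub ht))
        ((hψint.mono_set hsub).intervalIntegrable)
    have h2 : ∫ t in x..y, ψ t = 0 := by
      rw [intervalIntegral.integral_of_le hxy]
      refine integral_eq_zero_of_ae ?_
      have hIoc : Ioc x y ⊆ Ioo u v := fun t ht => ⟨lt_of_lt_of_le hx.1 ht.1.le, lt_of_le_of_lt ht.2 hy.2⟩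
      have h3 : ∀ᵐ t ∂(volume.restrict (Ioc x y)), t ∈ Ioc x y := ae_restrict_mem measurableSet_Ioc
      filter_upwards [ae_restrict_of_ae (μ := volume) (s := Ioc x y) hψae, h3] with t ht htm
      exact ht (hIoc htm)
    linarith
  intro t ht
  have heq : ∀ᶠ s in nhds t, H s = Φ t - c * Real.log (1 - s) := by
    filter_upwards [Ioo_mem_nhds ht.1 ht.2] with s hs
    have hΦs : Φ s = Φ t := by
      rcases le_total t s with h | h
      · exact hconst t ht s hs h
      · exact (hconst s hs t ht h).symm
    have : Φ s = H s + c * Real.log (1 - s) := rfl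
    linarith
  have hlog : HasDerivAt (fun s => Real.log (1 - s)) ((-1) / (1 - t)) t := by
    simpa using ((hasDerivAt_id t).const_sub 1).log (hne t ht)
  have hd : HasDerivAt (fun s => Φ t - c * Real.log (1 - s)) (0 - c * ((-1) / (1 - t))) t :=
    (hasDerivAt_const t (Φ t)).sub (hlog.const_mul c)
  have hd' : HasDerivAt (fun s => Φ t - c * Real.log (1 - s)) (c / (1 - t)) t := by
    convert hd using 1
    have := hne t ht
    field_simp
    ring
  exact hd'.congr_of_eventuallyEq heq

end Line

/-! ## The main theorem: the crux is false without rule (2) -/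

section Main

open Polynomial
open scoped Polynomial.Bivariate

/-- **Rule (2) is load-bearing: `DihedralNormalForm` fails inside the sub-calculus generated by the
additivity moves and Newton–Leibniz.**  Witness `[Δ₂, 1/(1-t₁)]`; invariant: push-forward to the
first two coordinates modulo a.e.-zero functions and low-dimensional Newton–Leibniz differences;
the word side is `1/x₀`-homogeneous; elimination along two generic lines; no linear combination of
slices of semialgebraic primitives is a primitive of `c/(1-t)`. [folklore] -/
theorem not_cruxWithoutChangeOfVariables : ¬ CruxWithoutChangeOfVariables := by
  classical
  intro hC
  obtain ⟨m, hm, hrel⟩ := hC 2 letterRep isGenusZero_letterRep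
  obtain ⟨hW, ⟨Λ, hΛ⟩, hιm⟩ := exists_good_of_mem_closure hm
  have h0 : invariant (KZ.of letterRep - m) = 0 :=
    (AddMonoidHom.mem_ker).1 (relationsWithoutCoV_le_ker hrel)
  rw [map_sub, invariant_of, hιm, ← QuotientAddGroup.mk_sub, QuotientAddGroup.eq_zero_iff] at h0
  obtain ⟨η, hη, δ, hδ, hsum⟩ := AddSubgroup.mem_sup.1 h0
  obtain ⟨L, c, d, hδU⟩ := pd_of_mem_Dsub hδ
  -- the pointwise identity on `U`
  have hpt : ∀ q ∈ U, 1 / (1 - q.2) - Λ q.2 / q.1 = η q + ∑ i, (c i : ℝ) * bandTerm (d i) q := by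
    intro q hq
    have e := congrFun hsum q
    simp only [Pi.add_apply, Pi.sub_apply] at e
    rw [hδU q hq, letterRep_dens hq, hΛ q hq] at e
    linarith
  -- a.e. in the line parameter
  have haeη : ∀ᵐ s : ℝ, ∀ᵐ t : ℝ, η (s, t) = 0 := by
    have hη' : ∀ᵐ q : ℝ × ℝ ∂((volume : Measure ℝ).prod volume), η q = 0 := by
      rw [← Measure.volume_eq_prod]; exact hη
    exact Measure.ae_ae_of_ae_prod hη'
  have haeI : ∀ᵐ s : ℝ, ∀ i : Fin L, Integrable fun t : ℝ => bandTerm (d i) (s, t) := by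
    rw [ae_all_iff]; intro i; exact ae_integrable_line (d i).r
  obtain ⟨r₁, r₂, hr₁, hr₂, hne, ⟨hη₁, hI₁⟩, ⟨hη₂, hI₂⟩⟩ := exists_two_of_ae (haeη.and haeI)
  -- a test interval `(u,v) ⊆ (0,½)` missing all fibre endpoints on both lines
  let E : Finset ℝ :=
    ((Finset.univ.image fun i => (d i).a ![r₁]) ∪ (Finset.univ.image fun i => (d i).b ![r₁])) ∪
      ((Finset.univ.image fun i => (d i).a ![r₂]) ∪ (Finset.univ.image fun i => (d i).b ![r₂]))
  obtain ⟨u, v, hu, huv, hv, hE⟩ := exists_Ioo_avoid E (show (0 : ℝ) < 1 / 2 by norm_num)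
  have ha₁ : ∀ i, (d i).a ![r₁] ∉ Ioo u v := fun i => hE _ (by simp [E])
  have hb₁ : ∀ i, (d i).b ![r₁] ∉ Ioo u v := fun i => hE _ (by simp [E])
  have ha₂ : ∀ i, (d i).a ![r₂] ∉ Ioo u v := fun i => hE _ (by simp [E])
  have hb₂ : ∀ i, (d i).b ![r₂] ∉ Ioo u v := fun i => hE _ (by simp [E])
  have hJU : ∀ {r t : ℝ}, r ∈ Ioo (1 / 2 : ℝ) 1 → t ∈ Ioo u v → (r, t) ∈ U := fun hr ht =>
    ⟨hr, ⟨by linarith [ht.1], by linarith [ht.2]⟩⟩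
  -- the derivative sums agree a.e. with `1/(1-t) - Λ t / r` on each line
  have hline : ∀ {r : ℝ}, r ∈ Ioo (1 / 2 : ℝ) 1 → (∀ᵐ t : ℝ, η (r, t) = 0) →
      (∀ i, (d i).a ![r] ∉ Ioo u v) → (∀ i, (d i).b ![r] ∉ Ioo u v) →
      ∀ᵐ t : ℝ, t ∈ Ioo u v → Dfun c d u v r t = 1 / (1 - t) - Λ t / r := by
    intro r hr hηr ha hb
    filter_upwards [hηr] with t ht htJ
    rw [Dfun_eq c d huv ha hb htJ]
    have := hpt (r, t) (hJU hr htJ)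
    rw [ht, zero_add] at this
    exact this.symm
  -- combine the two lines
  set H : ℝ → ℝ := fun t => r₁ * Gfun c d u v r₁ t - r₂ * Gfun c d u v r₂ t with hH
  set φ : ℝ → ℝ := fun t => r₁ * Dfun c d u v r₁ t - r₂ * Dfun c d u v r₂ t with hφ
  have hHd : ∀ t ∈ Ioo u v, HasDerivAt H (φ t) t := fun t ht =>
    ((hasDerivAt_Gfun c d huv ha₁ hb₁ ht).const_mul r₁).sub
      ((hasDerivAt_Gfun c d huv ha₂ hb₂ ht).const_mul r₂)
  have hr1 : r₁ ≠ 0 := by linarith [hr₁.1]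
  have hr2 : r₂ ≠ 0 := by linarith [hr₂.1]
  have hφae : ∀ᵐ t, t ∈ Ioo u v → φ t = (r₁ - r₂) / (1 - t) := by
    filter_upwards [hline hr₁ hη₁ ha₁ hb₁, hline hr₂ hη₂ ha₂ hb₂] with t h1 h2 htJ
    rw [hφ]
    simp only
    rw [h1 htJ, h2 htJ]
    have : (1 : ℝ) - t ≠ 0 := by linarith [htJ.2]
    field_simp
    ring
  have hφint : IntegrableOn φ (Ioo u v) :=
    ((integrableOn_Dfun c d huv ha₁ hb₁ hI₁).const_mul r₁).sub
      ((integrableOn_Dfun c d huv ha₂ hb₂ hI₂).const_mul r₂)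
  have hHd' : ∀ t ∈ Ioo u v, HasDerivAt H ((r₁ - r₂) / (1 - t)) t :=
    hasDerivAt_of_ae_eq hv hHd hφint hφae
  -- the algebraic data of the slices
  have hslice : ∀ (r : ℝ) (i : Fin L), ∃ P : ℝ[X][Y], P ≠ 0 ∧ ∀ t : ℝ,
      (![r, t] : Fin 2 → ℝ) ∈ (d i).r.domain → P.evalEval t ((d i).F ![r, t]) = 0 := by
    intro r i
    obtain ⟨P, hP0, hP⟩ := exists_ne_zero_evalEval_slice (d i).hF r
    refine ⟨P, hP0, fun t ht => ?_⟩
    have h := hP t (by rw [← vecTwo_eq_cons]; exact ht)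
    rwa [← vecTwo_eq_cons] at h
  choose P hP0 hPrel using hslice
  -- index the combination by `Fin L ⊕ Fin L`
  let ρ : Fin L ⊕ Fin L → ℝ := Sum.elim (fun _ => r₁) (fun _ => r₂)
  let idx : Fin L ⊕ Fin L → Fin L := Sum.elim id id
  let φf : Fin L ⊕ Fin L → ℝ → ℝ := fun l t =>
    if act d u v (ρ l) (idx l) then (d (idx l)).F ![ρ l, t] else 0
  let Pf : Fin L ⊕ Fin L → ℝ[X][Y] := fun l => if act d u v (ρ l) (idx l) then P (ρ l) (idx l) else X
  let lam : Fin L ⊕ Fin L → ℝ := Sum.elim (fun i => r₁ * c i) (fun i => -(r₂ * c i))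
  have hPf0 : ∀ l, Pf l ≠ 0 := by
    intro l
    simp only [Pf]
    split_ifs
    · exact hP0 _ _
    · exact X_ne_zero
  have hrelf : ∀ l, ∀ t ∈ Ioo u v, (Pf l).evalEval t (φf l t) = 0 := by
    intro l t ht
    simp only [Pf, φf]
    by_cases hA : act d u v (ρ l) (idx l)
    · rw [if_pos hA, if_pos hA]
      refine hPrel _ _ t ?_
      rcases l with i | i
      · exact (mem_band_iff_act d huv i (ha₁ i) (hb₁ i) ht).2 hA
      · exact (mem_band_iff_act d huv i (ha₂ i) (hb₂ i) ht).2 hA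
    · rw [if_neg hA, if_neg hA, evalEval_X]
  have hGsum : ∀ t ∈ Ioo u v, H t = ∑ l, lam l * φf l t := by
    intro t _
    rw [hH]
    simp only [Fintype.sum_sum_type, lam, φf, ρ, idx, Sum.elim_inl, Sum.elim_inr, id, Gfun,
      Finset.mul_sum]
    rw [sub_eq_add_neg, ← Finset.sum_neg_distrib]
    congr 1 <;> refine Finset.sum_congr rfl fun i _ => ?_ <;> ring
  refine no_linearCombination_algebraic_primitive_letter true huv (by simp; linarith) φf Pf hPf0 hrelf
    lam hGsum (c := r₁ - r₂) (sub_ne_zero.2 hne) ?_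
  intro t ht
  simpa using hHd' t ht

end Main


end RuleTwo

/-! ## §10 TIGHTNESS of the rule-(2) obstruction: the mirror witness `[Δ₂, 1/t₀]` closes WITHOUT rule (2) (certified)

The letter at the FIRST coordinate instead of the last: `[Δ₂, 1/t₀] ≡ [pt, 1]` modulo
`relationsWithoutCoV` by six instances of (1a)/(3) (close null faces; Newton–Leibniz with primitive
`t₁/t₀` to `[Δ₁,1]`; close endpoints; Newton–Leibniz with primitive `t` to `[pt,1]`).  Hence the
obstruction of §9 is exactly the orientation of the letter relative to `Fin.last`, i.e. a
transposition is precisely what rule (2) must supply.  Landed as `Negative/RuleTwoTightness.lean`. -/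

section Mirror

open MvPolynomial Literature.ModelTheory.ExponentialFields

/-! ### The closed-fibre band over `Δ₁` and its pieces (mirror witness) -/

/-- The band `{(t₀,t₁) | 0 < t₀ < 1, 0 ≤ t₁ ≤ t₀}` in the format of the Newton–Leibniz move over
the base `oneRep = [Δ₁, 1]`. -/
def mirrorBand : Set (Fin 2 → ℝ) :=
  {z | (Fin.init z : Fin 1 → ℝ) ∈ oneRep.domain ∧ (fun _ : Fin 1 → ℝ => (0 : ℝ)) (Fin.init z) ≤ z (Fin.last 1) ∧
    z (Fin.last 1) ≤ (fun x : Fin 1 → ℝ => x 0) (Fin.init z)}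

/-- Membership in the band, in coordinates. [folklore] -/
theorem mem_mirrorBand {z : Fin 2 → ℝ} :
    z ∈ mirrorBand ↔ 0 < z 0 ∧ z 0 < 1 ∧ 0 ≤ z 1 ∧ z 1 ≤ z 0 := by
  simp only [mirrorBand, oneRep_domain, simplex_one, mem_setOf_eq]
  show ((0 < z 0 ∧ z 0 < 1) ∧ 0 ≤ z 1 ∧ z 1 ≤ z 0) ↔ _
  tauto

/-- The band is `ℚ`-semialgebraic (four polynomial inequalities). [folklore] -/
theorem isSemialgebraic_mirrorBand : IsSemialgebraic ℚ mirrorBand := by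
  have h1 := isSemialgebraic_setOf_eval_lt (k := ℚ) (R := ℝ) (ι := Fin 2) (C 0) (X 0)
  have h2 := isSemialgebraic_setOf_eval_lt (k := ℚ) (R := ℝ) (ι := Fin 2) (X 0) (C 1)
  have h3 := isSemialgebraic_setOf_eval_le (k := ℚ) (R := ℝ) (ι := Fin 2) (C 0) (X 1)
  have h4 := isSemialgebraic_setOf_eval_le (k := ℚ) (R := ℝ) (ι := Fin 2) (X 1) (X 0)
  have hEq : mirrorBand = (({x : Fin 2 → ℝ | aeval x (C 0 : MvPolynomial (Fin 2) ℚ) < aeval x (X 0 : MvPolynomial (Fin 2) ℚ)} ∩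
      {x : Fin 2 → ℝ | aeval x (X 0 : MvPolynomial (Fin 2) ℚ) < aeval x (C 1 : MvPolynomial (Fin 2) ℚ)}) ∩
      {x : Fin 2 → ℝ | aeval x (C 0 : MvPolynomial (Fin 2) ℚ) ≤ aeval x (X 1 : MvPolynomial (Fin 2) ℚ)}) ∩
      {x : Fin 2 → ℝ | aeval x (X 1 : MvPolynomial (Fin 2) ℚ) ≤ aeval x (X 0 : MvPolynomial (Fin 2) ℚ)} := by
    ext z
    simp only [mem_mirrorBand, mem_inter_iff, mem_setOf_eq, map_zero, aeval_X, map_one]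
    tauto
  rw [hEq]
  exact ((h1.inter h2).inter h3).inter h4

/-- `Δ₂` lies in the band. [folklore] -/
theorem simplex_subset_mirrorBand : simplex 2 ⊆ mirrorBand := by
  rintro z ⟨h0, h1, hanti⟩
  rw [mem_mirrorBand]
  have : z 1 < z 0 := hanti (show (0 : Fin 2) < 1 by decide)
  exact ⟨h0 0, h1 0, (h0 1).le, this.le⟩

/-- The band minus `Δ₂` lies in two lines. [folklore] -/
theorem mirrorBand_diff_subset :
    mirrorBand \ simplex 2 ⊆ {z : Fin 2 → ℝ | z 1 = 0} ∪ {z | z 1 = z 0} := by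
  rintro z ⟨hz, hz'⟩
  rw [mem_mirrorBand] at hz
  obtain ⟨h0, h1, h2, h3⟩ := hz
  by_contra hcon
  simp only [mem_union, mem_setOf_eq, not_or] at hcon
  apply hz'
  have h2' : 0 < z 1 := lt_of_le_of_ne h2 (Ne.symm hcon.1)
  have h3' : z 1 < z 0 := lt_of_le_of_ne h3 hcon.2
  refine ⟨fun i => ?_, fun i => ?_, ?_⟩
  · fin_cases i <;> assumption
  · fin_cases i
    · exact h1
    · exact h3'.trans h1
  · intro i j hij
    fin_cases i <;> fin_cases j
    · exact absurd hij (lt_irrefl _)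
    · exact h3'
    · exact absurd hij (by decide)
    · exact absurd hij (lt_irrefl _)

/-- The diagonal `{t₁ = t₀}` of `ℝ²` is Lebesgue-null (a strict subspace). [folklore] -/
theorem volume_setOf_apply_one_eq_apply_zero : volume {z : Fin 2 → ℝ | z 1 = z 0} = 0 := by
  let L : (Fin 2 → ℝ) →ₗ[ℝ] ℝ :=
    LinearMap.proj (R := ℝ) (ι := Fin 2) (φ := fun _ => ℝ) 1 -
      LinearMap.proj (R := ℝ) (ι := Fin 2) (φ := fun _ => ℝ) 0
  have hS : {z : Fin 2 → ℝ | z 1 = z 0} = (LinearMap.ker L : Set (Fin 2 → ℝ)) := by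
    ext z
    simp [L, sub_eq_zero]
  rw [hS]
  refine Measure.addHaar_submodule volume (LinearMap.ker L) ?_
  intro htop
  have : (![1, 0] : Fin 2 → ℝ) ∈ LinearMap.ker L := by rw [htop]; trivial
  simp [L] at this

/-- The band minus `Δ₂` is Lebesgue-null. [folklore] -/
theorem volume_mirrorBand_diff : volume (mirrorBand \ simplex 2) = 0 :=
  measure_mono_null mirrorBand_diff_subset
    (measure_union_null (volume_setOf_apply_eq 1 0) volume_setOf_apply_one_eq_apply_zero)

/-- `1/t₀` is absolutely integrable on `Δ₂` (dominated by the `ζ(2)` integrand). [folklore] -/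
theorem integrableOn_one_div_apply_zero : IntegrableOn (fun t : Fin 2 → ℝ => 1 / t 0) (simplex 2) := by
  have hg : IntegrableOn zeta2Rep.integrand (simplex 2) := zeta2Rep.integrableOn
  refine Integrable.mono' hg ?_ ?_
  · exact ((measurable_pi_apply 0).const_div 1).aestronglyMeasurable
  · rw [show simplex 2 = KZ.openOrderedSimplex 2 from rfl,
      ae_restrict_iff' (KZ.measurableSet_openOrderedSimplex 2)]
    refine ae_of_all _ fun t ht => ?_
    obtain ⟨h0, h1, -⟩ := ht
    have ht0 : 0 < t 0 := h0 0
    have ht1 : 0 < 1 - t 1 := by linarith [h1 1]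
    have ht1' : 1 - t 1 ≤ 1 := by linarith [h0 1]
    rw [zeta2Rep_integrand, Real.norm_eq_abs, abs_of_pos (by positivity)]
    rw [div_mul_div_comm, one_mul, div_le_div_iff₀ ht0 (by positivity)]
    nlinarith

/-- `1/t₀` is absolutely integrable on the band (it differs from `Δ₂` by a null set). [folklore] -/
theorem integrableOn_one_div_apply_zero_band : IntegrableOn (fun t : Fin 2 → ℝ => 1 / t 0) mirrorBand := by
  have hN : IntegrableOn (fun t : Fin 2 → ℝ => 1 / t 0) (mirrorBand \ simplex 2) := by
    rw [IntegrableOn, Measure.restrict_eq_zero.2 volume_mirrorBand_diff]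
    exact integrable_zero_measure
  have h := integrableOn_one_div_apply_zero.union hN
  rw [union_sdiff_cancel simplex_subset_mirrorBand] at h
  exact h

/-- **The band representation** `[band, 1/t₀]`. -/
def bandRep : KZ.IntegralRep 2 where
  domain := mirrorBand
  integrand t := 1 / t 0
  isSemialgebraic_domain := isSemialgebraic_mirrorBand
  isSemialgebraicFunOn_integrand :=
    (isSemialgebraicFunOn_aeval_div_aeval isSemialgebraic_mirrorBand 1 (X 0) fun z hz => by
      rw [mem_mirrorBand] at hz; simpa using hz.1.ne').congr fun z _ => by simp
  integrableOn := integrableOn_one_div_apply_zero_band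

/-- **The mirror witness** `[Δ₂, 1/t₀]` (the letter `1/t` at the FIRST coordinate). -/
def mirrorRep : KZ.IntegralRep 2 :=
  bandRep.restrict (simplex 2) (KZ.isSemialgebraic_openOrderedSimplex 2) simplex_subset_mirrorBand

/-- The null representation on the two boundary lines. -/
def nullRep : KZ.IntegralRep 2 :=
  bandRep.restrict (mirrorBand \ simplex 2)
    (isSemialgebraic_mirrorBand.diff (KZ.isSemialgebraic_openOrderedSimplex 2)) sdiff_subset

/-- `[Δ₂, 1/t₀]` has the genus-zero shape of the crux (`P = 1`, `b = (1,0)`, `c = 0`, `a = 0`). [folklore] -/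
theorem isGenusZero_mirrorRep : IsGenusZero mirrorRep := by
  refine ⟨1, fun _ _ => 0, ![1, 0], ![0, 0], rfl, ?_⟩
  intro t _
  show 1 / t 0 = _
  simp [gzIntegrand, Fin.prod_univ_two]

/-! ### The closed interval over the point and the constant -/

/-- The closed unit interval in the band format over `ℝ⁰`. -/
def iccSet : Set (Fin 1 → ℝ) :=
  {z | (Fin.init z : Fin 0 → ℝ) ∈ simplex 0 ∧ (fun _ : Fin 0 → ℝ => (0 : ℝ)) (Fin.init z) ≤ z (Fin.last 0) ∧
    z (Fin.last 0) ≤ (fun _ : Fin 0 → ℝ => (1 : ℝ)) (Fin.init z)}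

/-- Every point of `ℝ⁰` lies in `Δ₀`. [folklore] -/
theorem mem_simplex_zero (x : Fin 0 → ℝ) : x ∈ simplex 0 :=
  ⟨fun i => i.elim0, fun i => i.elim0, fun i => i.elim0⟩

/-- Membership in `iccSet`. [folklore] -/
theorem mem_iccSet {z : Fin 1 → ℝ} : z ∈ iccSet ↔ 0 ≤ z 0 ∧ z 0 ≤ 1 := by
  simp only [iccSet, mem_setOf_eq, mem_simplex_zero, true_and]
  rfl

/-- `iccSet` is `ℚ`-semialgebraic. [folklore] -/
theorem isSemialgebraic_iccSet : IsSemialgebraic ℚ iccSet := by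
  have h1 := isSemialgebraic_setOf_eval_le (k := ℚ) (R := ℝ) (ι := Fin 1) (C 0) (X 0)
  have h2 := isSemialgebraic_setOf_eval_le (k := ℚ) (R := ℝ) (ι := Fin 1) (X 0) (C 1)
  have hEq : iccSet = {x : Fin 1 → ℝ | aeval x (C 0 : MvPolynomial (Fin 1) ℚ) ≤ aeval x (X 0 : MvPolynomial (Fin 1) ℚ)} ∩
      {x : Fin 1 → ℝ | aeval x (X 0 : MvPolynomial (Fin 1) ℚ) ≤ aeval x (C 1 : MvPolynomial (Fin 1) ℚ)} := by
    ext z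
    simp only [mem_iccSet, mem_inter_iff, mem_setOf_eq, map_zero, aeval_X, map_one]
  rw [hEq]
  exact h1.inter h2

/-- `[ [0,1], 1 ]`. -/
def iccRep : KZ.IntegralRep 1 where
  domain := iccSet
  integrand _ := 1
  isSemialgebraic_domain := isSemialgebraic_iccSet
  isSemialgebraicFunOn_integrand := (isSemialgebraicFunOn_aeval isSemialgebraic_iccSet 1).congr fun z _ => by simp
  integrableOn := by
    refine integrableOn_const ?_
    refine ne_of_lt (lt_of_le_of_lt (measure_mono (fun z hz => ?_ : iccSet ⊆ Set.Icc (0 : Fin 1 → ℝ) 1)) ?_)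
    · rw [mem_iccSet] at hz
      exact ⟨fun i => by fin_cases i; exact hz.1, fun i => by fin_cases i; exact hz.2⟩
    · rw [Real.volume_Icc_pi]; simp

/-- `Δ₁ ⊆ [0,1]`. [folklore] -/
theorem simplex_one_subset_iccSet : simplex 1 ⊆ iccSet := by
  intro z hz
  rw [simplex_one] at hz
  rw [mem_iccSet]
  exact ⟨hz.1.le, hz.2.le⟩

/-- The two endpoints. -/
def endsRep : KZ.IntegralRep 1 :=
  iccRep.restrict (iccSet \ simplex 1) (isSemialgebraic_iccSet.diff (KZ.isSemialgebraic_openOrderedSimplex 1))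
    sdiff_subset

/-- The endpoints are null. [folklore] -/
theorem volume_iccSet_diff : volume (iccSet \ simplex 1) = 0 := by
  refine measure_mono_null (fun z hz => ?_) (measure_union_null (volume_setOf_apply_eq (n := 0) 0 0)
    (volume_setOf_apply_eq (n := 0) 0 1))
  obtain ⟨hz, hz'⟩ := hz
  rw [mem_iccSet] at hz
  rw [simplex_one] at hz'
  simp only [mem_setOf_eq, not_and, not_lt] at hz'
  simp only [mem_union, mem_setOf_eq]
  rcases hz.1.lt_or_eq with h | h
  · exact Or.inr (le_antisymm hz.2 (hz' h))
  · exact Or.inl h.symm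

/-- The constant `[pt, 1]` as a word representation of length `0`. -/
def ptRep : KZ.IntegralRep 0 where
  domain := simplex 0
  integrand _ := 1
  isSemialgebraic_domain := KZ.isSemialgebraic_openOrderedSimplex 0
  isSemialgebraicFunOn_integrand :=
    (isSemialgebraicFunOn_aeval (KZ.isSemialgebraic_openOrderedSimplex 0) 1).congr fun z _ => by simp
  integrableOn := integrableOn_const (by
    rw [show simplex 0 = univ from eq_univ_of_forall mem_simplex_zero, volume_pi, Measure.pi_univ]; simp)

/-- `[pt, 1]` is a generator of the word closure. [folklore] -/
theorem of_ptRep_mem_wordRepSet : KZ.of ptRep ∈ wordRepSet :=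
  ⟨0, Fin.elim0, 1, ptRep, rfl, fun t _ => by simp [ptRep], rfl⟩

/-! ### The chain, inside `relationsWithoutCoV` -/

/-- Domain additivity lies in the sub-calculus. [folklore] -/
theorem domainAdd_subset : KZ.domainAddRel ⊆ (relationsWithoutCoV : Set KZ.FormalRep) := fun _ hc =>
  AddSubgroup.subset_closure (Or.inl (Or.inl hc))

/-- Newton–Leibniz lies in the sub-calculus. [folklore] -/
theorem newtonLeibniz_subset : KZ.newtonLeibnizRel ⊆ (relationsWithoutCoV : Set KZ.FormalRep) := fun _ hc =>
  AddSubgroup.subset_closure (Or.inr hc)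

/-- A representation on a null domain lies in the sub-calculus (`[N] − [N] − [N]` is a
domain-additivity instance). [folklore] -/
theorem of_mem_relationsWithoutCoV_of_null {n : ℕ} (r : KZ.IntegralRep n) (h : volume r.domain = 0) :
    KZ.of r ∈ relationsWithoutCoV := by
  have h1 : KZ.of r - KZ.of r - KZ.of r ∈ relationsWithoutCoV :=
    domainAdd_subset ⟨n, r, r, r, (union_self _).symm, by rwa [inter_self], fun _ _ => rfl,
      fun _ _ => rfl, rfl⟩
  have : KZ.of r - KZ.of r - KZ.of r = -KZ.of r := by abel
  rw [this] at h1
  exact neg_mem_iff.1 h1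

/-- `[band] − [Δ₂ piece] − [null piece]` is a domain-additivity instance. [folklore] -/
theorem band_split : KZ.of bandRep - KZ.of mirrorRep - KZ.of nullRep ∈ KZ.domainAddRel := by
  refine ⟨2, bandRep, mirrorRep, nullRep, ?_, ?_, fun _ _ => rfl, fun _ _ => rfl, rfl⟩
  · exact (union_sdiff_cancel simplex_subset_mirrorBand).symm
  · show volume (simplex 2 ∩ (mirrorBand \ simplex 2)) = 0
    rw [inter_sdiff_self]; exact measure_empty

/-- `[band, 1/t₀] − [Δ₁, 1]` is ONE Newton–Leibniz move with the primitive `t₁/t₀`. [folklore] -/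
theorem band_newtonLeibniz : KZ.of bandRep - KZ.of oneRep ∈ KZ.newtonLeibnizRel := by
  refine ⟨1, bandRep, oneRep, fun _ => (0 : ℝ), fun x => x 0, fun z => z 1 / z 0, ?_, ?_, ?_, ?_, rfl,
    ?_, ?_, ?_, rfl⟩
  · exact (isSemialgebraicFunOn_aeval_div_aeval isSemialgebraic_mirrorBand (X 1) (X 0) fun z hz => by
      rw [mem_mirrorBand] at hz; simpa using hz.1.ne').congr fun z _ => by simp
  · exact (isSemialgebraicFunOn_natCast oneRep.isSemialgebraic_domain 0).congr fun x _ => by simp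
  · exact (isSemialgebraicFunOn_aeval oneRep.isSemialgebraic_domain (X 0)).congr fun x _ => by simp
  · intro x hx
    rw [oneRep_domain, simplex_one] at hx
    exact hx.1.le
  · intro x _
    have h0 : ∀ t : ℝ, (Fin.snoc x t : Fin 2 → ℝ) 0 = x 0 := fun t => by simp [Fin.snoc]
    have h1 : ∀ t : ℝ, (Fin.snoc x t : Fin 2 → ℝ) 1 = t := fun t => by simp [Fin.snoc]
    simp only [h0, h1]
    fun_prop
  · intro x hx t _
    rw [oneRep_domain, simplex_one] at hx
    have h0 : ∀ s : ℝ, (Fin.snoc x s : Fin 2 → ℝ) 0 = x 0 := fun s => by simp [Fin.snoc]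
    have h1 : ∀ s : ℝ, (Fin.snoc x s : Fin 2 → ℝ) 1 = s := fun s => by simp [Fin.snoc]
    show HasDerivAt (fun s : ℝ => (Fin.snoc x s : Fin 2 → ℝ) 1 / (Fin.snoc x s : Fin 2 → ℝ) 0)
      (1 / (Fin.snoc x t : Fin 2 → ℝ) 0) t
    simp only [h0, h1]
    have hd := (hasDerivAt_id t).div_const (x 0)
    simp only [id, one_div] at hd ⊢
    exact hd
  · intro x hx
    rw [oneRep_domain, simplex_one] at hx
    have h0 : ∀ s : ℝ, (Fin.snoc x s : Fin 2 → ℝ) 0 = x 0 := fun s => by simp [Fin.snoc]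
    have h1 : ∀ s : ℝ, (Fin.snoc x s : Fin 2 → ℝ) 1 = s := fun s => by simp [Fin.snoc]
    rw [oneRep_integrand]
    simp only [h0, h1]
    field_simp [hx.1.ne']
    ring

/-- `[[0,1]] − [Δ₁] − [endpoints]` is a domain-additivity instance. [folklore] -/
theorem icc_split : KZ.of iccRep - KZ.of oneRep - KZ.of endsRep ∈ KZ.domainAddRel := by
  refine ⟨1, iccRep, oneRep, endsRep, ?_, ?_, fun x _ => (oneRep_integrand x).symm, fun _ _ => rfl, rfl⟩
  · show iccSet = simplex 1 ∪ (iccSet \ simplex 1)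
    exact (union_sdiff_cancel simplex_one_subset_iccSet).symm
  · show volume (simplex 1 ∩ (iccSet \ simplex 1)) = 0
    rw [inter_sdiff_self]; exact measure_empty

/-- `[[0,1], 1] − [pt, 1]` is ONE Newton–Leibniz move with the primitive `t`. [folklore] -/
theorem icc_newtonLeibniz : KZ.of iccRep - KZ.of ptRep ∈ KZ.newtonLeibnizRel := by
  refine ⟨0, iccRep, ptRep, fun _ => (0 : ℝ), fun _ => (1 : ℝ), fun z => z 0, ?_, ?_, ?_,
    fun _ _ => zero_le_one, rfl, ?_, ?_, ?_, rfl⟩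
  · exact (isSemialgebraicFunOn_aeval isSemialgebraic_iccSet (X 0)).congr fun z _ => by simp
  · exact (isSemialgebraicFunOn_natCast ptRep.isSemialgebraic_domain 0).congr fun x _ => by simp
  · exact (isSemialgebraicFunOn_natCast ptRep.isSemialgebraic_domain 1).congr fun x _ => by simp
  · intro x _
    have : ∀ t : ℝ, (Fin.snoc x t : Fin 1 → ℝ) 0 = t := fun t => by simp [Fin.snoc]
    simp only [this]
    exact continuousOn_id
  · intro x _ t _
    have : ∀ s : ℝ, (Fin.snoc x s : Fin 1 → ℝ) 0 = s := fun s => by simp [Fin.snoc]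
    simp only [this]
    exact hasDerivAt_id t
  · intro x _
    have : ∀ s : ℝ, (Fin.snoc x s : Fin 1 → ℝ) 0 = s := fun s => by simp [Fin.snoc]
    simp only [this]
    show (1 : ℝ) = 1 - 0
    ring

/-- **TIGHTNESS of the rule-(2) obstruction.** The mirror image `[Δ₂, 1/t₀]` of the witness (the
letter at the FIRST coordinate) DOES close without rule (2): closing null faces (two
domain-additivity moves and their null pieces), one Newton–Leibniz move with primitive `t₁/t₀`
down to `[Δ₁, 1]`, closing the endpoints, and one Newton–Leibniz move with primitive `t` down to
the word representation `[pt, 1]` — six instances of (1a)/(3).  So the obstruction of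
`not_cruxWithoutChangeOfVariables` is exactly the ORIENTATION of the letter relative to the last
coordinate: what rule (2) must supply is a transposition. [folklore] -/
theorem cruxWithoutChangeOfVariables_mirror :
    ∃ m ∈ AddSubgroup.closure wordRepSet, KZ.of mirrorRep - m ∈ relationsWithoutCoV := by
  refine ⟨KZ.of ptRep, AddSubgroup.subset_closure of_ptRep_mem_wordRepSet, ?_⟩
  have e1 := domainAdd_subset band_split
  have e2 : KZ.of nullRep ∈ relationsWithoutCoV := of_mem_relationsWithoutCoV_of_null _ volume_mirrorBand_diff
  have e3 := newtonLeibniz_subset band_newtonLeibniz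
  have e4 := domainAdd_subset icc_split
  have e5 : KZ.of endsRep ∈ relationsWithoutCoV := of_mem_relationsWithoutCoV_of_null _ volume_iccSet_diff
  have e6 := newtonLeibniz_subset icc_newtonLeibniz
  have key : KZ.of mirrorRep - KZ.of ptRep =
      (-(KZ.of bandRep - KZ.of mirrorRep - KZ.of nullRep) - KZ.of nullRep + (KZ.of bandRep - KZ.of oneRep)) +
      (-(KZ.of iccRep - KZ.of oneRep - KZ.of endsRep) - KZ.of endsRep + (KZ.of iccRep - KZ.of ptRep)) := by
    abel
  rw [key]
  exact add_mem (add_mem (sub_mem (neg_mem e1) e2) e3) (add_mem (sub_mem (neg_mem e4) e5) e6)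


end Mirror

/-- **Rule (2) is load-bearing** (the statement of §5, now a theorem: `RuleTwo` §9).  The crux
with `relations` replaced by the sub-calculus (1a)+(1b)+(3) is FALSE. [folklore] -/
theorem dihedralNormalForm_false_without_changeOfVariables : ¬ CruxWithoutChangeOfVariables :=
  fun h => RuleTwo.not_cruxWithoutChangeOfVariables fun k r hr => h k r hr

end Summit.KontsevichZagierPeriods.KontsevichZagierPeriods.Cruxes.DihedralNormalForm.Disproof
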